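import Literature.MathematicalPhysics.KineticTheory.TaggedSphereLinearBoltzmann
import Literature.MathematicalPhysics.KineticTheory.LinearLorentzBoltzmannProofs
import HarnessLib

/-!
# BGSR's linear Boltzmann equation (1.3): the collision series, well-posedness in the class
# `IsTaggedLinearBoltzmannSolution`, and the maximum principle
(Bodineau–Gallagher–Saint-Raymond, Invent. Math. 203 (2016) = arXiv:1305.3397v2; trunk T-KINETIC,
topic MathematicalPhysics/KineticTheory; serves the named facts `Hilbert6.bgsr_theorem22`
(`TaggedSphereLinearBoltzmann`, fact (c) `bodineau_gallagher_saintRaymond_linear`) and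
`Hilbert6.bgsr_linearBoltzmannApprox` (`TaggedSphereDiffusion`, fact (d)))

BGSR's Theorem 2.2 compares the tagged-sphere distribution `f_N^{(1)}(t)` with `M_β φ_α(t)`,
"where `φ_α` is the solution of the linear Boltzmann equation (1.3) with initial data `ρ⁰`":
`∂ₜ φ + v·∇ₓ φ = -α L φ`, `(L φ)(v) = ∫∫ [φ(v) - φ(v')] M_β(v₁) ((v - v₁)·ν)₊ dν dv₁` (p. 4),
and uses the maximum principle `sup_{t ≥ 0} φ_α(t) ≤ ‖ρ⁰‖_{L^∞}` (Remark 3.5). The vendored forms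
of Thm 2.2 (`BgsrTheorem22At`, `bgsr_linearBoltzmannApprox`) quantify `φ_α` existentially in the
class `Hilbert6.IsTaggedLinearBoltzmannSolution β α ρ⁰` (datum `ρ⁰`, jointly continuous and
bounded on slabs, `M_β φ_α` a mild solution of `∂ₜ g + v·∇ₓ g = α Q(g, M_β)` with the hard-sphere
kernel). This file PROVES that this class is inhabited, with the maximum principle, by an
explicit solution — the collision (Dyson–Duhamel) series — for every `β > 0`, `α ≥ 0` and
continuous `0 ≤ ρ⁰ ≤ R`, on any position geometry with continuous translations (torus or whole
space). This is the well-posedness layer of the bottom-up proof plan of fact (c) recorded in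
`TaggedSphereLinearBoltzmann`; it reduces the sequence form of Thm 2.2 to the convergence of
`f_N^{(1)}` towards this explicit solution (`bgsrTheorem22At_of_series`).

## What is proved

* `Hilbert6.linearBoltzmannGain` — the gain operator `K⁺_β` of (1.3) (`L = a_β - K⁺_β`, BGSR
  §6.1.2), with its algebra (`K⁺ 1 = a_β`, positivity, monotonicity and additivity on
  quadratically bounded functions, `|K⁺ φ| ≤ a_β ‖φ‖_∞`), the linear growth
  `a_β(v) ≤ |S^{d-1}| (|v| + m₁)` of the collision frequency, its continuity, the **parametric
  continuity** of `K⁺` (compact sphere inside, dominated convergence outside), and the **energy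
  drift inequality** `K⁺_β(1 + |·|²)(v) ≤ a_β(v)(1 + |v|²) + |S^{d-1}| (|v| m₂ + m₃)`
  (conservation of kinetic energy in `collide`; Gaussian moments
  `Kinetic.integrable_pow_norm_mul_maxwellianBeta`).
* `Hilbert6.gainDuhamel`, `Hilbert6.linearBoltzmannTerm`, `Hilbert6.linearBoltzmannSeries` —
  the gain Duhamel map `𝒯`, the terms `u₀ = e^{-α a t} f₀(x - tv, v)`, `u_{n+1} = 𝒯 uₙ` and the
  series `φ_α = ∑ₙ uₙ` of (1.3) in gain/loss form; for admissible data (`LinearBoltzmannData`: continuous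
  translations, `β > 0`, `α ≥ 0`, continuous `0 ≤ f₀ ≤ R`) the terms are jointly continuous with
  values in `[0, R]`, the partial sums satisfy the Picard recursion `Sₙ₊₁ = u₀ + 𝒯 Sₙ` and the
  **maximum principle** `Sₙ ≤ R` (`𝒯 R = R (1 - e^{-α a t})`), whence summability,
  `0 ≤ φ_α ≤ R` (`LinearBoltzmannData.linearBoltzmannSeries_mem`, BGSR Remark 3.5 for this solution) and,
  by dominated convergence, the fixed-point equation `φ_α = u₀ + 𝒯 φ_α`
  (`LinearBoltzmannData.linearBoltzmannSeries_eq`).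
* **Conservativity** (`linearBoltzmannSeries_one`: the series with datum `1` is `1`): the
  tails `pₙ = 1 - Sₙ[1]` satisfy `p_{n+1} = 𝒯 pₙ` and `∑_{k ≤ n} p_k ≤ F` for the Lyapunov
  supersolution `F(t, v) = α c_a (e^{(α C_D + 1) t} - 1)(1 + |v|²)` of `𝒯 (1 + F) ≤ F`
  (`gainDuhamel_le_collisionMajorant`, from the drift inequality and the fundamental theorem of
  calculus), so `pₙ ≤ F/n → 0` pointwise although the collision frequency is unbounded.
* **Continuity** (`LinearBoltzmannData.continuous_linearBoltzmannSeries`): `φ_α[f₀]` and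
  `φ_α[R - f₀] = R - φ_α[f₀]` (linearity + conservativity) are suprema of continuous partial
  sums, hence both lower semicontinuous.
* **Mild form** (`LinearBoltzmannData.isMildLinearBoltzmannSolutionOn`): `M_β φ_α` is a mild solution of
  `∂ₜ g + v·∇ₓ g = Q_{αB}(g, M_β)` in the accepted sense `Kinetic.IsMildLinearBoltzmannSolutionOn`
  on every `[0, T]` — detailed balance `M_β(v') M_β(v₁') = M_β(v) M_β(v₁)` gives
  `Q_{αB}(M_β φ, M_β) = α M_β (K⁺_β φ - a_β φ)` (`collisionOpWith_maxwellian_mul`), and the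
  integrating-factor form along characteristics is converted to Duhamel's form by variation of
  constants (`eq_add_integral_of_expForm`).
* `Hilbert6.isTaggedLinearBoltzmannSolution_linearBoltzmannSeries`,
  `Hilbert6.exists_isTaggedLinearBoltzmannSolution` — on `T^d`: for `β > 0`, `α ≥ 0`, continuous
  `0 ≤ ρ⁰ ≤ R`, the series is an `IsTaggedLinearBoltzmannSolution β α ρ⁰` with `0 ≤ φ ≤ R`.
* `Hilbert6.bgsrTheorem22At_of_series` — `BgsrTheorem22At α` follows from the convergence of
  `f_N^{(1)}` to `M_β` times the series solution (`BgsrSeriesConvergenceAt α`, an UpperCamelCase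
  statement predicate asserted nowhere): what remains of Thm 2.2 is its derivation part
  (BGSR §§3–5).
* **Uniqueness** (`eq_of_isMildLinearBoltzmannSolutionOn`, general geometry;
  `IsTaggedLinearBoltzmannSolution.unique`, `.eq_linearBoltzmannSeries` on `T^d`): the bounded
  continuous class is a uniqueness class — a mild solution in the class solves the gain/loss
  equation in integrating-factor form along characteristics (`expForm_of_eq_add_integral`,
  variation of constants backwards), so the difference `w` of two solutions satisfies `w = 𝒯 w`,
  `|w| ≤ ‖w‖_∞ pₙ → 0`. Hence "the solution `φ_α`" of BGSR is the collision series, and every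
  solution in the class obeys the maximum principle (`IsTaggedLinearBoltzmannSolution.mem_Icc`;
  the datum of a member of the class is automatically continuous, nonnegative and bounded,
  `IsTaggedLinearBoltzmannSolution.datum`).

## Design choices

* Times are clamped at `t⁺ = max t 0` in the terms, so that all objects are defined, bounded and
  continuous on `ℝ × X × ℝ^d` (negative times carry the time-`0` value); the mild formulation
  only sees `t ≥ 0`.
* Everything is done on a general `Kinetic.Geometry d X` with continuous translations and for a
  general jointly continuous datum `f₀(x, v)`; `X` is assumed locally compact and first countable
  where joint continuity of parametric integrals is used (true for `T^d` and `ℝ^d`).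
* Existence, the maximum principle and uniqueness are all proved for `β > 0`, `α ≥ 0` (the
  vendored statements only use `α > 1`).
* Relation to `Kinetic.existsUnique_mildLinearBoltzmann` (named fact of
  `Literature.Analysis.FunctionSpaces.LorentzGas`, undischarged): that fact asserts existence and
  uniqueness in the Maxwellian-weighted continuous class for the background `globalMaxwellian`
  (`= maxwellianBeta 1`), an arbitrary continuous Grad cut-off kernel and an arbitrary
  topological position space. The present file proves the hard-sphere-kernel case for every
  `M_β`, on locally compact first countable position spaces (where dominated convergence along
  sequences gives joint continuity); it does not discharge the general-kernel statement.
* `LinearBoltzmannData` is a `Prop`-valued structure bundling the standing hypotheses (dot notation).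
  Bochner integrals throughout (junk value `0`), iterated in the order of `linearBoltzmannOp`.

## References

* T. Bodineau, I. Gallagher, L. Saint-Raymond, *The Brownian motion as the limit of a
  deterministic system of hard-spheres*, Invent. Math. 203 (2016) 493–553 = arXiv:1305.3397v2:
  (1.3) (p. 4), Thm 2.2 (p. 7), Remark 3.5 (maximum principle for (1.3)), §6.1.2
  (`L = a(v) Id - K`).
* C. Cercignani, R. Illner, M. Pulvirenti, *The Mathematical Theory of Dilute Gases*, Springer
  (1994), §3.1 (collision invariants, detailed balance).
-/

open MeasureTheory Metric Real Set Filter Topology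
open scoped InnerProductSpace ENNReal Interval

namespace Literature.MathematicalPhysics.KineticTheory

noncomputable section

section Kinetic

variable {d : Type*} [Fintype d]

/-! ## Gaussian moments of the Maxwellian -/

/-- Polynomial moments of the Maxwellian are finite: `∫ |v|^k M_β(v) dv < ∞` for `β > 0`
(`|v|^k ≤ 1 + |v|^{2k} ≤ 1 + (4/β)^k k! e^{β|v|²/4}`). [folklore] -/
theorem integrable_pow_norm_mul_maxwellianBeta {β : ℝ} (hβ : 0 < β) (k : ℕ) :
    Integrable (fun v : EuclideanSpace ℝ d => ‖v‖ ^ k * Literature.Analysis.FunctionSpaces.maxwellianBeta β v) := by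
  set c := β / 4 with hc_def
  have hc : 0 < c := by positivity
  set A : ℝ := (2 * Real.pi * β⁻¹) ^ (-(Module.finrank ℝ (EuclideanSpace ℝ d) : ℝ) / 2) with hA_def
  have hA : 0 < A := Real.rpow_pos_of_pos (by positivity) _
  have hg1 : Integrable (fun v : EuclideanSpace ℝ d => exp (-(β / 2) * ‖v‖ ^ 2)) :=
    Literature.Analysis.FluidPDE.integrable_exp_neg_mul_sq_norm (half_pos hβ)
  have hg2 : Integrable (fun v : EuclideanSpace ℝ d => exp (-c * ‖v‖ ^ 2)) :=
    Literature.Analysis.FluidPDE.integrable_exp_neg_mul_sq_norm hc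
  have hdom : Integrable (fun v : EuclideanSpace ℝ d =>
      A * exp (-(β / 2) * ‖v‖ ^ 2) + A * (c⁻¹ ^ k * k.factorial) * exp (-c * ‖v‖ ^ 2)) :=
    (hg1.const_mul A).add (hg2.const_mul _)
  refine hdom.mono' ?_ (Eventually.of_forall fun v => ?_)
  · exact ((continuous_norm.pow k).mul (continuous_maxwellianBeta β)).aestronglyMeasurable
  · have hM := maxwellianBeta_eq β v
    rw [Real.norm_of_nonneg (mul_nonneg (pow_nonneg (norm_nonneg _) _)
      (Literature.Analysis.FunctionSpaces.maxwellianBeta_pos hβ v).le), hM]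
    set s := ‖v‖ with hs_def
    have hs : 0 ≤ s := norm_nonneg v
    -- `s^k ≤ 1 + s^(2k)` and `s^(2k) = c⁻¹^k (c s²)^k ≤ c⁻¹^k k! e^{c s²}`
    have h1 : s ^ k ≤ 1 + s ^ (2 * k) := by
      rcases le_or_gt s 1 with h | h
      · have : s ^ k ≤ 1 := pow_le_one₀ hs h
        linarith [pow_nonneg hs (2 * k)]
      · have : s ^ k ≤ s ^ (2 * k) := pow_le_pow_right₀ h.le (by omega)
        linarith
    have h2 : s ^ (2 * k) ≤ c⁻¹ ^ k * k.factorial * exp (c * s ^ 2) := by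
      have hx : 0 ≤ c * s ^ 2 := by positivity
      have h3 := Real.pow_div_factorial_le_exp (c * s ^ 2) hx k
      rw [div_le_iff₀ (by positivity)] at h3
      have h4 : s ^ (2 * k) = c⁻¹ ^ k * (c * s ^ 2) ^ k := by
        rw [mul_pow, ← mul_assoc, ← mul_pow, inv_mul_cancel₀ hc.ne', one_pow, one_mul, pow_mul]
      rw [h4, mul_assoc]
      gcongr
      calc (c * s ^ 2) ^ k ≤ exp (c * s ^ 2) * k.factorial := h3
        _ = k.factorial * exp (c * s ^ 2) := mul_comm _ _
    have hexp : exp (c * s ^ 2) * exp (-(β / 2) * s ^ 2) = exp (-c * s ^ 2) := by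
      rw [← Real.exp_add]; congr 1; simp only [hc_def]; ring
    calc s ^ k * (A * exp (-(β / 2) * s ^ 2))
        ≤ (1 + c⁻¹ ^ k * k.factorial * exp (c * s ^ 2)) * (A * exp (-(β / 2) * s ^ 2)) := by
          gcongr; exact h1.trans (by linarith)
      _ = A * exp (-(β / 2) * s ^ 2) +
          A * (c⁻¹ ^ k * k.factorial) * (exp (c * s ^ 2) * exp (-(β / 2) * s ^ 2)) := by ring
      _ = A * exp (-(β / 2) * s ^ 2) + A * (c⁻¹ ^ k * k.factorial) * exp (-c * s ^ 2) := by rw [hexp]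

/-- The `k`-th absolute moment `∫ |v|^k M_β(v) dv` of the Maxwellian. [folklore] -/
def maxwellianMoment (d : Type*) [Fintype d] (β : ℝ) (k : ℕ) : ℝ :=
  ∫ v : EuclideanSpace ℝ d, ‖v‖ ^ k * Literature.Analysis.FunctionSpaces.maxwellianBeta β v

/-- Moments of the Maxwellian are nonnegative. [folklore] -/
theorem maxwellianMoment_nonneg {β : ℝ} (hβ : 0 < β) (k : ℕ) : 0 ≤ maxwellianMoment d β k :=
  integral_nonneg fun v => mul_nonneg (pow_nonneg (norm_nonneg _) _) (Literature.Analysis.FunctionSpaces.maxwellianBeta_pos hβ v).le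


/-- The first absolute moment bounds `∫ (|v| + |w|) M_β(w) dw = |v| + m₁`. [folklore] -/
theorem integral_norm_add_norm_mul_maxwellianBeta {β : ℝ} (hβ : 0 < β) (v : EuclideanSpace ℝ d) :
    ∫ w : EuclideanSpace ℝ d, (‖v‖ + ‖w‖) * Literature.Analysis.FunctionSpaces.maxwellianBeta β w =
      ‖v‖ + maxwellianMoment d β 1 := by
  have h0 := integrable_maxwellianBeta (d := d) hβ
  have h1 := integrable_pow_norm_mul_maxwellianBeta (d := d) hβ 1
  simp only [pow_one] at h1
  simp_rw [add_mul]
  rw [integral_add (h0.const_mul _) h1, integral_const_mul, integral_maxwellianBeta hβ, mul_one,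
    maxwellianMoment]
  simp only [pow_one]

end Kinetic

section Hilbert6

variable {d : Type*} [Fintype d]

local notation "𝔼" => EuclideanSpace ℝ d
local notation "𝕊" => sphere (0 : EuclideanSpace ℝ d) 1

/-! ## The hard-sphere kernel: elementary bounds -/

/-- `((v - w)·ω)₊ ≥ 0`. [folklore] -/
theorem hardSphereKernel_nonneg (p : 𝔼 × 𝔼) (ω : 𝕊) : 0 ≤ hardSphereKernel p ω :=
  le_max_right _ _

/-- `((v - w)·ω)₊ ≤ |v - w| ≤ |v| + |w|`. [folklore] -/
theorem hardSphereKernel_le (v w : 𝔼) (ω : 𝕊) : hardSphereKernel (v, w) ω ≤ ‖v‖ + ‖w‖ := by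
  have h := KineticTheory.abs_max_inner_zero_le (v - w) ω
  rw [abs_of_nonneg (le_max_right _ _)] at h
  exact h.trans (norm_sub_le v w)

/-- Joint continuity of the hard-sphere kernel. [folklore] -/
@[fun_prop]
theorem continuous_hardSphereKernel :
    Continuous fun q : (𝔼 × 𝔼) × 𝕊 => hardSphereKernel q.1 q.2 := by
  unfold hardSphereKernel
  fun_prop

/-- The sphere integral of the hard-sphere kernel is the Lorentz loss frequency of the relative
velocity: `∫ ((v - w)·ω)₊ dω = ν(v - w)`. [folklore] -/
theorem integral_hardSphereKernel (v w : 𝔼) :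
    ∫ ω, hardSphereKernel (v, w) ω ∂sphereMeasure = KineticTheory.lorentzLossRate (v - w) := rfl

/-! ## The gain operator `K⁺_β` of the linear Boltzmann equation -/

/-- The *gain operator* of BGSR's linear Boltzmann operator (1.3):
`(K⁺_β φ)(v) = ∫_{ℝ^d} ∫_{S^{d-1}} ((v - v₁)·ν)₊ M_β(v₁) φ(v') dν dv₁`, `v' = v - ((v - v₁)·ν) ν`,
so that `L φ = a_β φ - K⁺_β φ` with `a_β = collisionFrequency β` (BGSR §6.1.2: "`L = a(v) Id - K`
with `K` compact"). Iterated Bochner integral, same integrand order as `linearBoltzmannOp`.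
[cite: BodineauGallagherSaintRaymondInvent2016, (1.3) and §6.1.2] -/
def linearBoltzmannGain (β : ℝ) (φ : 𝔼 → ℝ) (v : 𝔼) : ℝ :=
  ∫ v₁, ∫ ν, hardSphereKernel (v, v₁) ν * Literature.Analysis.FunctionSpaces.maxwellianBeta β v₁ *
    φ (collide ν (v, v₁)).1 ∂sphereMeasure

/-- The integrand of the gain operator, `((v - w)·ν)₊ M_β(w) φ(v')`. [folklore] -/
def gainIntegrand (β : ℝ) (φ : 𝔼 → ℝ) (v w : 𝔼) (ν : 𝕊) : ℝ :=
  hardSphereKernel (v, w) ν * Literature.Analysis.FunctionSpaces.maxwellianBeta β w * φ (collide ν (v, w)).1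

/-- Unfolding of the gain operator through its integrand. [folklore] -/
theorem linearBoltzmannGain_eq (β : ℝ) (φ : 𝔼 → ℝ) (v : 𝔼) :
    linearBoltzmannGain β φ v = ∫ w, ∫ ν, gainIntegrand β φ v w ν ∂sphereMeasure := rfl

/-- The collision frequency as a Maxwellian average of Lorentz loss frequencies:
`a_β(v) = ∫ ν(v - w) M_β(w) dw`. [folklore] -/
theorem collisionFrequency_eq (β : ℝ) (v : 𝔼) :
    TaggedSphereDiffusion.collisionFrequency β v = ∫ w, KineticTheory.lorentzLossRate (v - w) * Literature.Analysis.FunctionSpaces.maxwellianBeta β w := by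
  unfold TaggedSphereDiffusion.collisionFrequency
  congr 1
  funext w
  rw [integral_mul_const, integral_hardSphereKernel]

/-- `0 ≤ ν(v - w) M_β(w) ≤ |S^{d-1}| (|v| + |w|) M_β(w)`. [folklore] -/
theorem lorentzLossRate_mul_maxwellianBeta_le {β : ℝ} (hβ : 0 < β) (v w : 𝔼) :
    KineticTheory.lorentzLossRate (v - w) * Literature.Analysis.FunctionSpaces.maxwellianBeta β w ≤
      KineticTheory.sphereMass 𝔼 * ((‖v‖ + ‖w‖) * Literature.Analysis.FunctionSpaces.maxwellianBeta β w) := by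
  have h := (KineticTheory.lorentzLossRate_le (v - w)).trans
    (mul_le_mul_of_nonneg_left (norm_sub_le v w) KineticTheory.sphereMass_nonneg)
  calc KineticTheory.lorentzLossRate (v - w) * Literature.Analysis.FunctionSpaces.maxwellianBeta β w
      ≤ KineticTheory.sphereMass 𝔼 * (‖v‖ + ‖w‖) * Literature.Analysis.FunctionSpaces.maxwellianBeta β w :=
        mul_le_mul_of_nonneg_right h (Literature.Analysis.FunctionSpaces.maxwellianBeta_pos hβ w).le
    _ = _ := by ring

/-- `w ↦ (|v| + |w|) M_β(w)` is integrable. [folklore] -/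
theorem integrable_norm_add_norm_mul_maxwellianBeta {β : ℝ} (hβ : 0 < β) (v : 𝔼) :
    Integrable fun w : 𝔼 => (‖v‖ + ‖w‖) * Literature.Analysis.FunctionSpaces.maxwellianBeta β w := by
  have h0 := KineticTheory.integrable_maxwellianBeta (d := d) hβ
  have h1 := KineticTheory.integrable_pow_norm_mul_maxwellianBeta (d := d) hβ 1
  simp only [pow_one] at h1
  simp_rw [add_mul]
  exact (h0.const_mul _).add h1

/-- `w ↦ ν(v - w) M_β(w)` is integrable. [folklore] -/
theorem integrable_lorentzLossRate_mul_maxwellianBeta {β : ℝ} (hβ : 0 < β) (v : 𝔼) :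
    Integrable fun w : 𝔼 => KineticTheory.lorentzLossRate (v - w) * Literature.Analysis.FunctionSpaces.maxwellianBeta β w := by
  refine ((integrable_norm_add_norm_mul_maxwellianBeta hβ v).const_mul
    (KineticTheory.sphereMass 𝔼)).mono' ?_ (Eventually.of_forall fun w => ?_)
  · exact ((KineticTheory.continuous_lorentzLossRate.comp (continuous_const.sub continuous_id)).mul
      (KineticTheory.continuous_maxwellianBeta β)).aestronglyMeasurable
  · rw [Real.norm_of_nonneg (mul_nonneg (KineticTheory.lorentzLossRate_nonneg _)
      (Literature.Analysis.FunctionSpaces.maxwellianBeta_pos hβ w).le)]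
    exact lorentzLossRate_mul_maxwellianBeta_le hβ v w

/-- The collision frequency is nonnegative. [folklore] -/
theorem TaggedLinearBoltzmannSeries.collisionFrequency_nonneg {β : ℝ} (hβ : 0 < β) (v : 𝔼) : 0 ≤ TaggedSphereDiffusion.collisionFrequency β v := by
  rw [collisionFrequency_eq]
  exact integral_nonneg fun w => mul_nonneg (KineticTheory.lorentzLossRate_nonneg _)
    (Literature.Analysis.FunctionSpaces.maxwellianBeta_pos hβ w).le

/-- **Linear growth of the collision frequency**: `a_β(v) ≤ |S^{d-1}| (|v| + m₁)`,
`m₁ = ∫ |w| M_β(w) dw` (BGSR §6.1.2: `a` grows linearly). [folklore] -/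
theorem collisionFrequency_le {β : ℝ} (hβ : 0 < β) (v : 𝔼) :
    TaggedSphereDiffusion.collisionFrequency β v ≤ KineticTheory.sphereMass 𝔼 * (‖v‖ + KineticTheory.maxwellianMoment d β 1) := by
  rw [collisionFrequency_eq, ← KineticTheory.integral_norm_add_norm_mul_maxwellianBeta hβ v,
    ← integral_const_mul]
  exact integral_mono (integrable_lorentzLossRate_mul_maxwellianBeta hβ v)
    ((integrable_norm_add_norm_mul_maxwellianBeta hβ v).const_mul _)
    fun w => lorentzLossRate_mul_maxwellianBeta_le hβ v w

/-- A convenient form: `a_β(v) ≤ c (1 + |v|²)` with `c = |S^{d-1}| (1 + m₁)`. [folklore] -/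
theorem collisionFrequency_le_normSq {β : ℝ} (hβ : 0 < β) (v : 𝔼) :
    TaggedSphereDiffusion.collisionFrequency β v ≤
      KineticTheory.sphereMass 𝔼 * (1 + KineticTheory.maxwellianMoment d β 1) * (1 + ‖v‖ ^ 2) := by
  refine (collisionFrequency_le hβ v).trans ?_
  rw [mul_assoc]
  refine mul_le_mul_of_nonneg_left ?_ KineticTheory.sphereMass_nonneg
  have hm := KineticTheory.maxwellianMoment_nonneg (d := d) hβ 1
  nlinarith [sq_nonneg (‖v‖ - 1), norm_nonneg v, sq_nonneg ‖v‖]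

/-! ### Measurability and integrability of the gain integrand -/

/-- Joint continuity of `(v, w, ν) ↦ v'`. [folklore] -/
@[fun_prop]
theorem continuous_collide_fst :
    Continuous fun q : (𝔼 × 𝔼) × 𝕊 => (collide q.2 q.1).1 :=
  Literature.Analysis.FluidPDE.continuous_collide_uncurry.fst

/-- For measurable `φ`, the gain integrand is jointly measurable in `(w, ν)`. [folklore] -/
theorem measurable_gainIntegrand {β : ℝ} {φ : 𝔼 → ℝ} (hφ : Measurable φ) (v : 𝔼) :
    Measurable fun p : 𝔼 × 𝕊 => gainIntegrand β φ v p.1 p.2 := by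
  have h1 : Continuous fun p : 𝔼 × 𝕊 => hardSphereKernel (v, p.1) p.2 :=
    continuous_hardSphereKernel.comp ((continuous_const.prodMk continuous_fst).prodMk continuous_snd)
  have h2 : Continuous fun p : 𝔼 × 𝕊 => (collide p.2 (v, p.1)).1 :=
    continuous_collide_fst.comp ((continuous_const.prodMk continuous_fst).prodMk continuous_snd)
  exact (h1.measurable.mul ((KineticTheory.measurable_maxwellianBeta β).comp measurable_fst)).mul
    (hφ.comp h2.measurable)

/-- The inner (sphere) integral of the gain integrand is strongly measurable in `w`. [folklore] -/
theorem aestronglyMeasurable_integral_gainIntegrand {β : ℝ} {φ : 𝔼 → ℝ} (hφ : Measurable φ)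
    (v : 𝔼) :
    AEStronglyMeasurable (fun w => ∫ ν, gainIntegrand β φ v w ν ∂sphereMeasure) volume :=
  ((measurable_gainIntegrand hφ v).stronglyMeasurable.integral_prod_right'
    (ν := (sphereMeasure : Measure 𝕊))).aestronglyMeasurable

/-- Pointwise bound on the gain integrand: `|B M φ(v')| ≤ (|v| + |w|) M_β(w) C` if `|φ| ≤ C`.
[folklore] -/
theorem abs_gainIntegrand_le {β : ℝ} (hβ : 0 < β) {φ : 𝔼 → ℝ} {C : ℝ} (hC : ∀ w, |φ w| ≤ C)
    (v w : 𝔼) (ν : 𝕊) :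
    |gainIntegrand β φ v w ν| ≤ (‖v‖ + ‖w‖) * Literature.Analysis.FunctionSpaces.maxwellianBeta β w * C := by
  rw [gainIntegrand, abs_mul, abs_mul, abs_of_nonneg (hardSphereKernel_nonneg _ _),
    abs_of_pos (Literature.Analysis.FunctionSpaces.maxwellianBeta_pos hβ w)]
  have hM := (Literature.Analysis.FunctionSpaces.maxwellianBeta_pos hβ w).le
  have hB := hardSphereKernel_nonneg (v, w) ν
  exact mul_le_mul (mul_le_mul_of_nonneg_right (hardSphereKernel_le v w ν) hM) (hC _)
    (abs_nonneg _) (mul_nonneg (add_nonneg (norm_nonneg _) (norm_nonneg _)) hM)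

/-- A bounded gain integrand is integrable on the sphere (finite measure). [folklore] -/
theorem integrable_gainIntegrand_sphere {β : ℝ} (hβ : 0 < β) {φ : 𝔼 → ℝ} (hφ : Measurable φ)
    {C : ℝ} (hC : ∀ w, |φ w| ≤ C) (v w : 𝔼) :
    Integrable (fun ν => gainIntegrand β φ v w ν) (sphereMeasure : Measure 𝕊) := by
  refine Integrable.of_bound (C := (‖v‖ + ‖w‖) * Literature.Analysis.FunctionSpaces.maxwellianBeta β w * C) ?_
    (Eventually.of_forall fun ν => ?_)
  · exact ((measurable_gainIntegrand hφ v).comp measurable_prodMk_left).aestronglyMeasurable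
  · rw [Real.norm_eq_abs]; exact abs_gainIntegrand_le hβ hC v w _

/-- Bound on the inner integral: `|∫ B M φ(v') dν| ≤ |S^{d-1}| (|v| + |w|) M_β(w) C`. [folklore] -/
theorem abs_integral_gainIntegrand_le {β : ℝ} (hβ : 0 < β) {φ : 𝔼 → ℝ} {C : ℝ}
    (hC : ∀ w, |φ w| ≤ C) (v w : 𝔼) :
    |∫ ν, gainIntegrand β φ v w ν ∂sphereMeasure| ≤
      KineticTheory.sphereMass 𝔼 * ((‖v‖ + ‖w‖) * Literature.Analysis.FunctionSpaces.maxwellianBeta β w * C) := by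
  have h : ∀ᵐ ν : 𝕊 ∂sphereMeasure, ‖gainIntegrand β φ v w ν‖ ≤
      (‖v‖ + ‖w‖) * Literature.Analysis.FunctionSpaces.maxwellianBeta β w * C :=
    Eventually.of_forall fun ν => by rw [Real.norm_eq_abs]; exact abs_gainIntegrand_le hβ hC v w ν
  have := norm_integral_le_of_norm_le_const h
  rw [Real.norm_eq_abs] at this
  calc |∫ ν, gainIntegrand β φ v w ν ∂sphereMeasure|
      ≤ (‖v‖ + ‖w‖) * Literature.Analysis.FunctionSpaces.maxwellianBeta β w * C * (sphereMeasure : Measure 𝕊).real univ := this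
    _ = KineticTheory.sphereMass 𝔼 * ((‖v‖ + ‖w‖) * Literature.Analysis.FunctionSpaces.maxwellianBeta β w * C) := by
      rw [mul_comm]; rfl

/-- The inner integral of a bounded measurable gain integrand is integrable in `w`. [folklore] -/
theorem integrable_integral_gainIntegrand {β : ℝ} (hβ : 0 < β) {φ : 𝔼 → ℝ} (hφ : Measurable φ)
    {C : ℝ} (hC : ∀ w, |φ w| ≤ C) (v : 𝔼) :
    Integrable (fun w => ∫ ν, gainIntegrand β φ v w ν ∂sphereMeasure) := by
  refine (((integrable_norm_add_norm_mul_maxwellianBeta hβ v).mul_const C).const_mul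
    (KineticTheory.sphereMass 𝔼)).mono' (aestronglyMeasurable_integral_gainIntegrand hφ v)
    (Eventually.of_forall fun w => ?_)
  rw [Real.norm_eq_abs]
  exact abs_integral_gainIntegrand_le hβ hC v w

/-- A uniform bound is a quadratic-weight bound. [folklore] -/
theorem abs_le_quad_of_abs_le {φ : 𝔼 → ℝ} {C : ℝ} (hC : ∀ w, |φ w| ≤ C) (w : 𝔼) :
    |φ w| ≤ C * (1 + ‖w‖ ^ 2) := by
  have hC0 : 0 ≤ C := (abs_nonneg _).trans (hC 0)
  calc |φ w| ≤ C := hC w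
    _ = C * 1 := (mul_one C).symm
    _ ≤ C * (1 + ‖w‖ ^ 2) := by gcongr; nlinarith [sq_nonneg ‖w‖]

/-- Pointwise bound on the gain integrand for `|φ(w)| ≤ C (1 + |w|²)` (conservation of energy
`|v'|² ≤ |v|² + |w|²`). [folklore] -/
theorem abs_gainIntegrand_le_quad {β : ℝ} (hβ : 0 < β) {φ : 𝔼 → ℝ} {C : ℝ}
    (hC : ∀ w, |φ w| ≤ C * (1 + ‖w‖ ^ 2)) (v w : 𝔼) (ν : 𝕊) :
    |gainIntegrand β φ v w ν| ≤
      (‖v‖ + ‖w‖) * Literature.Analysis.FunctionSpaces.maxwellianBeta β w * (C * (1 + ‖v‖ ^ 2 + ‖w‖ ^ 2)) := by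
  have hC0 : 0 ≤ C := by have := (abs_nonneg _).trans (hC 0); simpa using this
  rw [gainIntegrand, abs_mul, abs_mul, abs_of_nonneg (hardSphereKernel_nonneg _ _),
    abs_of_pos (Literature.Analysis.FunctionSpaces.maxwellianBeta_pos hβ w)]
  have hM := (Literature.Analysis.FunctionSpaces.maxwellianBeta_pos hβ w).le
  have hB := hardSphereKernel_nonneg (v, w) ν
  have hE := norm_sq_collide_fst_add_norm_sq_collide_snd ν (v, w)
  have hv' : ‖(collide ν (v, w)).1‖ ^ 2 ≤ ‖v‖ ^ 2 + ‖w‖ ^ 2 := by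
    simp only at hE; nlinarith [sq_nonneg ‖(collide ν (v, w)).2‖]
  refine mul_le_mul (mul_le_mul_of_nonneg_right (hardSphereKernel_le v w ν) hM)
    ((hC _).trans ?_) (abs_nonneg _) (mul_nonneg (add_nonneg (norm_nonneg _) (norm_nonneg _)) hM)
  exact mul_le_mul_of_nonneg_left (by linarith) hC0

/-- The cubic Maxwellian weight `(|v| + |w|)(1 + |v|² + |w|²) M_β(w)` is integrable in `w`.
[folklore] -/
theorem integrable_cubicWeight_mul_maxwellianBeta {β : ℝ} (hβ : 0 < β) (v : 𝔼) (C : ℝ) :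
    Integrable fun w : 𝔼 =>
      (‖v‖ + ‖w‖) * Literature.Analysis.FunctionSpaces.maxwellianBeta β w * (C * (1 + ‖v‖ ^ 2 + ‖w‖ ^ 2)) := by
  have h0 := KineticTheory.integrable_maxwellianBeta (d := d) hβ
  have h1 := KineticTheory.integrable_pow_norm_mul_maxwellianBeta (d := d) hβ 1
  have h2 := KineticTheory.integrable_pow_norm_mul_maxwellianBeta (d := d) hβ 2
  have h3 := KineticTheory.integrable_pow_norm_mul_maxwellianBeta (d := d) hβ 3
  have : (fun w : 𝔼 => (‖v‖ + ‖w‖) * Literature.Analysis.FunctionSpaces.maxwellianBeta β w * (C * (1 + ‖v‖ ^ 2 + ‖w‖ ^ 2)))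
      = fun w => C * (‖v‖ * (1 + ‖v‖ ^ 2)) * Literature.Analysis.FunctionSpaces.maxwellianBeta β w +
          C * (1 + ‖v‖ ^ 2) * (‖w‖ ^ 1 * Literature.Analysis.FunctionSpaces.maxwellianBeta β w) +
          C * ‖v‖ * (‖w‖ ^ 2 * Literature.Analysis.FunctionSpaces.maxwellianBeta β w) +
          C * (‖w‖ ^ 3 * Literature.Analysis.FunctionSpaces.maxwellianBeta β w) := by
    funext w; ring
  rw [this]
  exact (((h0.const_mul _).add (h1.const_mul _)).add (h2.const_mul _)).add (h3.const_mul _)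

/-- A quadratically bounded measurable gain integrand is integrable on the sphere. [folklore] -/
theorem integrable_gainIntegrand_sphere_quad {β : ℝ} (hβ : 0 < β) {φ : 𝔼 → ℝ}
    (hφ : Measurable φ) {C : ℝ} (hC : ∀ w, |φ w| ≤ C * (1 + ‖w‖ ^ 2)) (v w : 𝔼) :
    Integrable (fun ν => gainIntegrand β φ v w ν) (sphereMeasure : Measure 𝕊) := by
  refine Integrable.of_bound
    (C := (‖v‖ + ‖w‖) * Literature.Analysis.FunctionSpaces.maxwellianBeta β w * (C * (1 + ‖v‖ ^ 2 + ‖w‖ ^ 2))) ?_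
    (Eventually.of_forall fun ν => ?_)
  · exact ((measurable_gainIntegrand hφ v).comp measurable_prodMk_left).aestronglyMeasurable
  · rw [Real.norm_eq_abs]; exact abs_gainIntegrand_le_quad hβ hC v w _

/-- Bound on the inner integral for quadratically bounded `φ`. [folklore] -/
theorem abs_integral_gainIntegrand_le_quad {β : ℝ} (hβ : 0 < β) {φ : 𝔼 → ℝ} {C : ℝ}
    (hC : ∀ w, |φ w| ≤ C * (1 + ‖w‖ ^ 2)) (v w : 𝔼) :
    |∫ ν, gainIntegrand β φ v w ν ∂sphereMeasure| ≤
      KineticTheory.sphereMass 𝔼 *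
        ((‖v‖ + ‖w‖) * Literature.Analysis.FunctionSpaces.maxwellianBeta β w * (C * (1 + ‖v‖ ^ 2 + ‖w‖ ^ 2))) := by
  have h : ∀ᵐ ν : 𝕊 ∂sphereMeasure, ‖gainIntegrand β φ v w ν‖ ≤
      (‖v‖ + ‖w‖) * Literature.Analysis.FunctionSpaces.maxwellianBeta β w * (C * (1 + ‖v‖ ^ 2 + ‖w‖ ^ 2)) :=
    Eventually.of_forall fun ν => by
      rw [Real.norm_eq_abs]; exact abs_gainIntegrand_le_quad hβ hC v w ν
  have := norm_integral_le_of_norm_le_const h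
  rw [Real.norm_eq_abs] at this
  calc |∫ ν, gainIntegrand β φ v w ν ∂sphereMeasure|
      ≤ (‖v‖ + ‖w‖) * Literature.Analysis.FunctionSpaces.maxwellianBeta β w * (C * (1 + ‖v‖ ^ 2 + ‖w‖ ^ 2)) *
          (sphereMeasure : Measure 𝕊).real univ := this
    _ = _ := by rw [mul_comm]; rfl

/-- The inner integral of a quadratically bounded measurable gain integrand is integrable in
`w` (Gaussian moments up to order `3`). [folklore] -/
theorem integrable_integral_gainIntegrand_quad {β : ℝ} (hβ : 0 < β) {φ : 𝔼 → ℝ}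
    (hφ : Measurable φ) {C : ℝ} (hC : ∀ w, |φ w| ≤ C * (1 + ‖w‖ ^ 2)) (v : 𝔼) :
    Integrable (fun w => ∫ ν, gainIntegrand β φ v w ν ∂sphereMeasure) := by
  refine ((integrable_cubicWeight_mul_maxwellianBeta hβ v C).const_mul
    (KineticTheory.sphereMass 𝔼)).mono' (aestronglyMeasurable_integral_gainIntegrand hφ v)
    (Eventually.of_forall fun w => ?_)
  rw [Real.norm_eq_abs]
  exact abs_integral_gainIntegrand_le_quad hβ hC v w

/-! ### Algebra of the gain operator -/

/-- **`K⁺_β 1 = a_β`**: the gain operator of a constant is the constant times the collision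
frequency (conservativity of `L`: `L 1 = 0`). [folklore] -/
theorem linearBoltzmannGain_const (β c : ℝ) (v : 𝔼) :
    linearBoltzmannGain β (fun _ => c) v = TaggedSphereDiffusion.collisionFrequency β v * c := by
  simp only [linearBoltzmannGain, TaggedSphereDiffusion.collisionFrequency]
  rw [← integral_mul_const]
  congr 1
  funext w
  rw [← integral_mul_const]

/-- Homogeneity: `K⁺(c φ) = c K⁺ φ`. [folklore] -/
theorem linearBoltzmannGain_const_mul (β c : ℝ) (φ : 𝔼 → ℝ) (v : 𝔼) :
    linearBoltzmannGain β (fun w => c * φ w) v = c * linearBoltzmannGain β φ v := by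
  simp only [linearBoltzmannGain]
  rw [← integral_const_mul]
  congr 1
  funext w
  rw [← integral_const_mul]
  congr 1
  funext ν
  ring

/-- Additivity on quadratically bounded measurable functions: `K⁺(φ + ψ) = K⁺ φ + K⁺ ψ`.
[folklore] -/
theorem linearBoltzmannGain_add {β : ℝ} (hβ : 0 < β) {φ ψ : 𝔼 → ℝ} (hφ : Measurable φ)
    (hψ : Measurable ψ) {C D : ℝ} (hC : ∀ w, |φ w| ≤ C * (1 + ‖w‖ ^ 2))
    (hD : ∀ w, |ψ w| ≤ D * (1 + ‖w‖ ^ 2)) (v : 𝔼) :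
    linearBoltzmannGain β (fun w => φ w + ψ w) v =
      linearBoltzmannGain β φ v + linearBoltzmannGain β ψ v := by
  simp only [linearBoltzmannGain_eq]
  rw [← integral_add (integrable_integral_gainIntegrand_quad hβ hφ hC v)
    (integrable_integral_gainIntegrand_quad hβ hψ hD v)]
  congr 1
  funext w
  rw [← integral_add (integrable_gainIntegrand_sphere_quad hβ hφ hC v w)
    (integrable_gainIntegrand_sphere_quad hβ hψ hD v w)]
  congr 1
  funext ν
  simp only [gainIntegrand]
  ring

/-- Positivity: `φ ≥ 0 ⟹ K⁺ φ ≥ 0`. [folklore] -/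
theorem linearBoltzmannGain_nonneg {β : ℝ} (hβ : 0 < β) {φ : 𝔼 → ℝ} (hφ : ∀ w, 0 ≤ φ w) (v : 𝔼) :
    0 ≤ linearBoltzmannGain β φ v :=
  integral_nonneg fun w => integral_nonneg fun _ =>
    mul_nonneg (mul_nonneg (hardSphereKernel_nonneg _ _) (Literature.Analysis.FunctionSpaces.maxwellianBeta_pos hβ w).le) (hφ _)

/-- **Monotonicity** on nonnegative functions below a quadratically bounded measurable one:
`0 ≤ φ ≤ ψ ⟹ K⁺ φ ≤ K⁺ ψ` (no measurability of `φ` is needed). [folklore] -/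
theorem linearBoltzmannGain_mono {β : ℝ} (hβ : 0 < β) {φ ψ : 𝔼 → ℝ} (hφ0 : ∀ w, 0 ≤ φ w)
    (hφψ : ∀ w, φ w ≤ ψ w) (hψ : Measurable ψ) {C : ℝ} (hC : ∀ w, |ψ w| ≤ C * (1 + ‖w‖ ^ 2))
    (v : 𝔼) : linearBoltzmannGain β φ v ≤ linearBoltzmannGain β ψ v := by
  simp only [linearBoltzmannGain_eq]
  have hMB : ∀ w (ν : 𝕊), 0 ≤ hardSphereKernel (v, w) ν * Literature.Analysis.FunctionSpaces.maxwellianBeta β w :=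
    fun w ν => mul_nonneg (hardSphereKernel_nonneg _ _) (Literature.Analysis.FunctionSpaces.maxwellianBeta_pos hβ w).le
  refine integral_mono_of_nonneg (Eventually.of_forall fun w => integral_nonneg fun ν =>
    mul_nonneg (hMB w ν) (hφ0 _)) (integrable_integral_gainIntegrand_quad hβ hψ hC v)
    (Eventually.of_forall fun w => ?_)
  exact integral_mono_of_nonneg (Eventually.of_forall fun ν => mul_nonneg (hMB w ν) (hφ0 _))
    (integrable_gainIntegrand_sphere_quad hβ hψ hC v w)
    (Eventually.of_forall fun ν => mul_le_mul_of_nonneg_left (hφψ _) (hMB w ν))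

/-- **The gain operator is bounded by the collision frequency**: `|K⁺ φ(v)| ≤ a_β(v) C` if
`|φ| ≤ C`. [folklore] -/
theorem abs_linearBoltzmannGain_le {β : ℝ} (hβ : 0 < β) {φ : 𝔼 → ℝ} {C : ℝ} (hC : ∀ w, |φ w| ≤ C)
    (v : 𝔼) : |linearBoltzmannGain β φ v| ≤ TaggedSphereDiffusion.collisionFrequency β v * C := by
  have hC0 : 0 ≤ C := (abs_nonneg _).trans (hC 0)
  rw [linearBoltzmannGain_eq, collisionFrequency_eq, ← integral_mul_const]
  have h1 : ∀ w, |∫ ν, gainIntegrand β φ v w ν ∂sphereMeasure| ≤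
      KineticTheory.lorentzLossRate (v - w) * Literature.Analysis.FunctionSpaces.maxwellianBeta β w * C := fun w => by
    have h : ∀ᵐ ν : 𝕊 ∂sphereMeasure, ‖gainIntegrand β φ v w ν‖ ≤
        hardSphereKernel (v, w) ν * (Literature.Analysis.FunctionSpaces.maxwellianBeta β w * C) :=
      Eventually.of_forall fun ν => by
        rw [Real.norm_eq_abs, gainIntegrand, abs_mul, abs_mul,
          abs_of_nonneg (hardSphereKernel_nonneg _ _),
          abs_of_pos (Literature.Analysis.FunctionSpaces.maxwellianBeta_pos hβ w), mul_assoc]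
        exact mul_le_mul_of_nonneg_left (mul_le_mul_of_nonneg_left (hC _)
          (Literature.Analysis.FunctionSpaces.maxwellianBeta_pos hβ w).le) (hardSphereKernel_nonneg _ _)
    have hint : Integrable (fun ν : 𝕊 => hardSphereKernel (v, w) ν *
        (Literature.Analysis.FunctionSpaces.maxwellianBeta β w * C)) sphereMeasure :=
      ((continuous_hardSphereKernel.comp (by fun_prop :
        Continuous fun ν : 𝕊 => ((v, w), ν))).integrable_of_hasCompactSupport
        (HasCompactSupport.of_compactSpace _)).mul_const _
    have := norm_integral_le_of_norm_le hint h
    rw [Real.norm_eq_abs, integral_mul_const, integral_hardSphereKernel, ← mul_assoc] at this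
    exact this
  have h2 := norm_integral_le_of_norm_le
    ((integrable_lorentzLossRate_mul_maxwellianBeta hβ v).mul_const C)
    (Eventually.of_forall fun w => by rw [Real.norm_eq_abs]; exact h1 w)
  rwa [Real.norm_eq_abs] at h2

/-- **Lyapunov drift of the kinetic energy under the gain operator**:
`K⁺_β (1 + |·|²)(v) ≤ a_β(v) (1 + |v|²) + |S^{d-1}| (|v| m₂ + m₃)`, `m_k = ∫ |w|^k M_β`: by
conservation of energy `|v'|² ≤ |v|² + |v₁|²`, and `((v - v₁)·ν)₊ ≤ |v| + |v₁|`. This soft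
bound (the defect is linear in `|v|`, one order below the quadratic weight) is what rules out
the accumulation of collisions in finite time. [folklore] -/
theorem linearBoltzmannGain_normSq_le {β : ℝ} (hβ : 0 < β) (v : 𝔼) :
    linearBoltzmannGain β (fun w => 1 + ‖w‖ ^ 2) v ≤
      TaggedSphereDiffusion.collisionFrequency β v * (1 + ‖v‖ ^ 2) +
        KineticTheory.sphereMass 𝔼 * (‖v‖ * KineticTheory.maxwellianMoment d β 2 +
          KineticTheory.maxwellianMoment d β 3) := by
  -- the majorant, integrated
  have hM0 := fun w => (Literature.Analysis.FunctionSpaces.maxwellianBeta_pos (d := d) hβ w).le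
  have hm2 := KineticTheory.integrable_pow_norm_mul_maxwellianBeta (d := d) hβ 2
  have hm3 := KineticTheory.integrable_pow_norm_mul_maxwellianBeta (d := d) hβ 3
  set W : ℝ := 1 + ‖v‖ ^ 2 with hW
  set g : 𝔼 → ℝ := fun w => KineticTheory.lorentzLossRate (v - w) * Literature.Analysis.FunctionSpaces.maxwellianBeta β w * W +
    KineticTheory.sphereMass 𝔼 * ((‖v‖ + ‖w‖) * (‖w‖ ^ 2 * Literature.Analysis.FunctionSpaces.maxwellianBeta β w)) with hg
  have hg_int : Integrable g := by
    refine ((integrable_lorentzLossRate_mul_maxwellianBeta hβ v).mul_const W).add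
      (Integrable.const_mul ?_ _)
    have : (fun w : 𝔼 => (‖v‖ + ‖w‖) * (‖w‖ ^ 2 * Literature.Analysis.FunctionSpaces.maxwellianBeta β w)) =
        fun w => ‖v‖ * (‖w‖ ^ 2 * Literature.Analysis.FunctionSpaces.maxwellianBeta β w) + ‖w‖ ^ 3 * Literature.Analysis.FunctionSpaces.maxwellianBeta β w := by
      funext w; ring
    rw [this]
    exact (hm2.const_mul _).add hm3
  have hg_val : ∫ w, g w = TaggedSphereDiffusion.collisionFrequency β v * W +
      KineticTheory.sphereMass 𝔼 * (‖v‖ * KineticTheory.maxwellianMoment d β 2 +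
        KineticTheory.maxwellianMoment d β 3) := by
    rw [hg, integral_add ((integrable_lorentzLossRate_mul_maxwellianBeta hβ v).mul_const W)
      (hg_int.sub ((integrable_lorentzLossRate_mul_maxwellianBeta hβ v).mul_const W) |>.congr
        (Eventually.of_forall fun w => by simp [hg])),
      integral_mul_const, ← collisionFrequency_eq, integral_const_mul]
    congr 2
    have : (fun w : 𝔼 => (‖v‖ + ‖w‖) * (‖w‖ ^ 2 * Literature.Analysis.FunctionSpaces.maxwellianBeta β w)) =
        fun w => ‖v‖ * (‖w‖ ^ 2 * Literature.Analysis.FunctionSpaces.maxwellianBeta β w) + ‖w‖ ^ 3 * Literature.Analysis.FunctionSpaces.maxwellianBeta β w := by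
      funext w; ring
    rw [this, integral_add (hm2.const_mul _) hm3, integral_const_mul]
    rfl
  rw [← hg_val, linearBoltzmannGain_eq]
  -- pointwise comparison of the inner integrals
  refine integral_mono_of_nonneg (Eventually.of_forall fun w => integral_nonneg fun ν =>
    mul_nonneg (mul_nonneg (hardSphereKernel_nonneg _ _) (hM0 w)) (by positivity)) hg_int
    (Eventually.of_forall fun w => ?_)
  -- inner: `∫ B M (1+|v'|²) ≤ ∫ (B M W + (|v|+|w|) |w|² M)`
  have hker : Continuous fun ν : 𝕊 => hardSphereKernel (v, w) ν :=
    continuous_hardSphereKernel.comp (by fun_prop : Continuous fun ν : 𝕊 => ((v, w), ν))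
  have hint1 : Integrable (fun ν : 𝕊 => hardSphereKernel (v, w) ν *
      (Literature.Analysis.FunctionSpaces.maxwellianBeta β w * W)) sphereMeasure :=
    (hker.integrable_of_hasCompactSupport (HasCompactSupport.of_compactSpace _)).mul_const _
  have hint2 : Integrable (fun _ : 𝕊 => (‖v‖ + ‖w‖) * (‖w‖ ^ 2 * Literature.Analysis.FunctionSpaces.maxwellianBeta β w))
      sphereMeasure := integrable_const _
  have hsum : ∫ ν, (hardSphereKernel (v, w) ν * (Literature.Analysis.FunctionSpaces.maxwellianBeta β w * W) +
      (‖v‖ + ‖w‖) * (‖w‖ ^ 2 * Literature.Analysis.FunctionSpaces.maxwellianBeta β w)) ∂sphereMeasure = g w := by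
    rw [integral_add hint1 hint2, integral_mul_const, integral_hardSphereKernel, integral_const,
      smul_eq_mul, hg, ← mul_assoc]
    rfl
  rw [← hsum]
  refine integral_mono_of_nonneg (Eventually.of_forall fun ν =>
    mul_nonneg (mul_nonneg (hardSphereKernel_nonneg _ _) (hM0 w)) (by positivity))
    (hint1.add hint2) (Eventually.of_forall fun ν => ?_)
  -- pointwise: energy conservation
  have hE := norm_sq_collide_fst_add_norm_sq_collide_snd ν (v, w)
  have hv' : ‖(collide ν (v, w)).1‖ ^ 2 ≤ ‖v‖ ^ 2 + ‖w‖ ^ 2 := by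
    simp only at hE; nlinarith [sq_nonneg ‖(collide ν (v, w)).2‖]
  have hB := hardSphereKernel_nonneg (v, w) ν
  have hBle := hardSphereKernel_le v w ν
  simp only [gainIntegrand]
  calc hardSphereKernel (v, w) ν * Literature.Analysis.FunctionSpaces.maxwellianBeta β w * (1 + ‖(collide ν (v, w)).1‖ ^ 2)
      ≤ hardSphereKernel (v, w) ν * Literature.Analysis.FunctionSpaces.maxwellianBeta β w * (W + ‖w‖ ^ 2) :=
        mul_le_mul_of_nonneg_left (by linarith) (mul_nonneg hB (hM0 w))
    _ = hardSphereKernel (v, w) ν * (Literature.Analysis.FunctionSpaces.maxwellianBeta β w * W) +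
        hardSphereKernel (v, w) ν * (‖w‖ ^ 2 * Literature.Analysis.FunctionSpaces.maxwellianBeta β w) := by ring
    _ ≤ hardSphereKernel (v, w) ν * (Literature.Analysis.FunctionSpaces.maxwellianBeta β w * W) +
        (‖v‖ + ‖w‖) * (‖w‖ ^ 2 * Literature.Analysis.FunctionSpaces.maxwellianBeta β w) :=
        add_le_add_right (mul_le_mul_of_nonneg_right hBle (mul_nonneg (sq_nonneg _) (hM0 w))) _


/-! ### Parametric continuity of the gain operator -/

/-- The inner sphere integral `∫ ((v - w)·ν)₊ M_β(w) h_y(v') dν` is jointly continuous in the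
parameter `y` and in `w`, for `h` jointly continuous and `v = v(y)` continuous (parametric
integral over the compact sphere). [folklore] -/
theorem continuous_integral_gainIntegrand_param {Y : Type*} [TopologicalSpace Y]
    [FirstCountableTopology Y] [LocallyCompactSpace Y] {h : Y → 𝔼 → ℝ}
    (hh : Continuous fun p : Y × 𝔼 => h p.1 p.2) {v : Y → 𝔼} (hv : Continuous v) (β : ℝ) :
    Continuous fun p : Y × 𝔼 => ∫ ν, gainIntegrand β (h p.1) (v p.1) p.2 ν ∂sphereMeasure := by
  have hF : Continuous (Function.uncurry fun (p : Y × 𝔼) (ν : 𝕊) =>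
      gainIntegrand β (h p.1) (v p.1) p.2 ν) := by
    have hvw : Continuous fun q : (Y × 𝔼) × 𝕊 => ((v q.1.1, q.1.2), q.2) :=
      ((hv.comp continuous_fst.fst).prodMk continuous_fst.snd).prodMk continuous_snd
    refine ((continuous_hardSphereKernel.comp hvw).mul
      ((KineticTheory.continuous_maxwellianBeta β).comp continuous_fst.snd)).mul ?_
    exact hh.comp (continuous_fst.fst.prodMk (continuous_collide_fst.comp hvw))
  have := continuous_parametric_integral_of_continuous
    (μ := (sphereMeasure : Measure 𝕊)) hF isCompact_univ
  simpa only [Measure.restrict_univ] using this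

/-- **Parametric continuity of the gain operator**: if `h y w` is jointly continuous and
uniformly bounded and `v(y)` is continuous, then `y ↦ (K⁺_β h_y)(v(y))` is continuous
(compact sphere inside, dominated convergence with a Maxwellian majorant outside). [folklore] -/
theorem continuous_linearBoltzmannGain_param {Y : Type*} [TopologicalSpace Y]
    [FirstCountableTopology Y] [LocallyCompactSpace Y] {β : ℝ} (hβ : 0 < β) {h : Y → 𝔼 → ℝ}
    (hh : Continuous fun p : Y × 𝔼 => h p.1 p.2) {C : ℝ} (hC : ∀ y w, |h y w| ≤ C)
    {v : Y → 𝔼} (hv : Continuous v) :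
    Continuous fun y => linearBoltzmannGain β (h y) (v y) := by
  have hG := continuous_integral_gainIntegrand_param hh hv β
  simp only [linearBoltzmannGain_eq]
  refine continuous_iff_continuousAt.2 fun y₀ => ?_
  have hU : ∀ᶠ y in 𝓝 y₀, ‖v y‖ < ‖v y₀‖ + 1 :=
    ((continuous_norm.comp hv).tendsto y₀).eventually (eventually_lt_nhds (lt_add_one _))
  have hM0 := fun w => (Literature.Analysis.FunctionSpaces.maxwellianBeta_pos (d := d) hβ w).le
  have hC0 : 0 ≤ C := (abs_nonneg _).trans (hC y₀ 0)
  refine continuousAt_of_dominated (bound := fun w =>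
    KineticTheory.sphereMass 𝔼 * ((‖v y₀‖ + 1 + ‖w‖) * Literature.Analysis.FunctionSpaces.maxwellianBeta β w * C)) ?_ ?_ ?_ ?_
  · exact Eventually.of_forall fun y =>
      (hG.comp (Continuous.prodMk_right y)).aestronglyMeasurable
  · filter_upwards [hU] with y hy
    refine Eventually.of_forall fun w => ?_
    rw [Real.norm_eq_abs]
    refine (abs_integral_gainIntegrand_le hβ (hC y) (v y) w).trans ?_
    refine mul_le_mul_of_nonneg_left ?_ KineticTheory.sphereMass_nonneg
    refine mul_le_mul_of_nonneg_right (mul_le_mul_of_nonneg_right (by linarith) (hM0 w)) hC0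
  · have : (fun w : 𝔼 => KineticTheory.sphereMass 𝔼 * ((‖v y₀‖ + 1 + ‖w‖) * Literature.Analysis.FunctionSpaces.maxwellianBeta β w * C))
        = fun w => KineticTheory.sphereMass 𝔼 * C * (‖v y₀‖ + 1) * Literature.Analysis.FunctionSpaces.maxwellianBeta β w +
          KineticTheory.sphereMass 𝔼 * C * (‖w‖ ^ 1 * Literature.Analysis.FunctionSpaces.maxwellianBeta β w) := by
      funext w; ring
    rw [this]
    exact ((KineticTheory.integrable_maxwellianBeta hβ).const_mul _).add
      ((KineticTheory.integrable_pow_norm_mul_maxwellianBeta hβ 1).const_mul _)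
  · exact Eventually.of_forall fun w =>
      (hG.comp (continuous_id.prodMk continuous_const)).continuousAt

/-- The collision frequency `a_β` is continuous (`a_β = K⁺_β 1`). [folklore] -/
theorem continuous_collisionFrequency {β : ℝ} (hβ : 0 < β) :
    Continuous (TaggedSphereDiffusion.collisionFrequency (d := d) β) := by
  have h := continuous_linearBoltzmannGain_param (Y := 𝔼) hβ (h := fun _ _ => (1 : ℝ))
    continuous_const (C := 1) (fun _ _ => by simp) continuous_id
  simpa [linearBoltzmannGain_const] using h

/-! ## The collision series of the linear Boltzmann equation (1.3) -/

section SeriesDefs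

variable {X : Type*}

/-- `d/ds e^{-κ (T - s)} = κ e^{-κ (T - s)}`. [folklore] -/
theorem hasDerivAt_exp_neg_mul_sub (κ T s : ℝ) :
    HasDerivAt (fun s => exp (-(κ * (T - s)))) (exp (-(κ * (T - s))) * κ) s := by
  have h1 : HasDerivAt (fun s => -(κ * (T - s))) κ s := by
    have h2 := (((hasDerivAt_id s).const_sub T).const_mul κ).neg
    simp only [mul_neg, mul_one, neg_neg] at h2
    exact h2
  exact h1.exp

/-- An elementary exponential integral: `∫₀ᵀ κ e^{-κ (T - s)} ds = 1 - e^{-κ T}`. [folklore] -/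
theorem integral_mul_exp_neg_mul_sub (κ T : ℝ) :
    ∫ s in (0 : ℝ)..T, exp (-(κ * (T - s))) * κ = 1 - exp (-(κ * T)) := by
  rw [intervalIntegral.integral_eq_sub_of_hasDerivAt (fun s _ => hasDerivAt_exp_neg_mul_sub κ T s)
    ((by fun_prop : Continuous fun s => exp (-(κ * (T - s))) * κ).intervalIntegrable _ _)]
  simp

/-- The *gain Duhamel map* of the linear Boltzmann equation (1.3) written in gain/loss form
`∂ₜ φ + v·∇ₓ φ + α a_β φ = α K⁺_β φ` on the geometry `G`: for a density `ψ(s, y, w)`,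
`(𝒯 ψ)(t, x, v) = ∫₀ᵗ e^{-α a_β(v) (t - s)} α (K⁺_β ψ(s, x - (t - s) v, ·))(v) ds`
(last collision at time `s`, then damped free flight), with `t` replaced by `t⁺ = max t 0` so
that negative times carry the time-`0` value. [cite: BodineauGallagherSaintRaymondInvent2016, (1.3)] -/
def gainDuhamel (G : Literature.Analysis.FluidPDE.Geometry d X) (β α : ℝ) (ψ : ℝ → X → 𝔼 → ℝ) (t : ℝ) (x : X)
    (v : 𝔼) : ℝ :=
  ∫ s in (0 : ℝ)..max t 0, exp (-(α * TaggedSphereDiffusion.collisionFrequency β v * (max t 0 - s))) *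
    (α * linearBoltzmannGain β (fun w => ψ s (G.translate x ((s - max t 0) • v)) w) v)

/-- The `n`-collision term `uₙ` of the collision (Dyson–Duhamel) series of BGSR's linear
Boltzmann equation (1.3) `∂ₜ φ + v·∇ₓ φ = -α L φ = α (K⁺_β φ - a_β φ)` with datum `f₀`:
`u₀(t, x, v) = e^{-α a_β(v) t} f₀(x - t v, v)` (damped free flight) and `u_{n+1} = 𝒯 uₙ`
(`gainDuhamel`); times are clamped at `t⁺ = max t 0`. The series `∑ₙ uₙ` is the solution
`φ_α` of (1.3) (`linearBoltzmannSeries`). [cite: BodineauGallagherSaintRaymondInvent2016, (1.3)] -/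
def linearBoltzmannTerm (G : Literature.Analysis.FluidPDE.Geometry d X) (β α : ℝ) (f₀ : X → 𝔼 → ℝ) :
    ℕ → ℝ → X → 𝔼 → ℝ
  | 0 => fun t x v => exp (-(α * TaggedSphereDiffusion.collisionFrequency β v * max t 0)) *
      f₀ (G.translate x (-(max t 0) • v)) v
  | n + 1 => gainDuhamel G β α (linearBoltzmannTerm G β α f₀ n)

/-- The partial sums `Sₙ = ∑_{k<n} u_k` of the collision series. [folklore] -/
def linearBoltzmannPartialSum (G : Literature.Analysis.FluidPDE.Geometry d X) (β α : ℝ) (f₀ : X → 𝔼 → ℝ) (n : ℕ)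
    (t : ℝ) (x : X) (v : 𝔼) : ℝ :=
  ∑ k ∈ Finset.range n, linearBoltzmannTerm G β α f₀ k t x v

/-- The *collision-series solution* `φ_α = ∑ₙ uₙ` of BGSR's linear Boltzmann equation (1.3)
with inverse mean free path `α`, background `M_β` and datum `f₀` on the geometry `G`
(for `0 ≤ f₀ ≤ R` continuous this is a continuous mild solution with `0 ≤ φ_α ≤ R`).
[cite: BodineauGallagherSaintRaymondInvent2016, (1.3)] -/
def linearBoltzmannSeries (G : Literature.Analysis.FluidPDE.Geometry d X) (β α : ℝ) (f₀ : X → 𝔼 → ℝ) (t : ℝ) (x : X)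
    (v : 𝔼) : ℝ :=
  ∑' n, linearBoltzmannTerm G β α f₀ n t x v

/-- The free-flight term `u₀`. [folklore] -/
@[simp]
theorem linearBoltzmannTerm_zero (G : Literature.Analysis.FluidPDE.Geometry d X) (β α : ℝ) (f₀ : X → 𝔼 → ℝ) :
    linearBoltzmannTerm G β α f₀ 0 = fun t x v =>
      exp (-(α * TaggedSphereDiffusion.collisionFrequency β v * max t 0)) * f₀ (G.translate x (-(max t 0) • v)) v := rfl

/-- `u_{n+1} = 𝒯 uₙ`. [folklore] -/
@[simp]
theorem linearBoltzmannTerm_succ (G : Literature.Analysis.FluidPDE.Geometry d X) (β α : ℝ) (f₀ : X → 𝔼 → ℝ) (n : ℕ) :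
    linearBoltzmannTerm G β α f₀ (n + 1) = gainDuhamel G β α (linearBoltzmannTerm G β α f₀ n) := rfl

/-- `Sₙ₊₁ = Sₙ + uₙ`. [folklore] -/
theorem linearBoltzmannPartialSum_succ (G : Literature.Analysis.FluidPDE.Geometry d X) (β α : ℝ) (f₀ : X → 𝔼 → ℝ)
    (n : ℕ) (t : ℝ) (x : X) (v : 𝔼) :
    linearBoltzmannPartialSum G β α f₀ (n + 1) t x v =
      linearBoltzmannPartialSum G β α f₀ n t x v + linearBoltzmannTerm G β α f₀ n t x v :=
  Finset.sum_range_succ _ _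

/-- `S₀ = 0`. [folklore] -/
@[simp]
theorem linearBoltzmannPartialSum_zero (G : Literature.Analysis.FluidPDE.Geometry d X) (β α : ℝ) (f₀ : X → 𝔼 → ℝ) :
    linearBoltzmannPartialSum G β α f₀ 0 = fun _ _ _ => 0 := by
  funext t x v; simp [linearBoltzmannPartialSum]

/-- The integrand of the gain Duhamel map. [folklore] -/
def gainDuhamelIntegrand (G : Literature.Analysis.FluidPDE.Geometry d X) (β α : ℝ) (ψ : ℝ → X → 𝔼 → ℝ) (T : ℝ)
    (x : X) (v : 𝔼) (s : ℝ) : ℝ :=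
  exp (-(α * TaggedSphereDiffusion.collisionFrequency β v * (T - s))) *
    (α * linearBoltzmannGain β (fun w => ψ s (G.translate x ((s - T) • v)) w) v)

/-- The gain Duhamel map through its integrand. [folklore] -/
theorem gainDuhamel_eq (G : Literature.Analysis.FluidPDE.Geometry d X) (β α : ℝ) (ψ : ℝ → X → 𝔼 → ℝ) (t : ℝ) (x : X)
    (v : 𝔼) : gainDuhamel G β α ψ t x v =
      ∫ s in (0 : ℝ)..max t 0, gainDuhamelIntegrand G β α ψ (max t 0) x v s := rfl

variable {G : Literature.Analysis.FluidPDE.Geometry d X} {β α : ℝ}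

/-- Bound on the Duhamel integrand: `|e^{-κ(T-s)} α K⁺ψ| ≤ e^{-κ(T-s)} κ C`, `κ = α a_β(v)`.
[folklore] -/
theorem abs_gainDuhamelIntegrand_le (hβ : 0 < β) (hα : 0 ≤ α) {ψ : ℝ → X → 𝔼 → ℝ} {C : ℝ}
    (hψb : ∀ t x v, |ψ t x v| ≤ C) (T : ℝ) (x : X) (v : 𝔼) (s : ℝ) :
    |gainDuhamelIntegrand G β α ψ T x v s| ≤
      exp (-(α * TaggedSphereDiffusion.collisionFrequency β v * (T - s))) * (α * TaggedSphereDiffusion.collisionFrequency β v) * C := by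
  rw [gainDuhamelIntegrand, abs_mul, abs_of_pos (exp_pos _), abs_mul, abs_of_nonneg hα]
  calc exp (-(α * TaggedSphereDiffusion.collisionFrequency β v * (T - s))) *
        (α * |linearBoltzmannGain β (fun w => ψ s (G.translate x ((s - T) • v)) w) v|)
      ≤ exp (-(α * TaggedSphereDiffusion.collisionFrequency β v * (T - s))) * (α * (TaggedSphereDiffusion.collisionFrequency β v * C)) :=
        mul_le_mul_of_nonneg_left (mul_le_mul_of_nonneg_left
          (abs_linearBoltzmannGain_le hβ (fun w => hψb _ _ _) v) hα) (exp_pos _).le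
    _ = _ := by ring

/-- The Duhamel integrand of a nonnegative density is nonnegative. [folklore] -/
theorem gainDuhamelIntegrand_nonneg (hβ : 0 < β) (hα : 0 ≤ α) {ψ : ℝ → X → 𝔼 → ℝ}
    (hψ0 : ∀ t x v, 0 ≤ ψ t x v) (T : ℝ) (x : X) (v : 𝔼) (s : ℝ) :
    0 ≤ gainDuhamelIntegrand G β α ψ T x v s :=
  mul_nonneg (exp_pos _).le (mul_nonneg hα (linearBoltzmannGain_nonneg hβ (fun _ => hψ0 _ _ _) v))

/-- **The gain Duhamel map of a constant**: `𝒯 c = c (1 - e^{-α a_β(v) t⁺})`. [folklore] -/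
theorem gainDuhamel_const (G : Literature.Analysis.FluidPDE.Geometry d X) (β α c t : ℝ) (x : X) (v : 𝔼) :
    gainDuhamel G β α (fun _ _ _ => c) t x v =
      c * (1 - exp (-(α * TaggedSphereDiffusion.collisionFrequency β v * max t 0))) := by
  rw [gainDuhamel]
  simp only [linearBoltzmannGain_const]
  have : (fun s => exp (-(α * TaggedSphereDiffusion.collisionFrequency β v * (max t 0 - s))) *
      (α * (TaggedSphereDiffusion.collisionFrequency β v * c))) = fun s =>
      (exp (-(α * TaggedSphereDiffusion.collisionFrequency β v * (max t 0 - s))) * (α * TaggedSphereDiffusion.collisionFrequency β v)) * c := by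
    funext s; ring
  rw [this, intervalIntegral.integral_mul_const, integral_mul_exp_neg_mul_sub, mul_comm]

/-- The gain Duhamel map of a nonnegative density is nonnegative. [folklore] -/
theorem gainDuhamel_nonneg (hβ : 0 < β) (hα : 0 ≤ α) {ψ : ℝ → X → 𝔼 → ℝ}
    (hψ0 : ∀ t x v, 0 ≤ ψ t x v) (t : ℝ) (x : X) (v : 𝔼) : 0 ≤ gainDuhamel G β α ψ t x v := by
  rw [gainDuhamel_eq]
  exact intervalIntegral.integral_nonneg (le_max_right _ _)
    fun s _ => gainDuhamelIntegrand_nonneg hβ hα hψ0 _ x v s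

end SeriesDefs

/-! ### The gain Duhamel map on bounded continuous densities -/

section SeriesCont

variable {X : Type*} [TopologicalSpace X] {G : Literature.Analysis.FluidPDE.Geometry d X} {β α : ℝ}

/-- Continuity (jointly in all parameters) of the gain term `q ↦ K⁺_β ψ(s(q), y(q), ·)(v(q))`
for a jointly continuous bounded `ψ`. [folklore] -/
theorem continuous_linearBoltzmannGain_comp {Y : Type*} [TopologicalSpace Y]
    [FirstCountableTopology Y] [LocallyCompactSpace Y] (hβ : 0 < β) {ψ : ℝ → X → 𝔼 → ℝ}
    (hψc : Continuous fun p : ℝ × X × 𝔼 => ψ p.1 p.2.1 p.2.2) {C : ℝ} (hψb : ∀ t x v, |ψ t x v| ≤ C)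
    {s : Y → ℝ} {y : Y → X} {v : Y → 𝔼} (hs : Continuous s) (hy : Continuous y)
    (hv : Continuous v) :
    Continuous fun q => linearBoltzmannGain β (fun w => ψ (s q) (y q) w) (v q) :=
  continuous_linearBoltzmannGain_param hβ (h := fun q w => ψ (s q) (y q) w)
    (hψc.comp ((hs.comp continuous_fst).prodMk ((hy.comp continuous_fst).prodMk continuous_snd)))
    (fun _ _ => hψb _ _ _) hv

/-- Continuity in `s` of the gain term along a backward characteristic. [folklore] -/
theorem continuous_gainAlong (hG : Continuous fun p : X × 𝔼 => G.translate p.1 p.2) (hβ : 0 < β)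
    {ψ : ℝ → X → 𝔼 → ℝ} (hψc : Continuous fun p : ℝ × X × 𝔼 => ψ p.1 p.2.1 p.2.2) {C : ℝ}
    (hψb : ∀ t x v, |ψ t x v| ≤ C) (T : ℝ) (x : X) (v : 𝔼) :
    Continuous fun s : ℝ =>
      linearBoltzmannGain β (fun w => ψ s (G.translate x ((s - T) • v)) w) v :=
  continuous_linearBoltzmannGain_comp (Y := ℝ) hβ hψc hψb continuous_id
    (hG.comp (continuous_const.prodMk ((continuous_id.sub continuous_const).smul
      continuous_const))) continuous_const

/-- Continuity in `s` of the Duhamel integrand. [folklore] -/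
theorem continuous_gainDuhamelIntegrand (hG : Continuous fun p : X × 𝔼 => G.translate p.1 p.2)
    (hβ : 0 < β) (α : ℝ) {ψ : ℝ → X → 𝔼 → ℝ}
    (hψc : Continuous fun p : ℝ × X × 𝔼 => ψ p.1 p.2.1 p.2.2)
    {C : ℝ} (hψb : ∀ t x v, |ψ t x v| ≤ C) (T : ℝ) (x : X) (v : 𝔼) :
    Continuous (gainDuhamelIntegrand G β α ψ T x v) := by
  unfold gainDuhamelIntegrand
  exact (by fun_prop : Continuous fun s : ℝ => exp (-(α * TaggedSphereDiffusion.collisionFrequency β v * (T - s)))).mul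
    (continuous_const.mul (continuous_gainAlong hG hβ hψc hψb T x v))

/-- **Monotonicity of the gain Duhamel map**: `0 ≤ ψ₁ ≤ ψ₂` with `ψ₂` jointly continuous and
bounded implies `𝒯 ψ₁ ≤ 𝒯 ψ₂` (nothing is assumed on `ψ₁`). [folklore] -/
theorem gainDuhamel_mono (hG : Continuous fun p : X × 𝔼 => G.translate p.1 p.2) (hβ : 0 < β)
    (hα : 0 ≤ α) {ψ₁ ψ₂ : ℝ → X → 𝔼 → ℝ} (h0 : ∀ t x v, 0 ≤ ψ₁ t x v)
    (h12 : ∀ t x v, ψ₁ t x v ≤ ψ₂ t x v)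
    (hψc : Continuous fun p : ℝ × X × 𝔼 => ψ₂ p.1 p.2.1 p.2.2) {C : ℝ}
    (hψb : ∀ t x v, |ψ₂ t x v| ≤ C) (t : ℝ) (x : X) (v : 𝔼) :
    gainDuhamel G β α ψ₁ t x v ≤ gainDuhamel G β α ψ₂ t x v := by
  rw [gainDuhamel_eq, gainDuhamel_eq, intervalIntegral.integral_of_le (le_max_right _ _),
    intervalIntegral.integral_of_le (le_max_right _ _)]
  refine integral_mono_of_nonneg (Eventually.of_forall fun s =>
    gainDuhamelIntegrand_nonneg hβ hα h0 _ x v s) ?_ (Eventually.of_forall fun s => ?_)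
  · exact ((continuous_gainDuhamelIntegrand hG hβ α hψc hψb _ x v).integrableOn_Icc).mono_set
      Ioc_subset_Icc_self
  · refine mul_le_mul_of_nonneg_left (mul_le_mul_of_nonneg_left ?_ hα) (exp_pos _).le
    have hmeas : Measurable fun w => ψ₂ s (G.translate x ((s - max t 0) • v)) w :=
      (hψc.comp (continuous_const.prodMk (continuous_const.prodMk continuous_id))).measurable
    exact linearBoltzmannGain_mono hβ (fun w => h0 _ _ _) (fun w => h12 _ _ _) hmeas
      (abs_le_quad_of_abs_le fun w => hψb _ _ _) v

/-- **Additivity of the gain Duhamel map** on jointly continuous bounded densities. [folklore] -/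
theorem gainDuhamel_add (hG : Continuous fun p : X × 𝔼 => G.translate p.1 p.2) (hβ : 0 < β)
    {ψ₁ ψ₂ : ℝ → X → 𝔼 → ℝ}
    (h1c : Continuous fun p : ℝ × X × 𝔼 => ψ₁ p.1 p.2.1 p.2.2) {C₁ : ℝ}
    (h1b : ∀ t x v, |ψ₁ t x v| ≤ C₁)
    (h2c : Continuous fun p : ℝ × X × 𝔼 => ψ₂ p.1 p.2.1 p.2.2) {C₂ : ℝ}
    (h2b : ∀ t x v, |ψ₂ t x v| ≤ C₂) (t : ℝ) (x : X) (v : 𝔼) :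
    gainDuhamel G β α (fun t x v => ψ₁ t x v + ψ₂ t x v) t x v =
      gainDuhamel G β α ψ₁ t x v + gainDuhamel G β α ψ₂ t x v := by
  rw [gainDuhamel_eq, gainDuhamel_eq, gainDuhamel_eq, ← intervalIntegral.integral_add
    ((continuous_gainDuhamelIntegrand hG hβ α h1c h1b _ x v).intervalIntegrable _ _)
    ((continuous_gainDuhamelIntegrand hG hβ α h2c h2b _ x v).intervalIntegrable _ _)]
  refine intervalIntegral.integral_congr fun s _ => ?_
  simp only [gainDuhamelIntegrand]
  have hm1 : Measurable fun w => ψ₁ s (G.translate x ((s - max t 0) • v)) w :=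
    (h1c.comp (continuous_const.prodMk (continuous_const.prodMk continuous_id))).measurable
  have hm2 : Measurable fun w => ψ₂ s (G.translate x ((s - max t 0) • v)) w :=
    (h2c.comp (continuous_const.prodMk (continuous_const.prodMk continuous_id))).measurable
  rw [linearBoltzmannGain_add hβ hm1 hm2 (abs_le_quad_of_abs_le fun w => h1b _ _ _)
    (abs_le_quad_of_abs_le fun w => h2b _ _ _)]
  ring

/-- **Sup-norm bound on the gain Duhamel map**: `|ψ| ≤ C ⟹ |𝒯 ψ| ≤ C (1 - e^{-α a t⁺}) ≤ C`.
[folklore] -/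
theorem abs_gainDuhamel_le (hG : Continuous fun p : X × 𝔼 => G.translate p.1 p.2) (hβ : 0 < β)
    (hα : 0 ≤ α) {ψ : ℝ → X → 𝔼 → ℝ} (hψc : Continuous fun p : ℝ × X × 𝔼 => ψ p.1 p.2.1 p.2.2)
    {C : ℝ} (hψb : ∀ t x v, |ψ t x v| ≤ C) (t : ℝ) (x : X) (v : 𝔼) :
    |gainDuhamel G β α ψ t x v| ≤ C * (1 - exp (-(α * TaggedSphereDiffusion.collisionFrequency β v * max t 0))) := by
  rw [gainDuhamel_eq]
  have hT := le_max_right t 0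
  set T := max t 0
  have hcont := continuous_gainDuhamelIntegrand hG hβ α hψc hψb T x v
  calc |∫ s in (0 : ℝ)..T, gainDuhamelIntegrand G β α ψ T x v s|
      ≤ ∫ s in (0 : ℝ)..T, |gainDuhamelIntegrand G β α ψ T x v s| :=
        intervalIntegral.abs_integral_le_integral_abs hT
    _ ≤ ∫ s in (0 : ℝ)..T, exp (-(α * TaggedSphereDiffusion.collisionFrequency β v * (T - s))) *
          (α * TaggedSphereDiffusion.collisionFrequency β v) * C := by
        refine intervalIntegral.integral_mono_on hT (hcont.abs.intervalIntegrable _ _)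
          ((by fun_prop : Continuous fun s => exp (-(α * TaggedSphereDiffusion.collisionFrequency β v * (T - s))) *
            (α * TaggedSphereDiffusion.collisionFrequency β v) * C).intervalIntegrable _ _) fun s _ => ?_
        exact abs_gainDuhamelIntegrand_le hβ hα hψb T x v s
    _ = C * (1 - exp (-(α * TaggedSphereDiffusion.collisionFrequency β v * T))) := by
        rw [intervalIntegral.integral_mul_const, integral_mul_exp_neg_mul_sub, mul_comm]

/-- In particular `|𝒯 ψ| ≤ C`. [folklore] -/
theorem abs_gainDuhamel_le' (hG : Continuous fun p : X × 𝔼 => G.translate p.1 p.2) (hβ : 0 < β)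
    (hα : 0 ≤ α) {ψ : ℝ → X → 𝔼 → ℝ} (hψc : Continuous fun p : ℝ × X × 𝔼 => ψ p.1 p.2.1 p.2.2)
    {C : ℝ} (hψb : ∀ t x v, |ψ t x v| ≤ C) (t : ℝ) (x : X) (v : 𝔼) :
    |gainDuhamel G β α ψ t x v| ≤ C := by
  have hC0 : 0 ≤ C := (abs_nonneg _).trans (hψb 0 x v)
  refine (abs_gainDuhamel_le hG hβ hα hψc hψb t x v).trans ?_
  have h1 : 0 ≤ exp (-(α * TaggedSphereDiffusion.collisionFrequency β v * max t 0)) := (exp_pos _).le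
  nlinarith

end SeriesCont

/-! ### The terms of the series: continuity, positivity and the bound `Sₙ ≤ R` -/

section Terms

variable {X : Type*} [TopologicalSpace X] [LocallyCompactSpace X] [FirstCountableTopology X]
  {G : Literature.Analysis.FluidPDE.Geometry d X} {β α : ℝ}

/-- **Joint continuity of the gain Duhamel map** on bounded jointly continuous densities, for a
geometry with continuous translations. [folklore] -/
theorem continuous_gainDuhamel (hG : Continuous fun p : X × 𝔼 => G.translate p.1 p.2)
    (hβ : 0 < β) (α : ℝ) {ψ : ℝ → X → 𝔼 → ℝ}
    (hψc : Continuous fun p : ℝ × X × 𝔼 => ψ p.1 p.2.1 p.2.2)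
    {C : ℝ} (hψb : ∀ t x v, |ψ t x v| ≤ C) :
    Continuous fun p : ℝ × X × 𝔼 => gainDuhamel G β α ψ p.1 p.2.1 p.2.2 := by
  unfold gainDuhamel
  have ha := continuous_collisionFrequency (d := d) hβ
  have hF : Continuous (Function.uncurry fun (p : ℝ × X × 𝔼) (s : ℝ) =>
      exp (-(α * TaggedSphereDiffusion.collisionFrequency β p.2.2 * (max p.1 0 - s))) *
        (α * linearBoltzmannGain β
          (fun w => ψ s (G.translate p.2.1 ((s - max p.1 0) • p.2.2)) w) p.2.2)) := by
    refine Continuous.mul ?_ (continuous_const.mul ?_)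
    · refine (Continuous.neg ?_).rexp
      exact ((continuous_const.mul (ha.comp continuous_fst.snd.snd)).mul
        ((continuous_fst.fst.max continuous_const).sub continuous_snd))
    · refine continuous_linearBoltzmannGain_comp (Y := (ℝ × X × 𝔼) × ℝ) hβ hψc hψb
        continuous_snd ?_ continuous_fst.snd.snd
      exact hG.comp (continuous_fst.snd.fst.prodMk
        ((continuous_snd.sub (continuous_fst.fst.max continuous_const)).smul
          continuous_fst.snd.snd))
  exact intervalIntegral.continuous_parametric_intervalIntegral_of_continuous hF
    (continuous_fst.max continuous_const)


omit [TopologicalSpace X] [LocallyCompactSpace X] [FirstCountableTopology X] in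
/-- Homogeneity of the gain Duhamel map: `𝒯 (c ψ) = c 𝒯 ψ`. [folklore] -/
theorem gainDuhamel_const_mul (G : Literature.Analysis.FluidPDE.Geometry d X) (β α c : ℝ) (ψ : ℝ → X → 𝔼 → ℝ)
    (t : ℝ) (x : X) (v : 𝔼) :
    gainDuhamel G β α (fun t x v => c * ψ t x v) t x v = c * gainDuhamel G β α ψ t x v := by
  rw [gainDuhamel, gainDuhamel, ← intervalIntegral.integral_const_mul]
  refine intervalIntegral.integral_congr fun s _ => ?_
  simp only [linearBoltzmannGain_const_mul]
  ring

/-- Standing hypotheses of the collision-series construction: continuous translations,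
`β > 0`, `α ≥ 0`, and a jointly continuous datum `0 ≤ f₀ ≤ R`. [folklore] -/
structure LinearBoltzmannData (G : Literature.Analysis.FluidPDE.Geometry d X) (β α : ℝ) (f₀ : X → 𝔼 → ℝ) (R : ℝ) : Prop where
  continuous_translate : Continuous fun p : X × 𝔼 => G.translate p.1 p.2
  beta_pos : 0 < β
  alpha_nonneg : 0 ≤ α
  continuous_data : Continuous fun p : X × 𝔼 => f₀ p.1 p.2
  data_nonneg : ∀ x v, 0 ≤ f₀ x v
  data_le : ∀ x v, f₀ x v ≤ R

namespace LinearBoltzmannData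

variable {f₀ : X → EuclideanSpace ℝ d → ℝ} {R : ℝ} (h : LinearBoltzmannData G β α f₀ R)
include h

/-- **The terms of the collision series are jointly continuous and take values in `[0, R]`**
for continuous data `0 ≤ f₀ ≤ R` (induction: `0 ≤ 𝒯 uₙ ≤ 𝒯 R = R (1 - e^{-α a t}) ≤ R`).
[folklore] -/
theorem continuous_linearBoltzmannTerm_and_mem (n : ℕ) :
    (Continuous fun p : ℝ × X × 𝔼 => linearBoltzmannTerm G β α f₀ n p.1 p.2.1 p.2.2) ∧
      ∀ t x v, 0 ≤ linearBoltzmannTerm G β α f₀ n t x v ∧ linearBoltzmannTerm G β α f₀ n t x v ≤ R := by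
  have ha := continuous_collisionFrequency (d := d) h.beta_pos
  induction n with
  | zero =>
    refine ⟨?_, fun t x v => ?_⟩
    · simp only [linearBoltzmannTerm_zero]
      refine Continuous.mul ?_ ?_
      · refine (Continuous.neg ?_).rexp
        exact (continuous_const.mul (ha.comp continuous_snd.snd)).mul
          (continuous_fst.max continuous_const)
      · exact h.continuous_data.comp ((h.continuous_translate.comp (continuous_snd.fst.prodMk
          ((continuous_fst.max continuous_const).neg.smul continuous_snd.snd))).prodMk
          continuous_snd.snd)
    · simp only [linearBoltzmannTerm_zero]
      have h1 : exp (-(α * TaggedSphereDiffusion.collisionFrequency β v * max t 0)) ≤ 1 := by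
        rw [exp_le_one_iff, neg_nonpos]
        exact mul_nonneg (mul_nonneg h.alpha_nonneg (TaggedLinearBoltzmannSeries.collisionFrequency_nonneg h.beta_pos v)) (le_max_right _ _)
      have h0 := (exp_pos (-(α * TaggedSphereDiffusion.collisionFrequency β v * max t 0))).le
      exact ⟨mul_nonneg h0 (h.data_nonneg _ _), (mul_le_mul h1 (h.data_le _ _) (h.data_nonneg _ _) zero_le_one).trans
        (one_mul R).le⟩
  | succ n ih =>
    have hb : ∀ t x v, |linearBoltzmannTerm G β α f₀ n t x v| ≤ R := fun t x v =>
      (abs_of_nonneg (ih.2 t x v).1).le.trans (ih.2 t x v).2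
    refine ⟨?_, fun t x v => ⟨?_, ?_⟩⟩
    · simpa only [linearBoltzmannTerm_succ] using continuous_gainDuhamel h.continuous_translate h.beta_pos α ih.1 hb
    · exact gainDuhamel_nonneg h.beta_pos h.alpha_nonneg (fun t x v => (ih.2 t x v).1) t x v
    · have hR : 0 ≤ R := (h.data_nonneg x v).trans (h.data_le x v)
      rw [linearBoltzmannTerm_succ]
      calc gainDuhamel G β α (linearBoltzmannTerm G β α f₀ n) t x v
          ≤ gainDuhamel G β α (fun _ _ _ => R) t x v :=
            gainDuhamel_mono h.continuous_translate h.beta_pos h.alpha_nonneg (fun t x v => (ih.2 t x v).1) (fun t x v => (ih.2 t x v).2)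
              continuous_const (C := R) (fun _ _ _ => (abs_of_nonneg hR).le) t x v
        _ = R * (1 - exp (-(α * TaggedSphereDiffusion.collisionFrequency β v * max t 0))) := gainDuhamel_const _ _ _ _ _ _ _
        _ ≤ R := by
            have h0 := (exp_pos (-(α * TaggedSphereDiffusion.collisionFrequency β v * max t 0))).le
            nlinarith

/-- Joint continuity of the terms. [folklore] -/
theorem continuous_linearBoltzmannTerm (n : ℕ) :
    Continuous fun p : ℝ × X × 𝔼 => linearBoltzmannTerm G β α f₀ n p.1 p.2.1 p.2.2 :=
  (h.continuous_linearBoltzmannTerm_and_mem n).1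

/-- The terms are nonnegative. [folklore] -/
theorem linearBoltzmannTerm_nonneg (n : ℕ) (t : ℝ) (x : X) (v : 𝔼) :
    0 ≤ linearBoltzmannTerm G β α f₀ n t x v :=
  ((h.continuous_linearBoltzmannTerm_and_mem n).2 t x v).1

/-- The terms are bounded by `R`. [folklore] -/
theorem abs_linearBoltzmannTerm_le (n : ℕ) (t : ℝ) (x : X) (v : 𝔼) :
    |linearBoltzmannTerm G β α f₀ n t x v| ≤ R :=
  (abs_of_nonneg (h.linearBoltzmannTerm_nonneg n t x v)).le.trans
    ((h.continuous_linearBoltzmannTerm_and_mem n).2 t x v).2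

/-- Joint continuity of the partial sums. [folklore] -/
theorem continuous_linearBoltzmannPartialSum (n : ℕ) :
    Continuous fun p : ℝ × X × 𝔼 => linearBoltzmannPartialSum G β α f₀ n p.1 p.2.1 p.2.2 := by
  unfold linearBoltzmannPartialSum
  exact continuous_finsetSum _ fun k _ => h.continuous_linearBoltzmannTerm k

/-- The partial sums are nonnegative. [folklore] -/
theorem linearBoltzmannPartialSum_nonneg (n : ℕ) (t : ℝ) (x : X) (v : 𝔼) :
    0 ≤ linearBoltzmannPartialSum G β α f₀ n t x v :=
  Finset.sum_nonneg fun k _ => h.linearBoltzmannTerm_nonneg k t x v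

/-- A crude bound on the partial sums: `|Sₙ| ≤ n R`. [folklore] -/
theorem abs_linearBoltzmannPartialSum_le (n : ℕ) (t : ℝ) (x : X) (v : 𝔼) :
    |linearBoltzmannPartialSum G β α f₀ n t x v| ≤ n * R := by
  refine (abs_of_nonneg (h.linearBoltzmannPartialSum_nonneg n t x v)).le.trans ?_
  calc linearBoltzmannPartialSum G β α f₀ n t x v ≤ ∑ _k ∈ Finset.range n, R :=
        Finset.sum_le_sum fun k _ =>
          ((h.continuous_linearBoltzmannTerm_and_mem k).2 t x v).2
    _ = n * R := by rw [Finset.sum_const, Finset.card_range, nsmul_eq_mul]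

/-- **The gain Duhamel map commutes with the partial sums**: `𝒯 Sₙ = ∑_{k<n} u_{k+1}`.
[folklore] -/
theorem gainDuhamel_linearBoltzmannPartialSum (n : ℕ) (t : ℝ) (x : X) (v : 𝔼) :
    gainDuhamel G β α (linearBoltzmannPartialSum G β α f₀ n) t x v =
      ∑ k ∈ Finset.range n, linearBoltzmannTerm G β α f₀ (k + 1) t x v := by
  induction n generalizing t x v with
  | zero =>
    rw [linearBoltzmannPartialSum_zero, Finset.sum_range_zero]
    have := gainDuhamel_const G β α 0 t x v
    rwa [zero_mul] at this
  | succ n ih =>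
    have hS : linearBoltzmannPartialSum G β α f₀ (n + 1) = fun t x v =>
        linearBoltzmannPartialSum G β α f₀ n t x v + linearBoltzmannTerm G β α f₀ n t x v := by
      funext t x v; exact linearBoltzmannPartialSum_succ _ _ _ _ _ _ _ _
    rw [hS, gainDuhamel_add h.continuous_translate h.beta_pos (h.continuous_linearBoltzmannPartialSum n)
      (h.abs_linearBoltzmannPartialSum_le n)
      (h.continuous_linearBoltzmannTerm n)
      (h.abs_linearBoltzmannTerm_le n), ih, Finset.sum_range_succ,
      linearBoltzmannTerm_succ]

/-- **The Picard recursion of the partial sums**: `Sₙ₊₁ = u₀ + 𝒯 Sₙ`. [folklore] -/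
theorem linearBoltzmannPartialSum_succ_eq (n : ℕ) (t : ℝ) (x : X) (v : 𝔼) :
    linearBoltzmannPartialSum G β α f₀ (n + 1) t x v =
      linearBoltzmannTerm G β α f₀ 0 t x v +
        gainDuhamel G β α (linearBoltzmannPartialSum G β α f₀ n) t x v := by
  rw [h.gainDuhamel_linearBoltzmannPartialSum, linearBoltzmannPartialSum,
    Finset.sum_range_succ', add_comm]

/-- **The maximum principle for the partial sums**: `Sₙ ≤ R`
(`Sₙ₊₁ = u₀ + 𝒯 Sₙ ≤ e^{-α a t} R + R (1 - e^{-α a t}) = R`). [folklore] -/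
theorem linearBoltzmannPartialSum_le (n : ℕ) (t : ℝ) (x : X) (v : 𝔼) :
    linearBoltzmannPartialSum G β α f₀ n t x v ≤ R := by
  have hR : 0 ≤ R := (h.data_nonneg x v).trans (h.data_le x v)
  induction n generalizing t x v with
  | zero => simp [hR]
  | succ n ih =>
    rw [h.linearBoltzmannPartialSum_succ_eq]
    have h1 : gainDuhamel G β α (linearBoltzmannPartialSum G β α f₀ n) t x v ≤
        R * (1 - exp (-(α * TaggedSphereDiffusion.collisionFrequency β v * max t 0))) := by
      calc gainDuhamel G β α (linearBoltzmannPartialSum G β α f₀ n) t x v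
          ≤ gainDuhamel G β α (fun _ _ _ => R) t x v :=
            gainDuhamel_mono h.continuous_translate h.beta_pos h.alpha_nonneg (h.linearBoltzmannPartialSum_nonneg n)
              ih continuous_const (C := R) (fun _ _ _ => (abs_of_nonneg hR).le) t x v
        _ = _ := gainDuhamel_const G β α R t x v
    have h2 : linearBoltzmannTerm G β α f₀ 0 t x v ≤
        exp (-(α * TaggedSphereDiffusion.collisionFrequency β v * max t 0)) * R := by
      rw [linearBoltzmannTerm_zero]
      exact mul_le_mul_of_nonneg_left (h.data_le _ _) (exp_pos _).le
    nlinarith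

/-- **Summability of the collision series** (nonnegative terms, partial sums `≤ R`). [folklore] -/
theorem summable_linearBoltzmannTerm (t : ℝ) (x : X) (v : 𝔼) :
    Summable fun n => linearBoltzmannTerm G β α f₀ n t x v :=
  summable_of_sum_range_le (c := R) (fun n => h.linearBoltzmannTerm_nonneg n t x v)
    fun n => h.linearBoltzmannPartialSum_le n t x v

/-- The partial sums converge to the series. [folklore] -/
theorem tendsto_linearBoltzmannPartialSum (t : ℝ) (x : X) (v : 𝔼) :
    Tendsto (fun n => linearBoltzmannPartialSum G β α f₀ n t x v) atTop
      (𝓝 (linearBoltzmannSeries G β α f₀ t x v)) :=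
  (h.summable_linearBoltzmannTerm t x v).hasSum.tendsto_sum_nat

/-- **Maximum principle** for the series solution (BGSR Remark 3.5: "the maximum principle for the
linear Boltzmann equation leads to `sup_{t ≥ 0} φ_α(t, z₁) ≤ ‖ρ⁰‖_{L^∞}`"): `0 ≤ φ_α ≤ R` for a
datum `0 ≤ f₀ ≤ R`. [cite: BodineauGallagherSaintRaymondInvent2016, Remark 3.5] -/
theorem linearBoltzmannSeries_mem (t : ℝ) (x : X) (v : 𝔼) :
    0 ≤ linearBoltzmannSeries G β α f₀ t x v ∧ linearBoltzmannSeries G β α f₀ t x v ≤ R :=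
  ⟨tsum_nonneg fun n => h.linearBoltzmannTerm_nonneg n t x v,
    (h.summable_linearBoltzmannTerm t x v).tsum_le_of_sum_range_le
      fun n => h.linearBoltzmannPartialSum_le n t x v⟩

/-- The partial sums are below the series. [folklore] -/
theorem linearBoltzmannPartialSum_le_series (n : ℕ) (t : ℝ) (x : X) (v : 𝔼) :
    linearBoltzmannPartialSum G β α f₀ n t x v ≤ linearBoltzmannSeries G β α f₀ t x v :=
  (h.summable_linearBoltzmannTerm t x v).sum_le_tsum (Finset.range n)
    fun k _ => h.linearBoltzmannTerm_nonneg k t x v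

/-- The partial sums are bounded by `R` in absolute value. [folklore] -/
theorem abs_linearBoltzmannPartialSum_le' (n : ℕ) (t : ℝ) (x : X) (v : 𝔼) :
    |linearBoltzmannPartialSum G β α f₀ n t x v| ≤ R :=
  (abs_of_nonneg (h.linearBoltzmannPartialSum_nonneg n t x v)).le.trans
    (h.linearBoltzmannPartialSum_le n t x v)

/-- The series is bounded by `R` in absolute value. [folklore] -/
theorem abs_linearBoltzmannSeries_le (t : ℝ) (x : X) (v : 𝔼) :
    |linearBoltzmannSeries G β α f₀ t x v| ≤ R :=
  (abs_of_nonneg (h.linearBoltzmannSeries_mem t x v).1).le.trans (h.linearBoltzmannSeries_mem t x v).2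

/-- The series is measurable in the velocity (pointwise limit of continuous partial sums).
[folklore] -/
theorem measurable_linearBoltzmannSeries (s : ℝ) (y : X) :
    Measurable fun w => linearBoltzmannSeries G β α f₀ s y w :=
  measurable_of_tendsto_metrizable (f := fun n w => linearBoltzmannPartialSum G β α f₀ n s y w)
    (fun n => ((h.continuous_linearBoltzmannPartialSum n).comp
      (continuous_const.prodMk (continuous_const.prodMk continuous_id))).measurable)
    (tendsto_pi_nhds.2 fun w => h.tendsto_linearBoltzmannPartialSum s y w)

/-- The partial sums are measurable in the velocity. [folklore] -/
theorem measurable_linearBoltzmannPartialSum (n : ℕ) (s : ℝ) (y : X) :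
    Measurable fun w => linearBoltzmannPartialSum G β α f₀ n s y w :=
  ((h.continuous_linearBoltzmannPartialSum n).comp
    (continuous_const.prodMk (continuous_const.prodMk continuous_id))).measurable

/-- **Dominated convergence inside the gain operator**: `K⁺ Sₙ(s, y, ·) → K⁺ φ(s, y, ·)`.
[folklore] -/
theorem tendsto_linearBoltzmannGain_partialSum (s : ℝ) (y : X) (v : 𝔼) :
    Tendsto (fun n => linearBoltzmannGain β (fun w => linearBoltzmannPartialSum G β α f₀ n s y w) v)
      atTop (𝓝 (linearBoltzmannGain β (fun w => linearBoltzmannSeries G β α f₀ s y w) v)) := by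
  have hβ := h.beta_pos
  simp only [linearBoltzmannGain_eq]
  have hinner : ∀ w, Tendsto (fun n => ∫ ν, gainIntegrand β
      (fun w => linearBoltzmannPartialSum G β α f₀ n s y w) v w ν ∂sphereMeasure) atTop
      (𝓝 (∫ ν, gainIntegrand β (fun w => linearBoltzmannSeries G β α f₀ s y w) v w ν ∂sphereMeasure)) :=
    fun w => by
      refine tendsto_integral_of_dominated_convergence
        (bound := fun _ => (‖v‖ + ‖w‖) * Literature.Analysis.FunctionSpaces.maxwellianBeta β w * R) ?_ (integrable_const _) ?_ ?_
      · exact fun n => ((measurable_gainIntegrand (h.measurable_linearBoltzmannPartialSum n s y)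
          v).comp measurable_prodMk_left).aestronglyMeasurable
      · exact fun n => Eventually.of_forall fun ν => by
          rw [Real.norm_eq_abs]
          exact abs_gainIntegrand_le hβ (fun w => h.abs_linearBoltzmannPartialSum_le' n s y w) v w ν
      · exact Eventually.of_forall fun ν =>
          ((h.tendsto_linearBoltzmannPartialSum s y _).const_mul _)
  refine tendsto_integral_of_dominated_convergence (bound := fun w =>
    KineticTheory.sphereMass 𝔼 * ((‖v‖ + ‖w‖) * Literature.Analysis.FunctionSpaces.maxwellianBeta β w * R)) ?_ ?_ ?_
    (Eventually.of_forall hinner)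
  · exact fun n => aestronglyMeasurable_integral_gainIntegrand
      (h.measurable_linearBoltzmannPartialSum n s y) v
  · exact ((integrable_norm_add_norm_mul_maxwellianBeta hβ v).mul_const R).const_mul _
  · exact fun n => Eventually.of_forall fun w => by
      rw [Real.norm_eq_abs]
      exact abs_integral_gainIntegrand_le hβ (fun w => h.abs_linearBoltzmannPartialSum_le' n s y w) v w

/-- **Dominated convergence in the gain Duhamel map**: `𝒯 Sₙ → 𝒯 φ` pointwise. [folklore] -/
theorem tendsto_gainDuhamel_partialSum (t : ℝ) (x : X) (v : 𝔼) :
    Tendsto (fun n => gainDuhamel G β α (linearBoltzmannPartialSum G β α f₀ n) t x v) atTop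
      (𝓝 (gainDuhamel G β α (linearBoltzmannSeries G β α f₀) t x v)) := by
  have hβ := h.beta_pos
  have hα := h.alpha_nonneg
  simp only [gainDuhamel_eq, intervalIntegral.integral_of_le (le_max_right t 0)]
  set T := max t 0
  refine tendsto_integral_of_dominated_convergence (μ := volume.restrict (Ioc 0 T))
    (bound := fun s => exp (-(α * TaggedSphereDiffusion.collisionFrequency β v * (T - s))) *
      (α * TaggedSphereDiffusion.collisionFrequency β v) * R) ?_ ?_ ?_ ?_
  · exact fun n => (continuous_gainDuhamelIntegrand h.continuous_translate hβ α
      (h.continuous_linearBoltzmannPartialSum n) (h.abs_linearBoltzmannPartialSum_le' n) T x v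
      ).aestronglyMeasurable
  · exact ((by fun_prop : Continuous fun s => exp (-(α * TaggedSphereDiffusion.collisionFrequency β v * (T - s))) *
      (α * TaggedSphereDiffusion.collisionFrequency β v) * R).integrableOn_Icc (a := 0) (b := T)).mono_set
      Ioc_subset_Icc_self
  · refine fun n => Eventually.of_forall fun s => ?_
    rw [Real.norm_eq_abs]
    exact abs_gainDuhamelIntegrand_le hβ hα (h.abs_linearBoltzmannPartialSum_le' n) T x v s
  · exact Eventually.of_forall fun s =>
      ((h.tendsto_linearBoltzmannGain_partialSum s _ v).const_mul α).const_mul _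

/-- **The series solves the linear Boltzmann equation in gain/loss (integrating-factor) mild
form**: `φ = u₀ + 𝒯 φ`, i.e.
`φ(t, x, v) = e^{-α a(v) t} f₀(x - tv, v) + ∫₀ᵗ e^{-α a(v)(t-s)} α K⁺φ(s, x - (t-s)v, ·)(v) ds`
(`t ≥ 0`; pass to the limit in `Sₙ₊₁ = u₀ + 𝒯 Sₙ`). [cite: BodineauGallagherSaintRaymondInvent2016, (1.3)] -/
theorem linearBoltzmannSeries_eq (t : ℝ) (x : X) (v : 𝔼) :
    linearBoltzmannSeries G β α f₀ t x v = linearBoltzmannTerm G β α f₀ 0 t x v +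
      gainDuhamel G β α (linearBoltzmannSeries G β α f₀) t x v := by
  have h1 : Tendsto (fun n => linearBoltzmannPartialSum G β α f₀ (n + 1) t x v) atTop
      (𝓝 (linearBoltzmannSeries G β α f₀ t x v)) :=
    (h.tendsto_linearBoltzmannPartialSum t x v).comp (tendsto_add_atTop_nat 1)
  have h2 : Tendsto (fun n => linearBoltzmannPartialSum G β α f₀ (n + 1) t x v) atTop
      (𝓝 (linearBoltzmannTerm G β α f₀ 0 t x v +
        gainDuhamel G β α (linearBoltzmannSeries G β α f₀) t x v)) := by
    simp_rw [h.linearBoltzmannPartialSum_succ_eq]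
    exact tendsto_const_nhds.add (h.tendsto_gainDuhamel_partialSum t x v)
  exact tendsto_nhds_unique h1 h2

end LinearBoltzmannData

/-! ### Linearity of the series in the datum -/

omit [TopologicalSpace X] [LocallyCompactSpace X] [FirstCountableTopology X] in
/-- Homogeneity of the terms in the datum. [folklore] -/
theorem linearBoltzmannTerm_const_mul (G : Literature.Analysis.FluidPDE.Geometry d X) (β α c : ℝ) (f₀ : X → 𝔼 → ℝ)
    (n : ℕ) : linearBoltzmannTerm G β α (fun x v => c * f₀ x v) n =
      fun t x v => c * linearBoltzmannTerm G β α f₀ n t x v := by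
  induction n with
  | zero => funext t x v; simp only [linearBoltzmannTerm_zero]; ring
  | succ n ih =>
    rw [linearBoltzmannTerm_succ, linearBoltzmannTerm_succ, ih]
    funext t x v
    exact gainDuhamel_const_mul G β α c _ t x v

omit [TopologicalSpace X] [LocallyCompactSpace X] [FirstCountableTopology X] in
/-- Homogeneity of the series in the datum. [folklore] -/
theorem linearBoltzmannSeries_const_mul (G : Literature.Analysis.FluidPDE.Geometry d X) (β α c : ℝ) (f₀ : X → 𝔼 → ℝ)
    (t : ℝ) (x : X) (v : 𝔼) : linearBoltzmannSeries G β α (fun x v => c * f₀ x v) t x v =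
      c * linearBoltzmannSeries G β α f₀ t x v := by
  simp only [linearBoltzmannSeries, linearBoltzmannTerm_const_mul, tsum_mul_left]

/-- **Additivity of the terms in the datum** (for admissible data). [folklore] -/
theorem linearBoltzmannTerm_add {f₀ g₀ : X → 𝔼 → ℝ} {R₁ R₂ : ℝ} (h₁ : LinearBoltzmannData G β α f₀ R₁)
    (h₂ : LinearBoltzmannData G β α g₀ R₂) (n : ℕ) :
    linearBoltzmannTerm G β α (fun x v => f₀ x v + g₀ x v) n =
      fun t x v => linearBoltzmannTerm G β α f₀ n t x v + linearBoltzmannTerm G β α g₀ n t x v := by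
  induction n with
  | zero => funext t x v; simp only [linearBoltzmannTerm_zero]; ring
  | succ n ih =>
    rw [linearBoltzmannTerm_succ, linearBoltzmannTerm_succ, linearBoltzmannTerm_succ, ih]
    funext t x v
    exact gainDuhamel_add h₁.continuous_translate h₁.beta_pos (h₁.continuous_linearBoltzmannTerm n)
      (h₁.abs_linearBoltzmannTerm_le n) (h₂.continuous_linearBoltzmannTerm n)
      (h₂.abs_linearBoltzmannTerm_le n) t x v

/-- **Additivity of the series in the datum** (for admissible data). [folklore] -/
theorem linearBoltzmannSeries_add {f₀ g₀ : X → 𝔼 → ℝ} {R₁ R₂ : ℝ} (h₁ : LinearBoltzmannData G β α f₀ R₁)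
    (h₂ : LinearBoltzmannData G β α g₀ R₂) (t : ℝ) (x : X) (v : 𝔼) :
    linearBoltzmannSeries G β α (fun x v => f₀ x v + g₀ x v) t x v =
      linearBoltzmannSeries G β α f₀ t x v + linearBoltzmannSeries G β α g₀ t x v := by
  simp only [linearBoltzmannSeries, linearBoltzmannTerm_add h₁ h₂]
  exact (h₁.summable_linearBoltzmannTerm t x v).tsum_add (h₂.summable_linearBoltzmannTerm t x v)

omit [LocallyCompactSpace X] [FirstCountableTopology X] in
/-- **Additivity of the gain Duhamel map over finite sums** of jointly continuous bounded
densities. [folklore] -/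
theorem gainDuhamel_finset_sum (hG : Continuous fun p : X × 𝔼 => G.translate p.1 p.2) (hβ : 0 < β)
    {ι : Type*} (S : Finset ι) {ψ : ι → ℝ → X → 𝔼 → ℝ}
    (hc : ∀ i, Continuous fun p : ℝ × X × 𝔼 => ψ i p.1 p.2.1 p.2.2)
    (hb : ∀ i, ∃ C, ∀ t x v, |ψ i t x v| ≤ C) (t : ℝ) (x : X) (v : 𝔼) :
    gainDuhamel G β α (fun t x v => ∑ i ∈ S, ψ i t x v) t x v =
      ∑ i ∈ S, gainDuhamel G β α (ψ i) t x v := by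
  classical
  induction S using Finset.induction_on with
  | empty =>
    simp only [Finset.sum_empty]
    have := gainDuhamel_const G β α 0 t x v
    rwa [zero_mul] at this
  | insert a S ha ih =>
    simp only [Finset.sum_insert ha]
    choose C hC using hb
    rw [← ih]
    refine gainDuhamel_add hG hβ (hc a) (hC a) (continuous_finsetSum S fun i _ => hc i)
      (C₂ := ∑ i ∈ S, C i) (fun t x v => ?_) t x v
    exact (Finset.abs_sum_le_sum_abs _ _).trans (Finset.sum_le_sum fun i _ => hC i t x v)

end Terms

/-! ## Conservativity: collisions do not accumulate (`∑ₙ uₙ[1] = 1`)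

For the constant datum `1` the partial sums `Sₙ[1] = 1 - pₙ` compute the "probability of fewer
than `n` collisions before time `t`" of the underlying velocity jump process, and `p_{n+1} = 𝒯 pₙ`.
Since the collision frequency `a_β(v)` is unbounded, `pₙ → 0` is not uniform in `v`; it is
obtained from a Lyapunov (supersolution) bound: with `W(v) = 1 + |v|²` and the drift inequality
`K⁺_β W ≤ a_β W + C (1 + |v|)` (`linearBoltzmannGain_normSq_le`), the function
`F(t, v) = A (e^{λ t} - 1) W(v)` satisfies `𝒯(1 + F) ≤ F`, whence `∑_{k=1}^{n} p_k ≤ F` and, the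
`p_k` being decreasing, `pₙ ≤ F / n → 0`. -/

section Conservativity

variable {X : Type*} [TopologicalSpace X] [LocallyCompactSpace X] [FirstCountableTopology X]
  {G : Literature.Analysis.FluidPDE.Geometry d X} {β α : ℝ}

omit [Fintype d] in
/-- The pointwise inequality making `F = A (e^{λ s} - 1) W` a supersolution: with `A = α c_a`,
`λ = α C_D + 1`, if `a ≤ c_a W`, `D ≤ C_D W` and `K ≤ a W + D` then
`α (a + A (e^{λs} - 1) K) ≤ α a A (e^{λs} - 1) W + A λ e^{λs} W` for `s ≥ 0`. [folklore] -/
theorem superSol_pointwise {α a K W D ca CD s : ℝ} (hα : 0 ≤ α) (hW : 0 ≤ W)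
    (haW : a ≤ ca * W) (hD : D ≤ CD * W) (hK : K ≤ a * W + D) (hca : 0 ≤ ca) (hCD : 0 ≤ CD)
    (hs : 0 ≤ s) :
    α * (a + α * ca * (exp ((α * CD + 1) * s) - 1) * K) ≤
      α * a * (α * ca * (exp ((α * CD + 1) * s) - 1) * W) +
        α * ca * ((α * CD + 1) * exp ((α * CD + 1) * s)) * W := by
  set A := α * ca with hA_def
  set e := exp ((α * CD + 1) * s) with he_def
  have he1 : 1 ≤ e := one_le_exp (mul_nonneg (by positivity) hs)
  have hA : 0 ≤ A := mul_nonneg hα hca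
  have hαA : 0 ≤ α * A * (e - 1) := mul_nonneg (mul_nonneg hα hA) (by linarith)
  have h1 : α * A * (e - 1) * K ≤ α * A * (e - 1) * (a * W + D) :=
    mul_le_mul_of_nonneg_left hK hαA
  have h2 : α * A * (e - 1) * D ≤ α * A * e * (CD * W) := by
    calc α * A * (e - 1) * D ≤ α * A * (e - 1) * (CD * W) :=
          mul_le_mul_of_nonneg_left hD hαA
      _ ≤ α * A * e * (CD * W) := by
          refine mul_le_mul_of_nonneg_right ?_ (mul_nonneg hCD hW)
          exact mul_le_mul_of_nonneg_left (by linarith) (mul_nonneg hα hA)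
  have h3 : α * a ≤ A * W * e := by
    calc α * a ≤ α * (ca * W) := mul_le_mul_of_nonneg_left haW hα
      _ = A * W * 1 := by ring
      _ ≤ A * W * e := mul_le_mul_of_nonneg_left he1 (mul_nonneg hA hW)
  nlinarith [h1, h2, h3]

omit [Fintype d] in
/-- The integrated supersolution inequality: `∫₀ᵀ e^{-αa(T-s)} α (a + A(e^{λs}-1) K) ds ≤
A (e^{λT} - 1) W` (fundamental theorem of calculus on `s ↦ e^{-αa(T-s)} F(s)`). [folklore] -/
theorem superSol_integral {α a K W D ca CD T : ℝ} (hα : 0 ≤ α) (hW : 0 ≤ W)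
    (haW : a ≤ ca * W) (hD : D ≤ CD * W) (hK : K ≤ a * W + D) (hca : 0 ≤ ca) (hCD : 0 ≤ CD)
    (hT : 0 ≤ T) :
    ∫ s in (0 : ℝ)..T, exp (-(α * a * (T - s))) *
        (α * (a + α * ca * (exp ((α * CD + 1) * s) - 1) * K)) ≤
      α * ca * (exp ((α * CD + 1) * T) - 1) * W := by
  set A := α * ca with hA_def
  set lam := α * CD + 1 with hlam_def
  have hderiv : ∀ s ∈ uIcc 0 T, HasDerivAt
      (fun s => exp (-(α * a * (T - s))) * (A * (exp (lam * s) - 1) * W))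
      (exp (-(α * a * (T - s))) * (α * a * (A * (exp (lam * s) - 1) * W) +
        A * (lam * exp (lam * s)) * W)) s := by
    intro s _
    have h1 := hasDerivAt_exp_neg_mul_sub (α * a) T s
    have h2 : HasDerivAt (fun s => A * (exp (lam * s) - 1) * W) (A * (lam * exp (lam * s)) * W) s := by
      have h3 : HasDerivAt (fun s => exp (lam * s)) (exp (lam * s) * lam) s := by
        have := ((hasDerivAt_id s).const_mul lam).exp
        simpa using this
      exact (((h3.sub_const 1).const_mul A).mul_const W).congr_deriv (by ring)
    exact (h1.mul h2).congr_deriv (by ring)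
  have hcont1 : Continuous fun s => exp (-(α * a * (T - s))) *
      (α * (a + A * (exp (lam * s) - 1) * K)) := by fun_prop
  have hcont2 : Continuous fun s => exp (-(α * a * (T - s))) *
      (α * a * (A * (exp (lam * s) - 1) * W) + A * (lam * exp (lam * s)) * W) := by fun_prop
  have hFTC := intervalIntegral.integral_eq_sub_of_hasDerivAt hderiv (hcont2.intervalIntegrable _ _)
  simp only [sub_self, mul_zero, neg_zero, exp_zero, one_mul, sub_zero] at hFTC
  calc ∫ s in (0 : ℝ)..T, exp (-(α * a * (T - s))) * (α * (a + A * (exp (lam * s) - 1) * K))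
      ≤ ∫ s in (0 : ℝ)..T, exp (-(α * a * (T - s))) *
          (α * a * (A * (exp (lam * s) - 1) * W) + A * (lam * exp (lam * s)) * W) := by
        refine intervalIntegral.integral_mono_on hT (hcont1.intervalIntegrable _ _)
          (hcont2.intervalIntegrable _ _) fun s hs => ?_
        exact mul_le_mul_of_nonneg_left (superSol_pointwise hα hW haW hD hK hca hCD hs.1)
          (exp_pos _).le
    _ = A * (exp (lam * T) - 1) * W := by
        rw [hFTC]
        simp

/-- The constant `c_a = |S^{d-1}| (1 + m₁)` of the linear bound `a_β ≤ c_a (1 + |v|²)`.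
[folklore] -/
def freqConst (d : Type*) [Fintype d] (β : ℝ) : ℝ :=
  KineticTheory.sphereMass (EuclideanSpace ℝ d) * (1 + KineticTheory.maxwellianMoment d β 1)

/-- The constant `C_D = |S^{d-1}| (m₂ + m₃)` of the drift defect `D ≤ C_D (1 + |v|²)`. [folklore] -/
def driftConst (d : Type*) [Fintype d] (β : ℝ) : ℝ :=
  KineticTheory.sphereMass (EuclideanSpace ℝ d) * (KineticTheory.maxwellianMoment d β 2 + KineticTheory.maxwellianMoment d β 3)

/-- `c_a ≥ 0`. [folklore] -/
theorem freqConst_nonneg (hβ : 0 < β) : 0 ≤ freqConst d β :=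
  mul_nonneg KineticTheory.sphereMass_nonneg (by linarith [KineticTheory.maxwellianMoment_nonneg (d := d) hβ 1])

/-- `C_D ≥ 0`. [folklore] -/
theorem driftConst_nonneg (hβ : 0 < β) : 0 ≤ driftConst d β :=
  mul_nonneg KineticTheory.sphereMass_nonneg (add_nonneg (KineticTheory.maxwellianMoment_nonneg hβ 2)
    (KineticTheory.maxwellianMoment_nonneg hβ 3))

/-- The **collision majorant** `F(T, v) = α c_a (e^{(α C_D + 1) T} - 1) (1 + |v|²)`, a
supersolution of the gain Duhamel map: `𝒯 (1 + F) ≤ F`. It bounds the expected number of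
collisions of the tagged particle before time `T` starting from velocity `v`. [folklore] -/
def collisionMajorant (d : Type*) [Fintype d] (β α T : ℝ) (v : EuclideanSpace ℝ d) : ℝ :=
  α * freqConst d β * (exp ((α * driftConst d β + 1) * T) - 1) * (1 + ‖v‖ ^ 2)

/-- `F(T, v) ≥ 0` for `T ≥ 0`. [folklore] -/
theorem collisionMajorant_nonneg (hβ : 0 < β) (hα : 0 ≤ α) {T : ℝ} (hT : 0 ≤ T) (v : 𝔼) :
    0 ≤ collisionMajorant d β α T v := by
  unfold collisionMajorant
  have h1 : 1 ≤ exp ((α * driftConst d β + 1) * T) :=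
    one_le_exp (mul_nonneg (by linarith [mul_nonneg hα (driftConst_nonneg (d := d) hβ)]) hT)
  have := freqConst_nonneg (d := d) hβ
  have : 0 ≤ 1 + ‖v‖ ^ 2 := by positivity
  apply mul_nonneg (mul_nonneg (mul_nonneg hα (freqConst_nonneg hβ)) (by linarith)) this

/-- Continuity of the majorant in `(T, v)`. [folklore] -/
theorem continuous_collisionMajorant (β α : ℝ) :
    Continuous fun p : ℝ × 𝔼 => collisionMajorant d β α p.1 p.2 := by
  unfold collisionMajorant; fun_prop

/-- **The gain operator on `1 + F(s, ·)`**: `K⁺(1 + F(s,·))(v) = a(v) + A (e^{λs} - 1) K⁺W(v)`.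
[folklore] -/
theorem linearBoltzmannGain_one_add_majorant (hβ : 0 < β) (hα : 0 ≤ α) {s : ℝ} (hs : 0 ≤ s)
    (v : 𝔼) :
    linearBoltzmannGain β (fun w => 1 + collisionMajorant d β α s w) v =
      TaggedSphereDiffusion.collisionFrequency β v + α * freqConst d β * (exp ((α * driftConst d β + 1) * s) - 1) *
        linearBoltzmannGain β (fun w => 1 + ‖w‖ ^ 2) v := by
  set Ag := α * freqConst d β * (exp ((α * driftConst d β + 1) * s) - 1) with hAg
  have hAg0 : 0 ≤ Ag := by
    have h1 : 1 ≤ exp ((α * driftConst d β + 1) * s) :=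
      one_le_exp (mul_nonneg (by linarith [mul_nonneg hα (driftConst_nonneg (d := d) hβ)]) hs)
    exact mul_nonneg (mul_nonneg hα (freqConst_nonneg hβ)) (by linarith)
  have hF : (fun w : 𝔼 => 1 + collisionMajorant d β α s w) = fun w => (1 : ℝ) + Ag * (1 + ‖w‖ ^ 2) := by
    funext w; simp only [collisionMajorant, hAg]
  have hmeasW : Measurable fun w : 𝔼 => 1 + ‖w‖ ^ 2 :=
    (continuous_const.add (continuous_norm.pow 2)).measurable
  rw [hF, linearBoltzmannGain_add hβ measurable_const (hmeasW.const_mul Ag) (C := 1) (D := Ag)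
    (fun w => by rw [abs_one, one_mul]; nlinarith [sq_nonneg ‖w‖])
    (fun w => by rw [abs_of_nonneg (mul_nonneg hAg0 (by positivity))]),
    linearBoltzmannGain_const, mul_one, linearBoltzmannGain_const_mul]

omit [LocallyCompactSpace X] [FirstCountableTopology X] in
/-- **`F` is a supersolution of the gain Duhamel map**: for a jointly continuous `ψ` with
`0 ≤ ψ(t, x, v) ≤ 1 + F(t⁺, v)` and bounded, `𝒯 ψ ≤ F(t⁺, ·)`. [folklore] -/
theorem gainDuhamel_le_collisionMajorant (hG : Continuous fun p : X × 𝔼 => G.translate p.1 p.2)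
    (hβ : 0 < β) (hα : 0 ≤ α) {ψ : ℝ → X → 𝔼 → ℝ}
    (hψc : Continuous fun p : ℝ × X × 𝔼 => ψ p.1 p.2.1 p.2.2) (hψ0 : ∀ t x v, 0 ≤ ψ t x v)
    (hψF : ∀ t x v, ψ t x v ≤ 1 + collisionMajorant d β α (max t 0) v) {C : ℝ}
    (hψb : ∀ t x v, |ψ t x v| ≤ C) (t : ℝ) (x : X) (v : 𝔼) :
    gainDuhamel G β α ψ t x v ≤ collisionMajorant d β α (max t 0) v := by
  rw [gainDuhamel_eq]
  have hT := le_max_right t 0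
  set T := max t 0
  -- the data of the supersolution inequality at `v`
  set a := TaggedSphereDiffusion.collisionFrequency β v
  set W : ℝ := 1 + ‖v‖ ^ 2
  set K := linearBoltzmannGain β (fun w => 1 + ‖w‖ ^ 2) v
  set D := KineticTheory.sphereMass 𝔼 * (‖v‖ * KineticTheory.maxwellianMoment d β 2 +
    KineticTheory.maxwellianMoment d β 3)
  have ha0 : 0 ≤ a := TaggedLinearBoltzmannSeries.collisionFrequency_nonneg hβ v
  have hW0 : 0 ≤ W := by positivity
  have haW : a ≤ freqConst d β * W := collisionFrequency_le_normSq hβ v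
  have hD : D ≤ driftConst d β * W := by
    simp only [D, driftConst, W, mul_assoc]
    refine mul_le_mul_of_nonneg_left ?_ KineticTheory.sphereMass_nonneg
    have hm2 := KineticTheory.maxwellianMoment_nonneg (d := d) hβ 2
    have hm3 := KineticTheory.maxwellianMoment_nonneg (d := d) hβ 3
    nlinarith [sq_nonneg (‖v‖ - 1), norm_nonneg v, sq_nonneg ‖v‖, mul_nonneg hm2 (sq_nonneg (‖v‖ - 1)),
      mul_nonneg hm3 (sq_nonneg ‖v‖)]
  have hK : K ≤ a * W + D := linearBoltzmannGain_normSq_le hβ v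
  -- pointwise comparison of the integrands on `[0, T]`
  have hcont1 := continuous_gainDuhamelIntegrand hG hβ α hψc hψb T x v
  have hcont2 : Continuous fun s => exp (-(α * a * (T - s))) *
      (α * (a + α * freqConst d β * (exp ((α * driftConst d β + 1) * s) - 1) * K)) := by fun_prop
  calc ∫ s in (0 : ℝ)..T, gainDuhamelIntegrand G β α ψ T x v s
      ≤ ∫ s in (0 : ℝ)..T, exp (-(α * a * (T - s))) *
          (α * (a + α * freqConst d β * (exp ((α * driftConst d β + 1) * s) - 1) * K)) := by
        refine intervalIntegral.integral_mono_on hT (hcont1.intervalIntegrable _ _)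
          (hcont2.intervalIntegrable _ _) fun s hs => ?_
        simp only [gainDuhamelIntegrand]
        rw [show α * TaggedSphereDiffusion.collisionFrequency β v * (T - s) = α * a * (T - s) by rfl]
        refine mul_le_mul_of_nonneg_left (mul_le_mul_of_nonneg_left ?_ hα) (exp_pos _).le
        rw [← linearBoltzmannGain_one_add_majorant hβ hα hs.1 v]
        have hmeas : Measurable fun w : 𝔼 => 1 + collisionMajorant d β α s w :=
          (continuous_const.add ((continuous_collisionMajorant β α).comp
            (continuous_const.prodMk continuous_id))).measurable
        have hAg0 : 0 ≤ α * freqConst d β * (exp ((α * driftConst d β + 1) * s) - 1) := by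
          have h1 : 1 ≤ exp ((α * driftConst d β + 1) * s) :=
            one_le_exp (mul_nonneg (by linarith [mul_nonneg hα (driftConst_nonneg (d := d) hβ)]) hs.1)
          exact mul_nonneg (mul_nonneg hα (freqConst_nonneg hβ)) (by linarith)
        refine linearBoltzmannGain_mono hβ (fun w => hψ0 _ _ _) (fun w => ?_) hmeas
          (C := 1 + α * freqConst d β * (exp ((α * driftConst d β + 1) * s) - 1)) (fun w => ?_) v
        · have := hψF s (G.translate x ((s - T) • v)) w
          rwa [max_eq_left hs.1] at this
        · rw [abs_of_nonneg (add_nonneg zero_le_one (collisionMajorant_nonneg hβ hα hs.1 w))]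
          simp only [collisionMajorant]
          nlinarith [sq_nonneg ‖w‖, hAg0]
    _ ≤ α * freqConst d β * (exp ((α * driftConst d β + 1) * T) - 1) * W :=
        superSol_integral hα hW0 haW hD hK (freqConst_nonneg hβ) (driftConst_nonneg hβ) hT
    _ = collisionMajorant d β α T v := rfl

/-! ### The collision tails `pₙ = 1 - Sₙ[1]` -/

omit [LocallyCompactSpace X] [FirstCountableTopology X] in
/-- Constant data are admissible. [folklore] -/
theorem linearBoltzmannData_const (hG : Continuous fun p : X × 𝔼 => G.translate p.1 p.2) (hβ : 0 < β)
    (hα : 0 ≤ α) {c : ℝ} (hc : 0 ≤ c) : LinearBoltzmannData G β α (fun _ _ => c) c :=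
  ⟨hG, hβ, hα, continuous_const, fun _ _ => hc, fun _ _ => le_rfl⟩

/-- The *collision tail* `pₙ(t, x, v) = 1 - Sₙ[1](t, x, v)`: one minus the `n`-th partial sum of
the collision series with constant datum `1` ("probability of at least `n` collisions before
time `t`"). [folklore] -/
def collisionTail (G : Literature.Analysis.FluidPDE.Geometry d X) (β α : ℝ) (n : ℕ) (t : ℝ) (x : X) (v : 𝔼) : ℝ :=
  1 - linearBoltzmannPartialSum G β α (fun _ _ => 1) n t x v

omit [TopologicalSpace X] [LocallyCompactSpace X] [FirstCountableTopology X] in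
/-- `p₀ = 1`. [folklore] -/
@[simp]
theorem collisionTail_zero (G : Literature.Analysis.FluidPDE.Geometry d X) (β α : ℝ) (t : ℝ) (x : X) (v : 𝔼) :
    collisionTail G β α 0 t x v = 1 := by
  simp [collisionTail]

section Tail

variable (hG : Continuous fun p : X × EuclideanSpace ℝ d => G.translate p.1 p.2) (hβ : 0 < β)
  (hα : 0 ≤ α)
include hG hβ hα

/-- `pₙ ≥ 0` (`Sₙ[1] ≤ 1`, the maximum principle for the partial sums). [folklore] -/
theorem collisionTail_nonneg (n : ℕ) (t : ℝ) (x : X) (v : 𝔼) : 0 ≤ collisionTail G β α n t x v :=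
  sub_nonneg.2 ((linearBoltzmannData_const hG hβ hα zero_le_one).linearBoltzmannPartialSum_le n t x v)

/-- `pₙ ≤ 1`. [folklore] -/
theorem collisionTail_le_one (n : ℕ) (t : ℝ) (x : X) (v : 𝔼) : collisionTail G β α n t x v ≤ 1 :=
  sub_le_self _ ((linearBoltzmannData_const hG hβ hα zero_le_one).linearBoltzmannPartialSum_nonneg n t x v)

/-- `|pₙ| ≤ 1`. [folklore] -/
theorem abs_collisionTail_le (n : ℕ) (t : ℝ) (x : X) (v : 𝔼) : |collisionTail G β α n t x v| ≤ 1 :=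
  abs_le.2 ⟨by linarith [collisionTail_nonneg hG hβ hα n t x v], collisionTail_le_one hG hβ hα n t x v⟩

/-- The tails decrease in `n`. [folklore] -/
theorem collisionTail_succ_le (n : ℕ) (t : ℝ) (x : X) (v : 𝔼) :
    collisionTail G β α (n + 1) t x v ≤ collisionTail G β α n t x v := by
  simp only [collisionTail, linearBoltzmannPartialSum_succ]
  linarith [(linearBoltzmannData_const hG hβ hα zero_le_one).linearBoltzmannTerm_nonneg n t x v]

/-- `n ↦ pₙ` is decreasing. [folklore] -/
theorem collisionTail_antitone (t : ℝ) (x : X) (v : 𝔼) :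
    Antitone fun n => collisionTail G β α n t x v :=
  antitone_nat_of_succ_le fun n => collisionTail_succ_le hG hβ hα n t x v

/-- Joint continuity of the tails. [folklore] -/
theorem continuous_collisionTail (n : ℕ) :
    Continuous fun p : ℝ × X × 𝔼 => collisionTail G β α n p.1 p.2.1 p.2.2 :=
  continuous_const.sub ((linearBoltzmannData_const hG hβ hα zero_le_one).continuous_linearBoltzmannPartialSum n)

/-- **First-step recursion of the tails**: `p_{n+1} = 𝒯 pₙ` (from `Sₙ₊₁ = u₀ + 𝒯 Sₙ`,
`u₀[1] = e^{-α a t}` and `𝒯 1 = 1 - e^{-α a t}`). [folklore] -/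
theorem collisionTail_succ (n : ℕ) (t : ℝ) (x : X) (v : 𝔼) :
    collisionTail G β α (n + 1) t x v = gainDuhamel G β α (collisionTail G β α n) t x v := by
  have h1 := linearBoltzmannData_const hG hβ hα zero_le_one
  have hfun : collisionTail G β α n = fun t x v =>
      (1 : ℝ) + (-1) * linearBoltzmannPartialSum G β α (fun _ _ => 1) n t x v := by
    funext t x v; simp only [collisionTail]; ring
  rw [hfun, gainDuhamel_add hG hβ continuous_const (C₁ := 1) (fun _ _ _ => by simp)
      (continuous_const.mul (h1.continuous_linearBoltzmannPartialSum n)) (C₂ := 1)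
      (fun t x v => by
        rw [abs_mul, abs_neg, abs_one, one_mul]; exact h1.abs_linearBoltzmannPartialSum_le' n t x v),
    gainDuhamel_const, gainDuhamel_const_mul, collisionTail, h1.linearBoltzmannPartialSum_succ_eq,
    linearBoltzmannTerm_zero]
  ring

/-- **The supersolution bound on the tails**: `∑_{k=1}^{n} p_k(t, x, v) ≤ F(t⁺, v)`. [folklore] -/
theorem sum_collisionTail_le (n : ℕ) (t : ℝ) (x : X) (v : 𝔼) :
    ∑ k ∈ Finset.range n, collisionTail G β α (k + 1) t x v ≤ collisionMajorant d β α (max t 0) v := by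
  induction n generalizing t x v with
  | zero => simpa using collisionMajorant_nonneg hβ hα (le_max_right t 0) v
  | succ n ih =>
    have hstep : ∑ k ∈ Finset.range (n + 1), collisionTail G β α (k + 1) t x v =
        gainDuhamel G β α (fun t x v => ∑ k ∈ Finset.range (n + 1), collisionTail G β α k t x v)
          t x v := by
      rw [gainDuhamel_finset_sum hG hβ (Finset.range (n + 1))
        (fun k => continuous_collisionTail hG hβ hα k)
        (fun k => ⟨1, fun t x v => abs_collisionTail_le hG hβ hα k t x v⟩)]
      exact Finset.sum_congr rfl fun k _ => collisionTail_succ hG hβ hα k t x v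
    rw [hstep]
    refine gainDuhamel_le_collisionMajorant hG hβ hα
      (continuous_finsetSum _ fun k _ => continuous_collisionTail hG hβ hα k)
      (fun t x v => Finset.sum_nonneg fun k _ => collisionTail_nonneg hG hβ hα k t x v)
      (fun t x v => ?_) (C := ((n + 1 : ℕ) : ℝ)) (fun t x v => ?_) t x v
    · rw [Finset.sum_range_succ', collisionTail_zero, add_comm]
      exact add_le_add_right (ih t x v) 1
    · refine (Finset.abs_sum_le_sum_abs _ _).trans ?_
      calc ∑ k ∈ Finset.range (n + 1), |collisionTail G β α k t x v|
          ≤ ∑ _k ∈ Finset.range (n + 1), (1 : ℝ) :=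
            Finset.sum_le_sum fun k _ => abs_collisionTail_le hG hβ hα k t x v
        _ = ((n + 1 : ℕ) : ℝ) := by simp

/-- `pₙ ≤ F(t⁺, v) / n`. [folklore] -/
theorem collisionTail_le_div {n : ℕ} (hn : 0 < n) (t : ℝ) (x : X) (v : 𝔼) :
    collisionTail G β α n t x v ≤ collisionMajorant d β α (max t 0) v / n := by
  rw [le_div_iff₀ (by exact_mod_cast hn)]
  calc collisionTail G β α n t x v * n = ∑ _k ∈ Finset.range n, collisionTail G β α n t x v := by
        rw [Finset.sum_const, Finset.card_range, nsmul_eq_mul, mul_comm]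
    _ ≤ ∑ k ∈ Finset.range n, collisionTail G β α (k + 1) t x v :=
        Finset.sum_le_sum fun k hk =>
          collisionTail_antitone hG hβ hα t x v (Nat.succ_le_of_lt (Finset.mem_range.1 hk))
    _ ≤ collisionMajorant d β α (max t 0) v := sum_collisionTail_le hG hβ hα n t x v

/-- **No accumulation of collisions**: `pₙ(t, x, v) → 0` for every `(t, x, v)`. [folklore] -/
theorem tendsto_collisionTail (t : ℝ) (x : X) (v : 𝔼) :
    Tendsto (fun n => collisionTail G β α n t x v) atTop (𝓝 0) := by
  refine squeeze_zero' (Eventually.of_forall fun n => collisionTail_nonneg hG hβ hα n t x v)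
    ?_ (tendsto_const_div_atTop_nhds_zero_nat (collisionMajorant d β α (max t 0) v))
  filter_upwards [eventually_gt_atTop 0] with n hn
  exact collisionTail_le_div hG hβ hα hn t x v

/-- **Conservativity**: the collision series with constant datum `1` sums to `1`. [folklore] -/
theorem linearBoltzmannSeries_one (t : ℝ) (x : X) (v : 𝔼) :
    linearBoltzmannSeries G β α (fun _ _ => 1) t x v = 1 := by
  have h1 := (linearBoltzmannData_const hG hβ hα zero_le_one).tendsto_linearBoltzmannPartialSum t x v
  have h2 : Tendsto (fun n => linearBoltzmannPartialSum G β α (fun _ _ => (1 : ℝ)) n t x v) atTop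
      (𝓝 1) := by
    have := (tendsto_collisionTail hG hβ hα t x v).const_sub 1
    simp only [collisionTail, sub_sub_cancel, sub_zero] at this
    exact this
  exact tendsto_nhds_unique h1 h2

/-- The collision series with constant datum `c` is `c`. [folklore] -/
theorem linearBoltzmannSeries_const (c t : ℝ) (x : X) (v : 𝔼) :
    linearBoltzmannSeries G β α (fun _ _ => c) t x v = c := by
  have := linearBoltzmannSeries_const_mul G β α c (fun _ _ => (1 : ℝ)) t x v
  simp only [mul_one] at this
  rw [this, linearBoltzmannSeries_one hG hβ hα, mul_one]

end Tail

/-! ### Continuity of the series solution -/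

namespace LinearBoltzmannData

variable {f₀ : X → EuclideanSpace ℝ d → ℝ} {R : ℝ} (h : LinearBoltzmannData G β α f₀ R)
include h

/-- The series (a supremum of continuous partial sums) is lower semicontinuous. [folklore] -/
theorem lowerSemicontinuous_linearBoltzmannSeries :
    LowerSemicontinuous fun p : ℝ × X × 𝔼 => linearBoltzmannSeries G β α f₀ p.1 p.2.1 p.2.2 := by
  intro p y hy
  obtain ⟨n, hn⟩ := ((h.tendsto_linearBoltzmannPartialSum p.1 p.2.1 p.2.2).eventually
    (eventually_gt_nhds hy)).exists
  have hc := (h.continuous_linearBoltzmannPartialSum n).continuousAt (x := p)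
  filter_upwards [hc.eventually (eventually_gt_nhds hn)] with q hq
  exact hq.trans_le (h.linearBoltzmannPartialSum_le_series n _ _ _)

omit [LocallyCompactSpace X] [FirstCountableTopology X] in
/-- The complementary datum `R - f₀` is admissible with the same bound. [folklore] -/
theorem compl : LinearBoltzmannData G β α (fun x v => R + (-1) * f₀ x v) R :=
  ⟨h.continuous_translate, h.beta_pos, h.alpha_nonneg,
    continuous_const.add (continuous_const.mul h.continuous_data),
    fun x v => by linarith [h.data_le x v], fun x v => by linarith [h.data_nonneg x v]⟩

/-- `φ[f₀] + φ[R - f₀] = φ[R] = R` (linearity and conservativity). [folklore] -/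
theorem linearBoltzmannSeries_add_compl (t : ℝ) (x : X) (v : 𝔼) :
    linearBoltzmannSeries G β α f₀ t x v +
      linearBoltzmannSeries G β α (fun x v => R + (-1) * f₀ x v) t x v = R := by
  have e1 : (fun x v => f₀ x v + (R + (-1) * f₀ x v)) = fun (_ : X) (_ : 𝔼) => R := by
    funext x v; ring
  rw [← linearBoltzmannSeries_add h h.compl, e1,
    linearBoltzmannSeries_const h.continuous_translate h.beta_pos h.alpha_nonneg]

/-- **The series solution is jointly continuous** in `(t, x, v)`: it is lower semicontinuous,
and so is `R - φ[f₀] = φ[R - f₀]`. [folklore] -/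
theorem continuous_linearBoltzmannSeries :
    Continuous fun p : ℝ × X × 𝔼 => linearBoltzmannSeries G β α f₀ p.1 p.2.1 p.2.2 := by
  have hl1 := h.lowerSemicontinuous_linearBoltzmannSeries
  have hl2 := h.compl.lowerSemicontinuous_linearBoltzmannSeries
  refine continuous_iff_continuousAt.2 fun p => ?_
  rw [ContinuousAt, tendsto_order]
  refine ⟨fun y hy => hl1 p y hy, fun y hy => ?_⟩
  have hp := h.linearBoltzmannSeries_add_compl p.1 p.2.1 p.2.2
  have : R - y < linearBoltzmannSeries G β α (fun x v => R + (-1) * f₀ x v) p.1 p.2.1 p.2.2 := by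
    linarith
  filter_upwards [hl2 p _ this] with q hq
  linarith [h.linearBoltzmannSeries_add_compl q.1 q.2.1 q.2.2]

end LinearBoltzmannData

end Conservativity

/-! ## The series is a mild solution of the linear Boltzmann equation -/

section Mild

variable {X : Type*} [TopologicalSpace X] [LocallyCompactSpace X] [FirstCountableTopology X]
  {G : Literature.Analysis.FluidPDE.Geometry d X} {β α : ℝ}

omit [Fintype d] in
/-- **From the integrating-factor form to Duhamel's form.** If `H` is continuous and
`ψ(t) = e^{-κt} ψ₀ + ∫₀ᵗ e^{-κ(t-s)} H(s) ds` for `t ≥ 0`, then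
`ψ(t) = ψ₀ + ∫₀ᵗ (H(s) - κ ψ(s)) ds` for `t ≥ 0` (variation of constants). [folklore] -/
theorem eq_add_integral_of_expForm {κ ψ₀ : ℝ} {ψ H : ℝ → ℝ} (hH : Continuous H)
    (hψ : ∀ t, 0 ≤ t → ψ t = exp (-(κ * t)) * ψ₀ + ∫ s in (0 : ℝ)..t, exp (-(κ * (t - s))) * H s)
    {t : ℝ} (ht : 0 ≤ t) : ψ t = ψ₀ + ∫ s in (0 : ℝ)..t, (H s - κ * ψ s) := by
  set Ψ : ℝ → ℝ := fun t => exp (-(κ * t)) * ψ₀ +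
    exp (-(κ * t)) * ∫ s in (0 : ℝ)..t, exp (κ * s) * H s with hΨ_def
  have hΨψ : ∀ t, 0 ≤ t → Ψ t = ψ t := fun t ht => by
    rw [hψ t ht]
    simp only [hΨ_def]
    congr 1
    rw [← intervalIntegral.integral_const_mul]
    refine intervalIntegral.integral_congr fun s _ => ?_
    rw [← mul_assoc, ← Real.exp_add, show -(κ * t) + κ * s = -(κ * (t - s)) by ring]
  have hI : Continuous fun s => exp (κ * s) * H s := by fun_prop
  have hderiv : ∀ t, HasDerivAt Ψ (-κ * Ψ t + H t) t := fun t => by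
    have h1 : HasDerivAt (fun t => exp (-(κ * t))) (exp (-(κ * t)) * -κ) t := by
      have := ((hasDerivAt_id t).const_mul κ).neg.exp
      simpa using this
    have h2 : HasDerivAt (fun t => ∫ s in (0 : ℝ)..t, exp (κ * s) * H s) (exp (κ * t) * H t) t :=
      (hI.integral_hasStrictDerivAt 0 t).hasDerivAt
    have h3 := (h1.mul_const ψ₀).add (h1.mul h2)
    have e : exp (-(κ * t)) * exp (κ * t) = 1 := by rw [← Real.exp_add]; simp
    refine h3.congr_deriv ?_
    simp only [hΨ_def]
    linear_combination (H t) * e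
  have hΨc : Continuous Ψ := continuous_iff_continuousAt.2 fun t => (hderiv t).continuousAt
  have hFTC := intervalIntegral.integral_eq_sub_of_hasDerivAt (a := 0) (b := t)
    (fun s _ => hderiv s) (((continuous_const.mul hΨc).add hH).intervalIntegrable _ _)
  have hΨ0 : Ψ 0 = ψ₀ := by simp [hΨ_def]
  rw [← hΨψ t ht, show Ψ t = ψ₀ + ∫ s in (0 : ℝ)..t, (-κ * Ψ s + H s) by rw [hFTC, hΨ0]; ring]
  congr 1
  refine intervalIntegral.integral_congr fun s hs => ?_
  rw [uIcc_of_le ht] at hs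
  rw [hΨψ s hs.1]
  ring

/-- **Detailed balance for the Maxwellian**: `M_β(v') M_β(v₁') = M_β(v) M_β(v₁)` (conservation
of kinetic energy). [folklore] -/
theorem maxwellianBeta_collide_mul (β : ℝ) (ω : 𝕊) (v w : 𝔼) :
    Literature.Analysis.FunctionSpaces.maxwellianBeta β (collide ω (v, w)).1 * Literature.Analysis.FunctionSpaces.maxwellianBeta β (collide ω (v, w)).2 =
      Literature.Analysis.FunctionSpaces.maxwellianBeta β v * Literature.Analysis.FunctionSpaces.maxwellianBeta β w := by
  simp only [KineticTheory.maxwellianBeta_eq]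
  have h := Literature.Analysis.FluidPDE.exp_collide_mul_exp_collide β ω (v, w)
  simp only at h
  linear_combination ((2 * Real.pi * β⁻¹) ^ (-(Module.finrank ℝ (EuclideanSpace ℝ d) : ℝ) / 2)) ^ 2 * h

/-- **The linear Boltzmann collision term in gain/loss form.** For a bounded measurable `φ`,
`Q_{αB}(M_β φ, M_β)(v) = α M_β(v) ((K⁺_β φ)(v) - a_β(v) φ(v))`, i.e. `M_β · (-α L φ)`: BGSR's
remark that (1.3) for `φ` is the linear Boltzmann equation for `g = M_β φ` since
`M_β(v') M_β(v₁') = M_β(v) M_β(v₁)`. [cite: BodineauGallagherSaintRaymondInvent2016, (1.3)] -/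
theorem collisionOpWith_maxwellian_mul (hβ : 0 < β) (α : ℝ) {φ : 𝔼 → ℝ} (hφ : Measurable φ)
    {C : ℝ} (hC : ∀ w, |φ w| ≤ C) (v : 𝔼) :
    Literature.Analysis.FluidPDE.collisionOpWith (α • hardSphereKernel) (fun w => Literature.Analysis.FunctionSpaces.maxwellianBeta β w * φ w)
        (Literature.Analysis.FunctionSpaces.maxwellianBeta β) v =
      α * Literature.Analysis.FunctionSpaces.maxwellianBeta β v *
        (linearBoltzmannGain β φ v - TaggedSphereDiffusion.collisionFrequency β v * φ v) := by
  unfold Literature.Analysis.FluidPDE.collisionOpWith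
  have hpt : ∀ w (ω : 𝕊), (α • hardSphereKernel) (v, w) ω *
      (Literature.Analysis.FunctionSpaces.maxwellianBeta β (collide ω (v, w)).1 * φ (collide ω (v, w)).1 *
          Literature.Analysis.FunctionSpaces.maxwellianBeta β (collide ω (v, w)).2 -
        Literature.Analysis.FunctionSpaces.maxwellianBeta β v * φ v * Literature.Analysis.FunctionSpaces.maxwellianBeta β w) =
      α * Literature.Analysis.FunctionSpaces.maxwellianBeta β v * (gainIntegrand β φ v w ω -
        hardSphereKernel (v, w) ω * Literature.Analysis.FunctionSpaces.maxwellianBeta β w * φ v) := fun w ω => by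
    have h := maxwellianBeta_collide_mul β ω v w
    simp only [Pi.smul_apply, smul_eq_mul, gainIntegrand]
    linear_combination (α * hardSphereKernel (v, w) ω * φ (collide ω (v, w)).1) * h
  simp_rw [hpt]
  have hloss_in : ∀ w, Integrable (fun ω : 𝕊 => hardSphereKernel (v, w) ω *
      Literature.Analysis.FunctionSpaces.maxwellianBeta β w * φ v) sphereMeasure := fun w =>
    (((continuous_hardSphereKernel.comp (by fun_prop : Continuous fun ω : 𝕊 => ((v, w), ω))
      ).integrable_of_hasCompactSupport (HasCompactSupport.of_compactSpace _)).mul_const _).mul_const _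
  have hinner : ∀ w, ∫ ω, α * Literature.Analysis.FunctionSpaces.maxwellianBeta β v * (gainIntegrand β φ v w ω -
      hardSphereKernel (v, w) ω * Literature.Analysis.FunctionSpaces.maxwellianBeta β w * φ v) ∂sphereMeasure =
      α * Literature.Analysis.FunctionSpaces.maxwellianBeta β v * ((∫ ω, gainIntegrand β φ v w ω ∂sphereMeasure) -
        KineticTheory.lorentzLossRate (v - w) * Literature.Analysis.FunctionSpaces.maxwellianBeta β w * φ v) := fun w => by
    rw [integral_const_mul, integral_sub (integrable_gainIntegrand_sphere hβ hφ hC v w) (hloss_in w),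
      integral_mul_const, integral_mul_const, integral_hardSphereKernel]
  simp_rw [hinner]
  rw [integral_const_mul, integral_sub (integrable_integral_gainIntegrand hβ hφ hC v)
    (((integrable_lorentzLossRate_mul_maxwellianBeta hβ v).mul_const _)), integral_mul_const,
    ← collisionFrequency_eq, ← linearBoltzmannGain_eq]

omit [TopologicalSpace X] [LocallyCompactSpace X] [FirstCountableTopology X] in
/-- **Initial value of the series**: `φ_α(0, x, v) = f₀(x, v)`. [folklore] -/
theorem linearBoltzmannSeries_zero (G : Literature.Analysis.FluidPDE.Geometry d X) (β α : ℝ) (f₀ : X → 𝔼 → ℝ)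
    (x : X) (v : 𝔼) : linearBoltzmannSeries G β α f₀ 0 x v = f₀ x v := by
  rw [linearBoltzmannSeries, tsum_eq_single 0]
  · simp
  · intro n hn
    obtain ⟨k, rfl⟩ := Nat.exists_eq_succ_of_ne_zero hn
    rw [linearBoltzmannTerm_succ, gainDuhamel]
    simp

omit [TopologicalSpace X] [LocallyCompactSpace X] [FirstCountableTopology X] in
/-- Composition of two free flights with the same velocity. [folklore] -/
theorem translate_translate_smul (G : Literature.Analysis.FluidPDE.Geometry d X) (x : X) (a b : ℝ) (v : 𝔼) :
    G.translate (G.translate x (a • v)) (b • v) = G.translate x ((a + b) • v) := by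
  rw [G.translate_add, add_smul]

namespace LinearBoltzmannData

variable {f₀ : X → EuclideanSpace ℝ d → ℝ} {R : ℝ} (h : LinearBoltzmannData G β α f₀ R)
include h

/-- **The gain/loss mild equation along forward characteristics**: for `t ≥ 0`,
`φ(t, x + tv, v) = e^{-α a(v) t} f₀(x, v) + ∫₀ᵗ e^{-α a(v)(t-s)} α K⁺φ(s, x + sv, ·)(v) ds`.
[cite: BodineauGallagherSaintRaymondInvent2016, (1.3)] -/
theorem linearBoltzmannSeries_alongFlow {t : ℝ} (ht : 0 ≤ t) (x : X) (v : 𝔼) :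
    linearBoltzmannSeries G β α f₀ t (G.translate x (t • v)) v =
      exp (-(α * TaggedSphereDiffusion.collisionFrequency β v * t)) * f₀ x v +
        ∫ s in (0 : ℝ)..t, exp (-(α * TaggedSphereDiffusion.collisionFrequency β v * (t - s))) *
          (α * linearBoltzmannGain β
            (fun w => linearBoltzmannSeries G β α f₀ s (G.translate x (s • v)) w) v) := by
  rw [h.linearBoltzmannSeries_eq, linearBoltzmannTerm_zero, gainDuhamel]
  simp only [max_eq_left ht]
  have e0 : G.translate (G.translate x (t • v)) (-t • v) = x := by
    rw [translate_translate_smul, add_neg_cancel, zero_smul, G.translate_zero]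
  have e1 : ∀ s, G.translate (G.translate x (t • v)) ((s - t) • v) = G.translate x (s • v) :=
    fun s => by rw [translate_translate_smul]; congr 2; ring
  rw [e0]
  simp_rw [e1]

/-- Continuity in `τ` of the gain term along a forward characteristic. [folklore] -/
theorem continuous_gain_alongFlow (x : X) (v : 𝔼) :
    Continuous fun τ : ℝ => linearBoltzmannGain β
      (fun w => linearBoltzmannSeries G β α f₀ τ (G.translate x (τ • v)) w) v :=
  continuous_linearBoltzmannGain_comp (Y := ℝ) h.beta_pos h.continuous_linearBoltzmannSeries
    h.abs_linearBoltzmannSeries_le continuous_id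
    (h.continuous_translate.comp (continuous_const.prodMk (continuous_id.smul continuous_const)))
    continuous_const

/-- **Duhamel form of (1.3) along forward characteristics** for the series solution: for `t ≥ 0`,
`φ(t, x + tv, v) = f₀(x, v) + ∫₀ᵗ α [K⁺φ(τ, x + τv, ·)(v) - a(v) φ(τ, x + τv, v)] dτ`
(variation of constants from the integrating-factor form).
[cite: BodineauGallagherSaintRaymondInvent2016, (1.3)] -/
theorem linearBoltzmannSeries_duhamel {t : ℝ} (ht : 0 ≤ t) (x : X) (v : 𝔼) :
    linearBoltzmannSeries G β α f₀ t (G.translate x (t • v)) v = f₀ x v +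
      ∫ τ in (0 : ℝ)..t, (α * linearBoltzmannGain β
          (fun w => linearBoltzmannSeries G β α f₀ τ (G.translate x (τ • v)) w) v -
        α * TaggedSphereDiffusion.collisionFrequency β v * linearBoltzmannSeries G β α f₀ τ (G.translate x (τ • v)) v) := by
  set ψ : ℝ → ℝ := fun τ => linearBoltzmannSeries G β α f₀ τ (G.translate x (τ • v)) v with hψ_def
  set H : ℝ → ℝ := fun τ => α * linearBoltzmannGain β
    (fun w => linearBoltzmannSeries G β α f₀ τ (G.translate x (τ • v)) w) v with hH_def
  have hHc : Continuous H := continuous_const.mul (h.continuous_gain_alongFlow x v)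
  have hform : ∀ τ, 0 ≤ τ → ψ τ = exp (-(α * TaggedSphereDiffusion.collisionFrequency β v * τ)) * f₀ x v +
      ∫ s in (0 : ℝ)..τ, exp (-(α * TaggedSphereDiffusion.collisionFrequency β v * (τ - s))) * H s :=
    fun τ hτ => h.linearBoltzmannSeries_alongFlow hτ x v
  have key := eq_add_integral_of_expForm hHc hform ht
  simpa only [hψ_def, hH_def] using key

/-- **The series solves the linear Boltzmann equation in mild (Duhamel) form**: for every
`T`, `g = M_β φ_α` is a mild solution on `[0, T]` of `∂ₜ g + v·∇ₓ g = Q_{αB}(g, M_β)` on the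
geometry `G` (the accepted `Kinetic.IsMildLinearBoltzmannSolutionOn` with kernel
`α • hardSphereKernel`). [cite: BodineauGallagherSaintRaymondInvent2016, (1.3)] -/
theorem isMildLinearBoltzmannSolutionOn (T : ℝ) :
    Literature.Analysis.FunctionSpaces.IsMildLinearBoltzmannSolutionOn T G (α • hardSphereKernel) (Literature.Analysis.FunctionSpaces.maxwellianBeta β)
      fun t x v => Literature.Analysis.FunctionSpaces.maxwellianBeta β v * linearBoltzmannSeries G β α f₀ t x v := by
  have hβ := h.beta_pos
  -- the collision term along the flow, in gain/loss form
  have hQ : ∀ (x : X) (v : 𝔼) (τ : ℝ),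
      Literature.Analysis.FluidPDE.alongFlow G (Literature.Analysis.FunctionSpaces.linearCollisionTerm (α • hardSphereKernel)
        (Literature.Analysis.FunctionSpaces.maxwellianBeta β)
        fun t x v => Literature.Analysis.FunctionSpaces.maxwellianBeta β v * linearBoltzmannSeries G β α f₀ t x v) τ x v =
      α * Literature.Analysis.FunctionSpaces.maxwellianBeta β v *
        (linearBoltzmannGain β (fun w => linearBoltzmannSeries G β α f₀ τ (G.translate x (τ • v)) w) v -
          TaggedSphereDiffusion.collisionFrequency β v * linearBoltzmannSeries G β α f₀ τ (G.translate x (τ • v)) v) :=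
    fun x v τ => by
      simp only [Literature.Analysis.FluidPDE.alongFlow, Literature.Analysis.FunctionSpaces.linearCollisionTerm_apply]
      exact collisionOpWith_maxwellian_mul hβ α (h.measurable_linearBoltzmannSeries τ _)
        (fun w => h.abs_linearBoltzmannSeries_le τ _ w) v
  have hQc : ∀ (x : X) (v : 𝔼), Continuous fun τ => Literature.Analysis.FluidPDE.alongFlow G
      (Literature.Analysis.FunctionSpaces.linearCollisionTerm (α • hardSphereKernel) (Literature.Analysis.FunctionSpaces.maxwellianBeta β)
        fun t x v => Literature.Analysis.FunctionSpaces.maxwellianBeta β v * linearBoltzmannSeries G β α f₀ t x v) τ x v :=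
    fun x v => by
      simp_rw [hQ x v]
      refine continuous_const.mul ((h.continuous_gain_alongFlow x v).sub (continuous_const.mul ?_))
      exact h.continuous_linearBoltzmannSeries.comp (continuous_id.prodMk
        ((h.continuous_translate.comp (continuous_const.prodMk (continuous_id.smul continuous_const))).prodMk
          continuous_const))
  refine ⟨fun t _ x v => mul_nonneg (Literature.Analysis.FunctionSpaces.maxwellianBeta_pos hβ v).le
    (h.linearBoltzmannSeries_mem t x v).1, fun x v t _ => (hQc x v).intervalIntegrable _ _,
    fun x v t ht => ?_⟩
  -- Duhamel's formula
  set ψ : ℝ → ℝ := fun τ => linearBoltzmannSeries G β α f₀ τ (G.translate x (τ • v)) v with hψ_def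
  set H : ℝ → ℝ := fun τ => α * linearBoltzmannGain β
    (fun w => linearBoltzmannSeries G β α f₀ τ (G.translate x (τ • v)) w) v with hH_def
  have hHc : Continuous H := continuous_const.mul (h.continuous_gain_alongFlow x v)
  have hform : ∀ τ, 0 ≤ τ → ψ τ = exp (-(α * TaggedSphereDiffusion.collisionFrequency β v * τ)) * f₀ x v +
      ∫ s in (0 : ℝ)..τ, exp (-(α * TaggedSphereDiffusion.collisionFrequency β v * (τ - s))) * H s :=
    fun τ hτ => h.linearBoltzmannSeries_alongFlow hτ x v
  have key := eq_add_integral_of_expForm hHc hform ht.1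
  simp only [Literature.Analysis.FluidPDE.alongFlow]
  rw [linearBoltzmannSeries_zero]
  change Literature.Analysis.FunctionSpaces.maxwellianBeta β v * ψ t = _
  rw [key, mul_add, ← intervalIntegral.integral_const_mul]
  congr 1
  refine intervalIntegral.integral_congr fun τ _ => ?_
  have hQ' := hQ x v τ
  simp only [Literature.Analysis.FluidPDE.alongFlow] at hQ'
  rw [hQ']
  simp only [hH_def, hψ_def]
  ring

end LinearBoltzmannData

end Mild

/-! ## Well-posedness of BGSR (1.3) on the torus in the class `IsTaggedLinearBoltzmannSolution` -/

section Torus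

local notation "𝕋" => UnitAddTorus d

/-- The torus datum `ρ⁰(x)` (independent of `v`) is admissible. [folklore] -/
theorem linearBoltzmannData_torus {β α : ℝ} (hβ : 0 < β) (hα : 0 ≤ α) {ρ₀ : 𝕋 → ℝ} (hρ₀ : Continuous ρ₀)
    (hρ₀0 : ∀ x, 0 ≤ ρ₀ x) {R : ℝ} (hR : ∀ x, ρ₀ x ≤ R) :
    LinearBoltzmannData (Literature.Analysis.FluidPDE.Torus.geometry d) β α (fun x _ => ρ₀ x) R where
  continuous_translate := by
    change Continuous fun p : 𝕋 × 𝔼 => p.1 + Literature.Analysis.FunctionSpaces.Torus.proj p.2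
    exact continuous_fst.add (Literature.Analysis.FunctionSpaces.Torus.continuous_proj.comp continuous_snd)
  beta_pos := hβ
  alpha_nonneg := hα
  continuous_data := hρ₀.comp continuous_fst
  data_nonneg x _ := hρ₀0 x
  data_le x _ := hR x

/-- **Well-posedness of BGSR's linear Boltzmann equation (1.3), with the maximum principle of
Remark 3.5.** For `β > 0`, `α ≥ 0` and a continuous datum `0 ≤ ρ⁰ ≤ R` on `T^d`, the collision
series `φ_α = linearBoltzmannSeries (Torus.geometry d) β α ρ⁰` is a solution of (1.3) in the class
`IsTaggedLinearBoltzmannSolution β α ρ⁰` of `TaggedSphereDiffusion` (datum `ρ⁰`, jointly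
continuous and bounded on every slab, `M_β φ_α` a mild solution of
`∂ₜ g + v·∇ₓ g = α Q(g, M_β)`), and `0 ≤ φ_α ≤ R` (Remark 3.5:
`sup_{t ≥ 0} φ_α(t) ≤ ‖ρ⁰‖_{L^∞}`, here for this solution).
[cite: BodineauGallagherSaintRaymondInvent2016, (1.3) and Remark 3.5] -/
theorem isTaggedLinearBoltzmannSolution_linearBoltzmannSeries {β α : ℝ} (hβ : 0 < β) (hα : 0 ≤ α)
    {ρ₀ : 𝕋 → ℝ} (hρ₀ : Continuous ρ₀) (hρ₀0 : ∀ x, 0 ≤ ρ₀ x) {R : ℝ} (hR : ∀ x, ρ₀ x ≤ R) :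
    IsTaggedLinearBoltzmannSolution β α ρ₀
        (linearBoltzmannSeries (Literature.Analysis.FluidPDE.Torus.geometry d) β α fun x _ => ρ₀ x) ∧
      ∀ t x v, 0 ≤ linearBoltzmannSeries (Literature.Analysis.FluidPDE.Torus.geometry d) β α (fun x _ => ρ₀ x) t x v ∧
        linearBoltzmannSeries (Literature.Analysis.FluidPDE.Torus.geometry d) β α (fun x _ => ρ₀ x) t x v ≤ R := by
  have h := linearBoltzmannData_torus hβ hα hρ₀ hρ₀0 hR
  refine ⟨⟨?_, fun T _ => h.continuous_linearBoltzmannSeries.continuousOn, fun T _ =>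
    ⟨R, fun t _ x v => h.abs_linearBoltzmannSeries_le t x v⟩,
    fun T _ => h.isMildLinearBoltzmannSolutionOn T⟩, h.linearBoltzmannSeries_mem⟩
  funext x v
  exact linearBoltzmannSeries_zero _ _ _ _ x v

/-- **Existence for (1.3) in the class `IsTaggedLinearBoltzmannSolution`, with the maximum
principle**: for `β > 0`, `α ≥ 0` and a continuous `0 ≤ ρ⁰ ≤ R` there is a solution `φ` of
BGSR's linear Boltzmann equation with `0 ≤ φ ≤ R`.
[cite: BodineauGallagherSaintRaymondInvent2016, (1.3) and Remark 3.5] -/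
theorem exists_isTaggedLinearBoltzmannSolution {β α : ℝ} (hβ : 0 < β) (hα : 0 ≤ α)
    {ρ₀ : 𝕋 → ℝ} (hρ₀ : Continuous ρ₀) (hρ₀0 : ∀ x, 0 ≤ ρ₀ x) {R : ℝ} (hR : ∀ x, ρ₀ x ≤ R) :
    ∃ φ : ℝ → 𝕋 → 𝔼 → ℝ, IsTaggedLinearBoltzmannSolution β α ρ₀ φ ∧
      ∀ t x v, 0 ≤ φ t x v ∧ φ t x v ≤ R :=
  ⟨_, isTaggedLinearBoltzmannSolution_linearBoltzmannSeries hβ hα hρ₀ hρ₀0 hR⟩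

/-! ### BGSR Theorem 2.2 reduces to convergence towards the explicit series solution -/

/-- *Statement predicate (UpperCamelCase, not a vendored fact):* the convergence half of BGSR
Theorem 2.2 at inverse mean free path `α`, with "the solution `φ_α` of (1.3)" instantiated as
the explicit collision series `linearBoltzmannSeries (Torus.geometry d) β α ρ⁰` constructed in
this file: along an exact Boltzmann–Grad sequence `(N_k + 1) ε_k^{d-1} = α`, for every `t > 0`
and `δ > 0`, eventually in `k`, `|f_{N_k}^{(1)}(t) - M_β φ_α(t)| ≤ δ` a.e. Together with the
well-posedness proved above it implies the sequence form `BgsrTheorem22At α` of the sibling file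
(`bgsrTheorem22At_of_series`); it is asserted nowhere in this file.
[cite: BodineauGallagherSaintRaymondInvent2016, Thm. 2.2 (2.9)] -/
def BgsrSeriesConvergenceAt (α : ℝ) : Prop :=
  ∀ (_hd : 2 ≤ Fintype.card d) {β : ℝ} (_hβ : 0 < β) (N : ℕ → ℕ) (ε : ℕ → ℝ),
    Literature.Analysis.FluidPDE.IsBoltzmannGradSequenceExact d α (fun k => N k + 1) ε → (∀ k, ε k < 2⁻¹) →
    ∀ ρ₀ : 𝕋 → ℝ, Continuous ρ₀ → (∀ x, 0 ≤ ρ₀ x) → ∫ x, ρ₀ x = 1 →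
    ∀ Φ : ∀ k, Literature.Analysis.FluidPDE.HardSphereFlow (Literature.Analysis.FluidPDE.Torus.geometry d) (ε k) (N k + 1),
      ∀ t, 0 < t → ∀ δ, 0 < δ → ∀ᶠ k in atTop, ∀ᵐ z : 𝕋 × 𝔼,
        |bgsrTaggedMarginal (Φ k) β ρ₀ t z.1 z.2 - Literature.Analysis.FunctionSpaces.maxwellianBeta β z.2 *
          linearBoltzmannSeries (Literature.Analysis.FluidPDE.Torus.geometry d) β α (fun x _ => ρ₀ x) t z.1 z.2| ≤ δ

/-- **Theorem 2.2 (sequence form) from convergence to the series solution.** Since the collision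
series is a solution of (1.3) in the class `IsTaggedLinearBoltzmannSolution β α ρ⁰`
(`isTaggedLinearBoltzmannSolution_linearBoltzmannSeries`), the existential over solutions in
`BgsrTheorem22At α` is witnessed by it: what remains of BGSR Thm 2.2 is the convergence
statement `BgsrSeriesConvergenceAt α` (BBGKY/Duhamel expansion, pruning, recollision control:
BGSR §§3–5). [cite: BodineauGallagherSaintRaymondInvent2016, Thm. 2.2] -/
theorem bgsrTheorem22At_of_series {α : ℝ} (h : BgsrSeriesConvergenceAt (d := d) α) :
    BgsrTheorem22At (d := d) α := by
  intro hd β hβ N ε hNε hε ρ₀ hρ₀ hρ₀0 hρ₀1 Φ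
  have hα : 0 ≤ α := by
    rw [← hNε.2.2 0]
    exact mul_nonneg (by positivity) (pow_nonneg (hNε.1 0).le _)
  obtain ⟨R, hR⟩ := exists_upper_bound_of_continuous hρ₀
  exact ⟨_, (isTaggedLinearBoltzmannSolution_linearBoltzmannSeries hβ hα hρ₀ hρ₀0 hR).1,
    h hd hβ N ε hNε hε ρ₀ hρ₀ hρ₀0 hρ₀1 Φ⟩

end Torus

/-! ## Uniqueness: the bounded continuous class is a uniqueness class for (1.3)

If `φ` is continuous and bounded on a slab `[0, T] × X × ℝ^d` and `M_β φ` is a mild solution of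
`∂ₜ g + v·∇ₓ g = Q_{αB}(g, M_β)`, then along characteristics `φ` solves the gain/loss equation
in integrating-factor form (variation of constants backwards, `expForm_of_eq_add_integral`), so
the difference `w` of two such solutions with the same datum satisfies `w = 𝒯 w`, whence
`|w| ≤ ‖w‖_∞ pₙ` for every `n` by positivity of `𝒯` (`pₙ` the collision tails of the
conservativity section) and `w = 0` since `pₙ → 0`. -/

section Unique

variable {X : Type*} [TopologicalSpace X] [LocallyCompactSpace X] [FirstCountableTopology X]
  {G : Literature.Analysis.FluidPDE.Geometry d X} {β α : ℝ}

omit [Fintype d] in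
/-- **From Duhamel's form to the integrating-factor form** on a slab: if `H`, `ψ` are
continuous on `[0, T]`, `κ ≥ 0` and `ψ(t) = ψ₀ + ∫₀ᵗ (H - κ ψ)` on `[0, T]`, then
`ψ(t) = e^{-κt} ψ₀ + ∫₀ᵗ e^{-κ(t-s)} H(s) ds` on `[0, T]` (the difference with the variation-of-
constants solution solves `δ = -κ ∫ δ`, hence `|δ| ≤ m (κt)ⁿ/n! → 0`). [folklore] -/
theorem expForm_of_eq_add_integral {κ ψ₀ T : ℝ} (hT : 0 ≤ T) {ψ H : ℝ → ℝ}
    (hH : ContinuousOn H (Icc 0 T)) (hψc : ContinuousOn ψ (Icc 0 T))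
    (hψ : ∀ t ∈ Icc 0 T, ψ t = ψ₀ + ∫ s in (0 : ℝ)..t, (H s - κ * ψ s)) {t : ℝ}
    (ht : t ∈ Icc 0 T) :
    ψ t = exp (-(κ * t)) * ψ₀ + ∫ s in (0 : ℝ)..t, exp (-(κ * (t - s))) * H s := by
  -- continuous extension of `H` and the variation-of-constants solution `Ψ`
  set Hx : ℝ → ℝ := fun s => H (projIcc 0 T hT s) with hHx_def
  have hHxc : Continuous Hx := hH.restrict.comp continuous_projIcc
  have hHx_eq : ∀ s ∈ Icc 0 T, Hx s = H s := fun s hs => by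
    simp only [hHx_def, projIcc_of_mem hT hs]
  have hI : Continuous fun s => exp (κ * s) * Hx s := by fun_prop
  set Ψ : ℝ → ℝ := fun t => exp (-(κ * t)) * ψ₀ +
    exp (-(κ * t)) * ∫ s in (0 : ℝ)..t, exp (κ * s) * Hx s with hΨ_def
  have hΨexp : ∀ t, Ψ t = exp (-(κ * t)) * ψ₀ +
      ∫ s in (0 : ℝ)..t, exp (-(κ * (t - s))) * Hx s := fun t => by
    simp only [hΨ_def]
    congr 1
    rw [← intervalIntegral.integral_const_mul]
    refine intervalIntegral.integral_congr fun s _ => ?_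
    rw [← mul_assoc, ← Real.exp_add, show -(κ * t) + κ * s = -(κ * (t - s)) by ring]
  have hΨc : Continuous Ψ := by
    have h1 : Continuous fun t => ∫ s in (0 : ℝ)..t, exp (κ * s) * Hx s :=
      continuous_iff_continuousAt.2 fun t => (hI.integral_hasStrictDerivAt 0 t).hasDerivAt.continuousAt
    simp only [hΨ_def]
    fun_prop
  have hΨ : ∀ t, 0 ≤ t → Ψ t = ψ₀ + ∫ s in (0 : ℝ)..t, (Hx s - κ * Ψ s) := fun t ht =>
    eq_add_integral_of_expForm hHxc (fun t _ => hΨexp t) ht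
  -- the difference `δ = ψ - Ψ` solves `δ(t) = -κ ∫₀ᵗ δ` on `[0, T]`
  set δ : ℝ → ℝ := fun t => ψ t - Ψ t with hδ_def
  have hδc : ContinuousOn δ (Icc 0 T) := hψc.sub hΨc.continuousOn
  have hδ : ∀ t ∈ Icc 0 T, δ t = -κ * ∫ s in (0 : ℝ)..t, δ s := fun t ht => by
    have hsub : Icc 0 t ⊆ Icc 0 T := Icc_subset_Icc_right ht.2
    have hi1 : IntervalIntegrable (fun s => H s - κ * ψ s) volume 0 t :=
      ((hH.sub (hψc.const_smul κ)).mono (by rwa [uIcc_of_le ht.1])).intervalIntegrable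
    have hi2 : IntervalIntegrable (fun s => Hx s - κ * Ψ s) volume 0 t :=
      ((hHxc.sub (continuous_const.mul hΨc)).intervalIntegrable _ _)
    simp only [hδ_def]
    rw [hψ t ht, hΨ t ht.1, add_sub_add_left_eq_sub, ← intervalIntegral.integral_sub hi1 hi2,
      ← intervalIntegral.integral_const_mul]
    refine intervalIntegral.integral_congr fun s hs => ?_
    rw [uIcc_of_le ht.1] at hs
    simp only [hHx_eq s (hsub hs)]
    ring
  -- iteration: `|δ t| ≤ m (|κ| t)^n / n!`
  obtain ⟨m, hm⟩ := (isCompact_Icc (a := (0 : ℝ)) (b := T)).exists_bound_of_continuousOn hδc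
  have hm0 : 0 ≤ m := (norm_nonneg _).trans (hm 0 ⟨le_rfl, hT⟩)
  have hiter : ∀ n : ℕ, ∀ t ∈ Icc 0 T, |δ t| ≤ m * (|κ| * t) ^ n / n.factorial := by
    intro n
    induction n with
    | zero =>
      intro t ht
      simpa using hm t ht
    | succ n ih =>
      intro t ht
      have hsub : Icc 0 t ⊆ Icc 0 T := Icc_subset_Icc_right ht.2
      rw [hδ t ht, abs_mul, abs_neg]
      have hcont : Continuous fun s => m * (|κ| * s) ^ n / n.factorial := by fun_prop
      have h1 : |∫ s in (0 : ℝ)..t, δ s| ≤ ∫ s in (0 : ℝ)..t, m * (|κ| * s) ^ n / n.factorial := by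
        refine (intervalIntegral.abs_integral_le_integral_abs ht.1).trans ?_
        refine intervalIntegral.integral_mono_on ht.1 ?_ (hcont.intervalIntegrable _ _)
          fun s hs => ih s (hsub hs)
        exact ((hδc.mono (by rwa [uIcc_of_le ht.1] : uIcc 0 t ⊆ Icc 0 T)).norm).intervalIntegrable
      have h2 : ∫ s in (0 : ℝ)..t, m * (|κ| * s) ^ n / n.factorial =
          m * |κ| ^ n / n.factorial * (t ^ (n + 1) / (n + 1)) := by
        have : (fun s => m * (|κ| * s) ^ n / n.factorial) =
            fun s => m * |κ| ^ n / n.factorial * s ^ n := by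
          funext s; rw [mul_pow]; ring
        rw [this, intervalIntegral.integral_const_mul, integral_pow]
        simp
      calc |κ| * |∫ s in (0 : ℝ)..t, δ s|
          ≤ |κ| * (m * |κ| ^ n / n.factorial * (t ^ (n + 1) / (n + 1))) := by
            rw [← h2]; exact mul_le_mul_of_nonneg_left h1 (abs_nonneg κ)
        _ = m * (|κ| * t) ^ (n + 1) / (n + 1).factorial := by
            rw [Nat.factorial_succ, Nat.cast_mul, mul_pow]
            field_simp
            push_cast
            ring
  -- `δ t = 0`
  have hδ0 : δ t = 0 := by
    have hlim : Tendsto (fun n : ℕ => m * ((|κ| * t) ^ n / n.factorial)) atTop (𝓝 (m * 0)) :=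
      (FloorSemiring.tendsto_pow_div_factorial_atTop (|κ| * t)).const_mul m
    rw [mul_zero] at hlim
    have habs : |δ t| ≤ 0 :=
      ge_of_tendsto hlim (Eventually.of_forall fun n => by
        rw [← mul_div_assoc]; exact hiter n t ht)
    exact abs_eq_zero.1 (le_antisymm habs (abs_nonneg _))
  -- conclude
  have hψΨ : ψ t = Ψ t := by simpa [hδ_def, sub_eq_zero] using hδ0
  rw [hψΨ, hΨexp t]
  congr 1
  refine intervalIntegral.integral_congr fun s hs => ?_
  rw [uIcc_of_le ht.1] at hs
  simp only [hHx_eq s (Icc_subset_Icc_right ht.2 hs)]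

/-- Subtraction rule for the gain operator on quadratically bounded measurable functions.
[folklore] -/
theorem linearBoltzmannGain_sub {β : ℝ} (hβ : 0 < β) {φ ψ : 𝔼 → ℝ} (hφ : Measurable φ)
    (hψ : Measurable ψ) {C D : ℝ} (hC : ∀ w, |φ w| ≤ C * (1 + ‖w‖ ^ 2))
    (hD : ∀ w, |ψ w| ≤ D * (1 + ‖w‖ ^ 2)) (v : 𝔼) :
    linearBoltzmannGain β (fun w => φ w - ψ w) v =
      linearBoltzmannGain β φ v - linearBoltzmannGain β ψ v := by
  have h := linearBoltzmannGain_add hβ hφ (hψ.const_mul (-1)) hC (D := D)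
    (fun w => by rw [abs_mul, abs_neg, abs_one, one_mul]; exact hD w) v
  simp only [linearBoltzmannGain_const_mul] at h
  have e : (fun w => φ w + -1 * ψ w) = fun w => φ w - ψ w := by funext w; ring
  rw [e] at h
  rw [h]
  ring

/-- **Domination**: `|φ| ≤ ψ` pointwise with `ψ` measurable and quadratically bounded implies
`|K⁺ φ| ≤ K⁺ ψ` (no measurability of `φ` needed). [folklore] -/
theorem abs_linearBoltzmannGain_le_of_abs_le {β : ℝ} (hβ : 0 < β) {φ ψ : 𝔼 → ℝ}
    (h : ∀ w, |φ w| ≤ ψ w) (hψ : Measurable ψ) {C : ℝ} (hC : ∀ w, |ψ w| ≤ C * (1 + ‖w‖ ^ 2))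
    (v : 𝔼) : |linearBoltzmannGain β φ v| ≤ linearBoltzmannGain β ψ v := by
  rw [linearBoltzmannGain_eq, linearBoltzmannGain_eq]
  have h1 := norm_integral_le_of_norm_le (integrable_integral_gainIntegrand_quad hβ hψ hC v)
    (Eventually.of_forall fun w => show ‖∫ ν, gainIntegrand β φ v w ν ∂sphereMeasure‖ ≤
      ∫ ν, gainIntegrand β ψ v w ν ∂sphereMeasure from ?_)
  · rwa [Real.norm_eq_abs] at h1
  refine norm_integral_le_of_norm_le (integrable_gainIntegrand_sphere_quad hβ hψ hC v w)
    (Eventually.of_forall fun ν => ?_)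
  rw [Real.norm_eq_abs, gainIntegrand, gainIntegrand, abs_mul, abs_mul,
    abs_of_nonneg (hardSphereKernel_nonneg _ _), abs_of_pos (Literature.Analysis.FunctionSpaces.maxwellianBeta_pos hβ w)]
  exact mul_le_mul_of_nonneg_left (h _)
    (mul_nonneg (hardSphereKernel_nonneg _ _) (Literature.Analysis.FunctionSpaces.maxwellianBeta_pos hβ w).le)

omit [LocallyCompactSpace X] [FirstCountableTopology X] in
/-- Continuity on `[0, T]` of the gain term `τ ↦ K⁺ φ(τ, y(τ), ·)(v)` for `φ` continuous and
bounded on the slab and a continuous curve `y` (clamp `τ` to `[0, T]` and use parametric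
continuity). [folklore] -/
theorem continuousOn_gain_comp (hβ : 0 < β) {φ : ℝ → X → 𝔼 → ℝ} {T : ℝ} (hT : 0 ≤ T)
    (hφc : ContinuousOn (fun p : ℝ × X × 𝔼 => φ p.1 p.2.1 p.2.2) (Icc 0 T ×ˢ univ))
    {C : ℝ} (hφb : ∀ t ∈ Icc 0 T, ∀ x v, |φ t x v| ≤ C) {y : ℝ → X} (hy : Continuous y) (v : 𝔼) :
    ContinuousOn (fun τ => linearBoltzmannGain β (fun w => φ τ (y τ) w) v) (Icc 0 T) := by
  set cl : ℝ → ℝ := fun τ => (projIcc 0 T hT τ : ℝ) with hcl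
  have hclc : Continuous cl := continuous_subtype_val.comp continuous_projIcc
  have hclm : ∀ τ, cl τ ∈ Icc 0 T := fun τ => (projIcc 0 T hT τ).2
  have hcl_eq : ∀ τ ∈ Icc 0 T, cl τ = τ := fun τ hτ => by simp only [hcl, projIcc_of_mem hT hτ]
  have hh : Continuous fun p : ℝ × 𝔼 => φ (cl p.1) (y (cl p.1)) p.2 := by
    have hmap : Continuous fun p : ℝ × 𝔼 => (cl p.1, y (cl p.1), p.2) :=
      (hclc.comp continuous_fst).prodMk (((hy.comp (hclc.comp continuous_fst))).prodMk continuous_snd)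
    exact hφc.comp_continuous hmap fun p => ⟨hclm _, mem_univ _⟩
  have hcont := continuous_linearBoltzmannGain_param (Y := ℝ) hβ
    (h := fun τ w => φ (cl τ) (y (cl τ)) w) hh (fun τ _ => hφb _ (hclm τ) _ _)
    (continuous_const (y := v))
  refine hcont.continuousOn.congr fun τ hτ => ?_
  simp only [hcl_eq τ hτ]

omit [Fintype d] [LocallyCompactSpace X] [FirstCountableTopology X] in
/-- Continuity on `[0, T]` of `τ ↦ φ(τ, y(τ), v)`. [folklore] -/
theorem continuousOn_comp_curve {φ : ℝ → X → 𝔼 → ℝ} {T : ℝ}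
    (hφc : ContinuousOn (fun p : ℝ × X × 𝔼 => φ p.1 p.2.1 p.2.2) (Icc 0 T ×ˢ univ))
    {y : ℝ → X} (hy : Continuous y) (v : 𝔼) :
    ContinuousOn (fun τ => φ τ (y τ) v) (Icc 0 T) :=
  hφc.comp (continuousOn_id.prodMk ((hy.continuousOn).prodMk continuousOn_const))
    fun _ hτ => ⟨hτ, mem_univ _⟩

omit [LocallyCompactSpace X] [FirstCountableTopology X] in
/-- Measurability in `w` of `φ(s, y, ·)` for `φ` continuous on the slab, `s ∈ [0, T]`. [folklore] -/
theorem measurable_slab_section {φ : ℝ → X → 𝔼 → ℝ} {T : ℝ}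
    (hφc : ContinuousOn (fun p : ℝ × X × 𝔼 => φ p.1 p.2.1 p.2.2) (Icc 0 T ×ˢ univ))
    {s : ℝ} (hs : s ∈ Icc 0 T) (y : X) : Measurable fun w => φ s y w :=
  (hφc.comp_continuous (continuous_const.prodMk (continuous_const.prodMk continuous_id))
    fun _ => ⟨hs, mem_univ _⟩).measurable

omit [LocallyCompactSpace X] [FirstCountableTopology X] in
/-- Interval integrability on `[0, t] ⊆ [0, T]` of the damped gain term along a continuous
curve, for `φ` continuous and bounded on the slab. [folklore] -/
theorem intervalIntegrable_expGain (hβ : 0 < β) {φ : ℝ → X → 𝔼 → ℝ} {T : ℝ} (hT : 0 ≤ T)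
    (hφc : ContinuousOn (fun p : ℝ × X × 𝔼 => φ p.1 p.2.1 p.2.2) (Icc 0 T ×ˢ univ))
    {C : ℝ} (hφb : ∀ t ∈ Icc 0 T, ∀ x v, |φ t x v| ≤ C) {y : ℝ → X} (hy : Continuous y) (v : 𝔼)
    {t : ℝ} (ht : t ∈ Icc 0 T) :
    IntervalIntegrable (fun s => exp (-(α * TaggedSphereDiffusion.collisionFrequency β v * (t - s))) *
      (α * linearBoltzmannGain β (fun w => φ s (y s) w) v)) volume 0 t := by
  have h1 : ContinuousOn (fun s => exp (-(α * TaggedSphereDiffusion.collisionFrequency β v * (t - s)))) (uIcc 0 t) :=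
    (by fun_prop : Continuous fun s => exp (-(α * TaggedSphereDiffusion.collisionFrequency β v * (t - s)))).continuousOn
  refine (h1.mul (continuousOn_const.mul ((continuousOn_gain_comp hβ hT hφc hφb hy v).mono ?_))
    ).intervalIntegrable
  rw [uIcc_of_le ht.1]
  exact Icc_subset_Icc_right ht.2

omit [LocallyCompactSpace X] [FirstCountableTopology X] in
/-- **Integrating-factor form of a mild solution in the bounded continuous class.** If `φ` is
continuous and bounded on `[0, T] × X × ℝ^d` and `M_β φ` is a mild solution of
`∂ₜ g + v·∇ₓ g = Q_{αB}(g, M_β)` on `[0, T]`, then for `t ∈ [0, T]`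
`φ(t, x + tv, v) = e^{-α a(v) t} φ(0, x, v) + ∫₀ᵗ e^{-α a(v)(t-s)} α K⁺φ(s, x + sv, ·)(v) ds`.
[folklore] -/
theorem expForm_of_isMildLinearBoltzmannSolutionOn
    (hG : Continuous fun p : X × 𝔼 => G.translate p.1 p.2) (hβ : 0 < β)
    {φ : ℝ → X → 𝔼 → ℝ} {T : ℝ} (hT : 0 ≤ T)
    (hφc : ContinuousOn (fun p : ℝ × X × 𝔼 => φ p.1 p.2.1 p.2.2) (Icc 0 T ×ˢ univ))
    {C : ℝ} (hφb : ∀ t ∈ Icc 0 T, ∀ x v, |φ t x v| ≤ C)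
    (hm : Literature.Analysis.FunctionSpaces.IsMildLinearBoltzmannSolutionOn T G (α • hardSphereKernel)
      (Literature.Analysis.FunctionSpaces.maxwellianBeta β) fun t x v => Literature.Analysis.FunctionSpaces.maxwellianBeta β v * φ t x v)
    (x : X) (v : 𝔼) {t : ℝ} (ht : t ∈ Icc 0 T) :
    φ t (G.translate x (t • v)) v = exp (-(α * TaggedSphereDiffusion.collisionFrequency β v * t)) * φ 0 x v +
      ∫ s in (0 : ℝ)..t, exp (-(α * TaggedSphereDiffusion.collisionFrequency β v * (t - s))) *
        (α * linearBoltzmannGain β (fun w => φ s (G.translate x (s • v)) w) v) := by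
  have hy : Continuous fun τ : ℝ => G.translate x (τ • v) :=
    hG.comp (continuous_const.prodMk (continuous_id.smul continuous_const))
  set ψ : ℝ → ℝ := fun τ => φ τ (G.translate x (τ • v)) v with hψ_def
  set H : ℝ → ℝ := fun τ => α * linearBoltzmannGain β
    (fun w => φ τ (G.translate x (τ • v)) w) v with hH_def
  have hHc : ContinuousOn H (Icc 0 T) :=
    continuousOn_const.mul (continuousOn_gain_comp hβ hT hφc hφb hy v)
  have hψc : ContinuousOn ψ (Icc 0 T) := continuousOn_comp_curve hφc hy v
  have hψ : ∀ τ ∈ Icc 0 T, ψ τ = φ 0 x v +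
      ∫ s in (0 : ℝ)..τ, (H s - α * TaggedSphereDiffusion.collisionFrequency β v * ψ s) := fun τ hτ => by
    have hd := hm.duhamel x v τ hτ
    simp only [Literature.Analysis.FluidPDE.alongFlow] at hd
    have hI : ∫ s in (0 : ℝ)..τ, Literature.Analysis.FunctionSpaces.linearCollisionTerm (α • hardSphereKernel)
        (Literature.Analysis.FunctionSpaces.maxwellianBeta β) (fun t x v => Literature.Analysis.FunctionSpaces.maxwellianBeta β v * φ t x v) s
        (G.translate x (s • v)) v =
        ∫ s in (0 : ℝ)..τ, Literature.Analysis.FunctionSpaces.maxwellianBeta β v * (H s - α * TaggedSphereDiffusion.collisionFrequency β v * ψ s) := by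
      refine intervalIntegral.integral_congr fun s hs => ?_
      rw [uIcc_of_le hτ.1] at hs
      have hs' : s ∈ Icc 0 T := ⟨hs.1, hs.2.trans hτ.2⟩
      rw [Literature.Analysis.FunctionSpaces.linearCollisionTerm_apply, collisionOpWith_maxwellian_mul hβ α
        (measurable_slab_section hφc hs' _) (fun w => hφb s hs' _ w) v]
      simp only [hH_def, hψ_def]
      ring
    rw [hI, intervalIntegral.integral_const_mul, ← mul_add] at hd
    exact mul_left_cancel₀ (Literature.Analysis.FunctionSpaces.maxwellianBeta_pos hβ v).ne' hd
  have key := expForm_of_eq_add_integral (κ := α * TaggedSphereDiffusion.collisionFrequency β v) (ψ₀ := φ 0 x v)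
    hT hHc hψc hψ ht
  simpa only [hψ_def, hH_def] using key

/-- **Uniqueness in the bounded continuous class** (general geometry). Two functions `φ₁, φ₂`,
each continuous and bounded on `[0, T] × X × ℝ^d` with `M_β φᵢ` a mild solution of the linear
Boltzmann equation on `[0, T]`, and with the same datum, coincide on the slab: their difference
`w` satisfies `w = 𝒯 w`, hence `|w| ≤ ‖w‖_∞ pₙ → 0` by positivity of `𝒯` and conservativity.
[folklore] -/
theorem eq_of_isMildLinearBoltzmannSolutionOn
    (hG : Continuous fun p : X × 𝔼 => G.translate p.1 p.2) (hβ : 0 < β) (hα : 0 ≤ α)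
    {φ₁ φ₂ : ℝ → X → 𝔼 → ℝ} {T : ℝ} (hT : 0 ≤ T)
    (h1c : ContinuousOn (fun p : ℝ × X × 𝔼 => φ₁ p.1 p.2.1 p.2.2) (Icc 0 T ×ˢ univ))
    {C₁ : ℝ} (h1b : ∀ t ∈ Icc 0 T, ∀ x v, |φ₁ t x v| ≤ C₁)
    (h1m : Literature.Analysis.FunctionSpaces.IsMildLinearBoltzmannSolutionOn T G (α • hardSphereKernel)
      (Literature.Analysis.FunctionSpaces.maxwellianBeta β) fun t x v => Literature.Analysis.FunctionSpaces.maxwellianBeta β v * φ₁ t x v)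
    (h2c : ContinuousOn (fun p : ℝ × X × 𝔼 => φ₂ p.1 p.2.1 p.2.2) (Icc 0 T ×ˢ univ))
    {C₂ : ℝ} (h2b : ∀ t ∈ Icc 0 T, ∀ x v, |φ₂ t x v| ≤ C₂)
    (h2m : Literature.Analysis.FunctionSpaces.IsMildLinearBoltzmannSolutionOn T G (α • hardSphereKernel)
      (Literature.Analysis.FunctionSpaces.maxwellianBeta β) fun t x v => Literature.Analysis.FunctionSpaces.maxwellianBeta β v * φ₂ t x v)
    (h0 : ∀ x v, φ₁ 0 x v = φ₂ 0 x v) {t : ℝ} (ht : t ∈ Icc 0 T) (x : X) (v : 𝔼) :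
    φ₁ t x v = φ₂ t x v := by
  -- Step 1: `w = 𝒯 w` on the slab
  have hw : ∀ t ∈ Icc 0 T, ∀ (x : X) (v : 𝔼), φ₁ t x v - φ₂ t x v =
      ∫ s in (0 : ℝ)..t, exp (-(α * TaggedSphereDiffusion.collisionFrequency β v * (t - s))) *
        (α * linearBoltzmannGain β (fun w => φ₁ s (G.translate x ((s - t) • v)) w -
          φ₂ s (G.translate x ((s - t) • v)) w) v) := by
    intro t ht x v
    set x' := G.translate x (-t • v) with hx'
    have hx : G.translate x' (t • v) = x := by
      rw [hx', translate_translate_smul, neg_add_cancel, zero_smul, G.translate_zero]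
    have hy : ∀ s, G.translate x' (s • v) = G.translate x ((s - t) • v) := fun s => by
      rw [hx', translate_translate_smul]; congr 1; rw [show -t + s = s - t by ring]
    have e1 := expForm_of_isMildLinearBoltzmannSolutionOn hG hβ hT h1c h1b h1m x' v ht
    have e2 := expForm_of_isMildLinearBoltzmannSolutionOn hG hβ hT h2c h2b h2m x' v ht
    rw [hx] at e1 e2
    simp_rw [hy] at e1 e2
    have hyc : Continuous fun s : ℝ => G.translate x ((s - t) • v) :=
      hG.comp (continuous_const.prodMk ((continuous_id.sub continuous_const).smul continuous_const))
    rw [e1, e2, h0 x' v, add_sub_add_left_eq_sub,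
      ← intervalIntegral.integral_sub (intervalIntegrable_expGain hβ hT h1c h1b hyc v ht)
        (intervalIntegrable_expGain hβ hT h2c h2b hyc v ht)]
    refine intervalIntegral.integral_congr fun s hs => ?_
    rw [uIcc_of_le ht.1] at hs
    have hs' : s ∈ Icc 0 T := ⟨hs.1, hs.2.trans ht.2⟩
    rw [← mul_sub, ← mul_sub, linearBoltzmannGain_sub hβ (measurable_slab_section h1c hs' _)
      (measurable_slab_section h2c hs' _) (abs_le_quad_of_abs_le fun w => h1b s hs' _ w)
      (abs_le_quad_of_abs_le fun w => h2b s hs' _ w)]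
  -- Step 2: `|w| ≤ D pₙ` by induction
  set D := C₁ + C₂ with hD_def
  have hD : ∀ t ∈ Icc 0 T, ∀ (x : X) (v : 𝔼), |φ₁ t x v - φ₂ t x v| ≤ D := fun t ht x v =>
    (abs_sub _ _).trans (add_le_add (h1b t ht x v) (h2b t ht x v))
  have hiter : ∀ n : ℕ, ∀ t ∈ Icc 0 T, ∀ (x : X) (v : 𝔼),
      |φ₁ t x v - φ₂ t x v| ≤ D * collisionTail G β α n t x v := by
    intro n
    induction n with
    | zero => intro t ht x v; simpa using hD t ht x v
    | succ n ih =>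
      intro t ht x v
      have hpc := continuous_collisionTail hG hβ hα n
      have hpb := abs_collisionTail_le hG hβ hα n
      -- the majorant `D p_n` is admissible
      have hDpc : Continuous fun p : ℝ × X × 𝔼 => D * collisionTail G β α n p.1 p.2.1 p.2.2 :=
        continuous_const.mul hpc
      have hDpb : ∀ t x v, |D * collisionTail G β α n t x v| ≤ |D| * 1 := fun t x v => by
        rw [abs_mul]; exact mul_le_mul_of_nonneg_left (hpb t x v) (abs_nonneg _)
      rw [hw t ht x v, collisionTail_succ hG hβ hα, ← gainDuhamel_const_mul, gainDuhamel_eq,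
        max_eq_left ht.1, intervalIntegral.integral_of_le ht.1, intervalIntegral.integral_of_le ht.1]
      have hgi : IntegrableOn (gainDuhamelIntegrand G β α
          (fun t x v => D * collisionTail G β α n t x v) t x v) (Ioc 0 t) :=
        ((continuous_gainDuhamelIntegrand hG hβ α hDpc hDpb t x v).integrableOn_Icc).mono_set
          Ioc_subset_Icc_self
      refine (Real.norm_eq_abs _).symm.le.trans (norm_integral_le_of_norm_le hgi
        ((ae_restrict_iff' measurableSet_Ioc).2 (Eventually.of_forall fun s hs => ?_)))
      have hs' : s ∈ Icc 0 T := ⟨hs.1.le, hs.2.trans ht.2⟩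
      rw [Real.norm_eq_abs, gainDuhamelIntegrand, abs_mul, abs_of_pos (exp_pos _), abs_mul,
        abs_of_nonneg hα]
      refine mul_le_mul_of_nonneg_left (mul_le_mul_of_nonneg_left ?_ hα) (exp_pos _).le
      refine abs_linearBoltzmannGain_le_of_abs_le hβ (fun w => ih s hs' _ w)
        ((hDpc.comp (continuous_const.prodMk (continuous_const.prodMk continuous_id))).measurable)
        (abs_le_quad_of_abs_le fun w => hDpb _ _ _) v
  -- Step 3: `pₙ → 0`
  have hlim : Tendsto (fun n => D * collisionTail G β α n t x v) atTop (𝓝 (D * 0)) :=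
    (tendsto_collisionTail hG hβ hα t x v).const_mul D
  rw [mul_zero] at hlim
  have habs : |φ₁ t x v - φ₂ t x v| ≤ 0 :=
    ge_of_tendsto hlim (Eventually.of_forall fun n => hiter n t ht x v)
  exact sub_eq_zero.1 (abs_eq_zero.1 (le_antisymm habs (abs_nonneg _)))

end Unique

/-! ### Uniqueness and identification on the torus -/

section TorusUnique

local notation "𝕋" => UnitAddTorus d

/-- **`IsTaggedLinearBoltzmannSolution` is a uniqueness class** (BGSR: "`φ_α` is the solution
of the linear Boltzmann equation (1.3)"; the sibling file's claim that the bounded continuous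
class is a uniqueness class): for `β > 0`, `α ≥ 0`, two solutions with the same datum agree at
all times `t ≥ 0`. [cite: BodineauGallagherSaintRaymondInvent2016, (1.3)] -/
theorem IsTaggedLinearBoltzmannSolution.unique {β α : ℝ} (hβ : 0 < β) (hα : 0 ≤ α)
    {ρ₀ : 𝕋 → ℝ} {φ₁ φ₂ : ℝ → 𝕋 → 𝔼 → ℝ} (h₁ : IsTaggedLinearBoltzmannSolution β α ρ₀ φ₁)
    (h₂ : IsTaggedLinearBoltzmannSolution β α ρ₀ φ₂) {t : ℝ} (ht : 0 ≤ t) : φ₁ t = φ₂ t := by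
  have hG : Continuous fun p : 𝕋 × 𝔼 => (Literature.Analysis.FluidPDE.Torus.geometry d).translate p.1 p.2 := by
    change Continuous fun p : 𝕋 × 𝔼 => p.1 + Literature.Analysis.FunctionSpaces.Torus.proj p.2
    exact continuous_fst.add (Literature.Analysis.FunctionSpaces.Torus.continuous_proj.comp continuous_snd)
  obtain ⟨C₁, hC₁⟩ := h₁.bounded t ht
  obtain ⟨C₂, hC₂⟩ := h₂.bounded t ht
  funext x v
  exact eq_of_isMildLinearBoltzmannSolutionOn hG hβ hα ht (h₁.continuousOn t ht) hC₁ (h₁.mild t ht)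
    (h₂.continuousOn t ht) hC₂ (h₂.mild t ht) (fun x v => by rw [h₁.init, h₂.init])
    ⟨ht, le_rfl⟩ x v

/-- The datum of a solution in the class is continuous, nonnegative and bounded (from the
fields `init`, `continuousOn`, `mild.nonneg` and `bounded` at `T = 0`). [folklore] -/
theorem IsTaggedLinearBoltzmannSolution.datum {β α : ℝ} (hβ : 0 < β) {ρ₀ : 𝕋 → ℝ}
    {φ : ℝ → 𝕋 → 𝔼 → ℝ} (h : IsTaggedLinearBoltzmannSolution β α ρ₀ φ) :
    Continuous ρ₀ ∧ (∀ x, 0 ≤ ρ₀ x) ∧ ∃ R, ∀ x, ρ₀ x ≤ R := by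
  have h0 : ∀ x (v : 𝔼), φ 0 x v = ρ₀ x := fun x v => by rw [h.init]
  refine ⟨?_, fun x => ?_, ?_⟩
  · have hc := (h.continuousOn 0 le_rfl).comp_continuous
      (continuous_const.prodMk (continuous_id.prodMk continuous_const) :
        Continuous fun x : 𝕋 => ((0 : ℝ), x, (0 : 𝔼))) fun x => ⟨⟨le_rfl, le_rfl⟩, mem_univ _⟩
    simpa [Function.comp_def, h0] using hc
  · have := (h.mild 0 le_rfl).nonneg 0 ⟨le_rfl, le_rfl⟩ x 0
    rw [h0] at this
    exact nonneg_of_mul_nonneg_right (by simpa [mul_comm] using this)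
      (Literature.Analysis.FunctionSpaces.maxwellianBeta_pos hβ (0 : 𝔼))
  · obtain ⟨C, hC⟩ := h.bounded 0 le_rfl
    exact ⟨C, fun x => by simpa [h0] using (abs_le.1 (hC 0 ⟨le_rfl, le_rfl⟩ x 0)).2⟩

/-- **Identification**: for `β > 0`, `α ≥ 0`, every solution in the class
`IsTaggedLinearBoltzmannSolution β α ρ⁰` is the collision series at all `t ≥ 0` (its datum `ρ⁰`
is automatically continuous, nonnegative and bounded); in particular it satisfies the maximum
principle `0 ≤ φ(t) ≤ sup ρ⁰` (BGSR Remark 3.5).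
[cite: BodineauGallagherSaintRaymondInvent2016, (1.3) and Remark 3.5] -/
theorem IsTaggedLinearBoltzmannSolution.eq_linearBoltzmannSeries {β α : ℝ} (hβ : 0 < β)
    (hα : 0 ≤ α) {ρ₀ : 𝕋 → ℝ} {φ : ℝ → 𝕋 → 𝔼 → ℝ} (h : IsTaggedLinearBoltzmannSolution β α ρ₀ φ)
    {t : ℝ} (ht : 0 ≤ t) :
    φ t = linearBoltzmannSeries (Literature.Analysis.FluidPDE.Torus.geometry d) β α (fun x _ => ρ₀ x) t := by
  obtain ⟨hρ₀, hρ₀0, R, hR⟩ := h.datum hβ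
  exact h.unique hβ hα (isTaggedLinearBoltzmannSolution_linearBoltzmannSeries hβ hα hρ₀ hρ₀0 hR).1 ht

/-- **Maximum principle for the class** (BGSR Remark 3.5): every solution in
`IsTaggedLinearBoltzmannSolution β α ρ⁰` (`β > 0`, `α ≥ 0`) satisfies `0 ≤ φ(t, x, v) ≤ R` for
`t ≥ 0` whenever `ρ⁰ ≤ R`. [cite: BodineauGallagherSaintRaymondInvent2016, Remark 3.5] -/
theorem IsTaggedLinearBoltzmannSolution.mem_Icc {β α : ℝ} (hβ : 0 < β) (hα : 0 ≤ α)
    {ρ₀ : 𝕋 → ℝ} {φ : ℝ → 𝕋 → 𝔼 → ℝ} (h : IsTaggedLinearBoltzmannSolution β α ρ₀ φ) {R : ℝ}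
    (hR : ∀ x, ρ₀ x ≤ R) {t : ℝ} (ht : 0 ≤ t) (x : 𝕋) (v : 𝔼) :
    0 ≤ φ t x v ∧ φ t x v ≤ R := by
  obtain ⟨hρ₀, hρ₀0, -⟩ := h.datum hβ
  rw [h.eq_linearBoltzmannSeries hβ hα ht]
  exact (linearBoltzmannData_torus hβ hα hρ₀ hρ₀0 hR).linearBoltzmannSeries_mem t x v

end TorusUnique

end Hilbert6

end

end Literature.MathematicalPhysics.KineticTheory
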